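import Summits.AtomisticToContinuum.HydrodynamicLimit.Theses.OneFlightGossipEngine
import Summits.AtomisticToContinuum.HydrodynamicLimit.Theorems.BoltzmannGreenKubo.Negative.ForallN
import Summits.AtomisticToContinuum.HydrodynamicLimit.Theorems.BoltzmannGreenKubo.Negative.EnergyWitness
import Summits.AtomisticToContinuum.HydrodynamicLimit.Theorems.ShearStressHalfDrude.Negative.WithoutOrth
import Summits.AtomisticToContinuum.HydrodynamicLimit.Theorems.KineticFluxLdDecay.Negative.TiltBasics
import Summits.AtomisticToContinuum.HydrodynamicLimit.Theorems.CorrectorPressureDecay.Negative.Frame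
import Summits.AtomisticToContinuum.HydrodynamicLimit.Theorems.OneFlightGossipEngineKineticCurrentsWindowLDUniformClassTruncationReduced
import Summits.AtomisticToContinuum.HydrodynamicLimit.Theorems.AprioriBounds.Negative.ExpMomentTangent
import Literature.Analysis.FluidPDE.HardSphereAlexander
import Literature.Analysis.FluidPDE.HardSphereDynamicsProofs
import Literature.Analysis.FunctionSpaces.BMOCarlesonProofs

/-!
# Disproof work file — crux `KineticCurrentsWindowLDUniform` (stmt-AtomisticToContinuum-14662)

Standing adversary record (cdisprove seat `refuter-cdisprove-stmt-AtomisticToContinuum-14662-0`; route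
`OneFlightGossipEngine`, rank-3 docking node KCW). The crux: `∃ η₀ > 0 ∀` continuous `a, θ₀ > 0`, `u₀` `∀ σ > 0` with
`σ³·sup a ≤ η₀·∫a` `∀` flow families `Φ_N` `∀ F(x,v) = A(x):w⊗w + (b(x)·w) G(x,‖w‖²)`, `w = v − u₀(x)` (continuous,
`|F| ≤ C(1+‖v‖²)`, `F ⊥ 1, v_j, ‖v‖²` under `M_{1,u₀(x),θ₀(x)}` pointwise in `x`):
`∃ β₀ > 0 ∀ |β| ≤ β₀ ∀ ε > 0 ∃ τ > 0 ∃ N₀ ∀ N ≥ N₀: ∫ exp(β ∑ᵢ w_N⁻¹∫₀^{w_N} F(xᵢ(r),vᵢ(r)) dr) dλ^N ≤ e^{ε(N+1)}`,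
`w_N = τ(N+1)^{-1/3}`, `λ^N = localGibbsLaw σ a u₀ θ₀ N Φ_N`.

## Findings (cycle 1) — NO KILL; six refuted variants / structural lemmas PROVED (sorry-free below; landing as
`Theorems/KineticCurrentsWindowLDUniform/Negative/{ForallN, OrthRedundant, WindowFubini, WindowSum, TiltWindow, LoadBearing,
LoadBearingGrowth, LoadBearingOrthOne}.lean`; WindowFubini ACCEPTED p95258, ForallN p95174 / OrthRedundant p95215 queued for
review, the rest pending the farm rebuild of WindowFubini; all attached as item evidence)

* READ-BACK / JUNK AUDIT (no formalisation-level kill). `λ^N` is the normalised canonical local Gibbs measure,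
  a probability measure for `σ ≤ 1/2` (tree `isProbabilityMeasure_localGibbsMeasure`; the guard forces
  `σ³ ≤ η₀`); `λ^N ≪ Liouville`, so the junk values of `Φ.flow` off the good set are invisible and the dynamics is
  pinned a.e. by `IsHardSphereTrajectory` (elastic `collidePair`) — no junk-flow attack; flows are CONSTRUCTIBLE
  (tree Alexander theorem `HardSphereFlow.nonempty_torus_holds`), so the `∀ Φ` is not vacuous and every `¬`-lemma
  here is UNCONDITIONAL. Every junk direction favours the statement: a non-measurable integrand lowers `∫⁻`
  (lower integral), a non-`r`-integrable path functional gives interval integral `0`, only on null sets anyway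
  (good trajectories are piecewise free flight with conserved energy). `⨆ a`/`∫ a` fine (continuous on compact `𝕋³`,
  Haar probability). Exponential moments are finite for small `β` (`∑ᵢ F ≤ C(N+1) + 2C·E`, `E` conserved, Gaussian).
* THE CLASS (Gaussian moment algebra at fixed `x`, `θ = θ₀(x)`, `u = u₀(x)`, `R(x) = ⅓∫|w|²G(x,|w|²)M`):
  (1) `⊥ 1 ⇔ θ·tr A = 0`; (2) `⊥ v_j ⇔ u_j θ tr A + b_j R = 0`; (3) `⊥ ‖v‖² ⇔ θ(5θ + |u|²) tr A + 2(u·b)R = 0`.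
  Hence GIVEN (1),(2), hypothesis (3) is REDUNDANT — PROVED (§ 2, `orth_energy_of_orth_one_of_orth_mom`, and in
  the crux's exact form `kcw_orth_energy_redundant`; landing as `Negative/OrthRedundant.lean`): symmetrisation
  `F(u+√θξ)+F(u−√θξ) = 2θξᵀAξ`, reflections/swaps give `∫ξᵀAξ κ(‖ξ‖²)dγ = m_κ tr A`, and `∫FM = θ tr A`
  (`integral_classF`). Conversely (2),(3) force `tr A = 0` only where `|u₀|² ≠ 5θ₀`. Provers may discharge (3)
  for free; planners may delete it.
* § 1 `∃ N₀` IS LOAD-BEARING (PROVED, `not_kineticCurrentsWindowLDUniformAllN`): the `∀ N` strengthening is false —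
  one free sphere (`N = 0`) keeps `F = v₀v₁` frozen, the functional is the static moment `I(β)`, and
  `I(β₀) + I(−β₀) ≥ 2 + (β₀²/2) E[(v₀v₁)²] > 2e^{ε}` at `ε = log(1 + β₀² min(J,1)/8)`. Any proof must use collisions.
* § 3 `∃ β₀` IS LOAD-BEARING, QUANTITATIVELY (PROVED, `not_kineticCurrentsWindowLDUniformAllBeta`,
  `lintegral_exp_shear_window_eq_top`): by Donsker–Varadhan with the drifted homogeneous Gibbs law `G_N^{u₁}`
  (flow-INVARIANT, equal partition functions) the window functional obeys, for EVERY `N`, flow and window,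
  `∫ exp(∑ᵢ w⁻¹∫₀ʷ g(vᵢ)) dG_N ≥ exp((N+1)(E_{N(u₁,I)}g − ‖u₁‖²/2))` (`tilt_window_lower_bound`, any continuous
  `|g| ≤ C(1+‖v‖²)`). For `g = βv₀v₁`, drifts `(s,s,0)`: gain `βs²`, cost `s²` ⇒ `= +∞` for `β > 1`. So the static
  finiteness threshold `|β| < 1/(2θ₀λ_max(A_sym))` is NOT improved by time averaging: `β₀ ≤ 1/(2 sup θ₀ λ_max(A_sym))`
  uniformly in `τ`; a proof whose admissible `β`-range grows with `τ` is wrong.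
* § 4 `⊥ v_j` IS LOAD-BEARING (PROVED, `not_kineticCurrentsWindowLDUniformWithoutOrthMom`): `F = v₀` (`A = 0`,
  `b = e₀`, `G ≡ 1`; `⊥ 1, ‖v‖²`) has functional `≥ e^{(N+1)β²/2}` at every window and `N` (drift `βe₀`), beating
  `e^{ε(N+1)}` at `ε = β₀²/4` whatever `β₀ > 0`. (`⊥ 1`: within the class `⊥1 ⇔ ⊥‖v‖²` at `u₀ = 0`, so a witness
  needs `|u₀|² = 5θ₀` and `b ∥ u₀`; expected false by the same temperature/drift tilt — not formalised, low value.)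
* § 5 THE GROWTH CLAUSE IS LOAD-BEARING (PROVED, `not_kineticCurrentsWindowLDUniformWithoutGrowth`,
  `lintegral_exp_heat_window_eq_top`): the TRUE heat flux `F = v₀(‖v‖²−5)` (`A = 0`, `b = e₀`, `G(x,s) = s − 5`;
  continuous, `⊥ 1, v_j, ‖v‖²` — `E[v₀²‖v‖²] = 5`) has window functional `+∞` at EVERY `β > 0`, `N`, flow, window
  (drift `se₀`: gain `βs³`, cost `s²/2`): time averaging does not cure the cubic exponential moment (dynamic form of
  the `HighMomentumCutoff` kernel `lintegral_exp_cubic_eq_top`); the truncation `G = O(√s)` forced by the growth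
  clause is necessary and the untruncated energy current must be cut elsewhere (EnergyCurrentTails), as the route says.
  The tilt machinery is proved for any polynomial growth `|g| ≤ C(1+‖v‖²)^m`.
* § 6 `⊥ 1` IS LOAD-BEARING (PROVED, `not_kineticCurrentsWindowLDUniformWithoutOrthOne`): within the class `⊥v_j ∧ ⊥‖v‖²`
  force `tr A = 0` unless `|u₀|² = 5θ₀`, so the witness sits there: `θ₀ = 1`, `u₀ ≡ √5e₀`, `A = I`, `b ≡ −3√5e₀`, `G ≡ 1`,
  `F = ‖v−u₀‖² − 3√5(v−u₀)₀` (`⊥v_j`, `⊥‖v‖²` by `E‖ξ‖² = 3`, `Eξ₀² = 1`, `E‖ξ‖⁴ = 15`); the constant-drift reference law is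
  flow-invariant, Jensen + `integral_windowSum` give `≥ e^{3β(N+1)}` at every window (`∑ᵢFᵢ` is even a function of `(KE,P)`).
* LOAD-BEARING TABLE (all in Lean): `∃N₀` LB (§1) · `∃β₀` LB, `β₀ ≤ 1/(2 sup θ₀ λ_max)` (§3) · `⊥v_j` LB (§4) · growth
  clause LB (§5) · `⊥1` LB (§6) · `⊥‖v‖²` REDUNDANT (§2) · `η₀`-guard NOT refutably LB (dropping it makes the crux vacuously
  true at high density: `λ^N = 0`) · continuity/positivity clauses: technical.
* § 7 LINE ATTACK (paper; payload line `Sketch`, and the shared stub of the picked line `sigma-uniform-equilibrium-transfer`):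
  `stub_windowRenyi` (Rényi-`p` quasi-invariance of the local Gibbs law over a kinetic window) SURVIVES as typed (`∃ p` after the
  profiles) but NECESSARILY `p < R/(R−1)`, `R = sup θ₀/inf θ₀`: for `p ≥ R/(R−1)` the Rényi integral `∫ψ_r^pψ^{1−p}dL` is `+∞` at
  every `r > 0`, `N`, flow — data processing to the one-particle marginal, whose no-collision part is the free-streamed Maxwellian,
  and `M_{x−rv}^p M_x^{1−p}` has exponent `|v|²[(p−1)/2θ_min − p/2θ_max] → +∞` on a positive-density set of velocities (one fast
  particle streaming from the hottest to the coldest point; modulo the survival bound `≥ e^{−c(1+V)}`). Consequence: the Hölder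
  conjugate `q = p/(p−1) > R` multiplies `β` inside the frozen core, so the admissible `β`-range of S6 shrinks with the temperature
  contrast; drift/activity contrasts impose nothing. `stub_frozenEquilibriumCore` (global Gibbs, bounded class, `β₀(C)`) resists the
  drift/temperature tilts for `β₀ ≲ 1/(100C)` (gain second order `≤ C t²`, cost `t²/2`). Evidence: stubs-windowRenyi.md on the item.
* WHY THE CRUX RESISTS (for provers and planners).
  - Every STARVATION regime sits before `∃ τ`: `σ → 0` (free flight over the window: `τσ²` mean free times),
    `min a → 0` (local vacuum), `θ₀ → 0` (cold, slow collisions) — `τ = τ(η₀,a,θ₀,u₀,σ,Φ,F,β,ε)` compensates all.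
  - INVARIANT/LOCAL-EQUILIBRIUM TILTS GAIN ONLY AT SECOND ORDER: a bulk-velocity shift `U(x)` on a region costs
    `n_R|U|²/(2θ₀)` and gains `β n_R UᵀA U` (persisting through the window by local momentum conservation) —
    unprofitable iff `|β| < 1/(2θ₀λ_max(A))`, exactly the crux's `∃ β₀`; temperature tilts gain nothing on the
    `A`-part (`tr A = 0`) and only bilinearly `(U, δθ)` on the `b`-part against a positive-definite quadratic cost;
    density tilts gain nothing (`F ⊥ 1` pointwise and hard-sphere velocities are exactly Maxwellian at any density).
    § 3's `tilt_window_lower_bound` is the sharp form of this family: it certifies the clauses above as necessary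
    and CANNOT refute the crux.
  - QUADRATIC CONSERVED CHARGES (`P⊗P`, `E²`, Mazur): `⟨∑ᵢv_{i0}v_{i1} · P₀P₁⟩ = (N+1)θ² ≠ 0`, floor
    `⟨SQ⟩²/⟨Q²⟩ = θ²` in total = `O(1/N)` per particle; at LD scale the Galilean cost `|P|²/(2θ(N+1))` beats the gain
    `β|P|²/(2(N+1))` for `βθ < 1`. No kill.
  - HYDRODYNAMIC long-time tails `t^{-3/2}` (d = 3) are integrable: window variance `∼ 1/τ`; the persistent
    local-momentum part of the stress lives on cells of `n_c ∼ ρ v̄³τ³` particles, variance `θ²|A|²/n_c → 0`.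
  - LOCAL (non-constant) profiles: over the kinetic window `w_N → 0` the first Chapman–Enskog correction to
    `E[F_i]` is `O(√θ₀ · ω_{u₀}(ℓ_N)) → 0` per particle (uniform continuity of `u₀` suffices; no Lipschitz needed):
    `o(N)` in the mean, invisible at LD scale by Jensen. The `η₀`-uniformity only caps local packing (`≤ η₀`).
  - A counterexample therefore needs a finite-entropy-density, kinetic-time-quasi-stationary, NON-Maxwellian velocity
    structure of 3-d hard spheres at small density (a hidden extensive charge surviving `τσ²` collisions per
    particle, uniformly in `N`) — none is known; the exact witnesses (free gas `σ = 0`, one sphere `N = 0`, 1-d rods)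
    are all excluded by the statement. Same verdict as the sibling disprover of `KineticFluxLdDecay` (stmt-10967).
  - BARRIERS: `BoltzmannHypothesisBarrier` (classification of invariant states of the INFINITE system) is evaded in
    form (finite window, explicit data) but its free-gas kernel is exactly § 1's witness; `MazurBoundBallistic` gives
    only the `O(1/N)` floor above; `HighMomentumCutoff` does not bite (quadratic class, Gaussian reference).
* USED FROM THE TREE: Alexander flows; `flow_vel_eq`, `reflB`, `integral_stdGaussian_eq_zero_of_odd`
  (BoltzmannGreenKubo/Negative/ForallN); `lintegral_vel_localGibbsMeasure`, `integral_window_eq`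
  (ShearStressHalfDrude/Negative/WithoutOrth); `KineticFluxLdDecayTilt.*` (tilt identity, Jensen; TiltBasics);
  `measurePreserving_flow_localGibbsLaw_const`; `configEnergy_eq_holds`; `HardSphereFlowJointMeasurable`.

## HANDOFF (disprover): Negative/ files: ForallN (§1, p95174 queued), OrthRedundant (§2, p95215 queued), WindowFubini
(§3 part 1, p95258 ACCEPTED), WindowSum + TiltWindow (§3 parts 2–3) and LoadBearing (§§3–5 variants) to be proposed once
the farm has built WindowFubini. Sorried: nothing. Next regimes:
local-profile (`u₀ ≠ const`) tilt bounds need non-invariant reference laws (entropy production over the window) —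
research-level, the honest frontier of this crux.
-/

/-!
# `KineticCurrentsWindowLDUniform` for EVERY `N` (no `N₀`) is FALSE — one free sphere never decorrelates

Negative knowledge for the crux `OneFlightGossipEngine.KineticCurrentsWindowLDUniform`
(stmt-AtomisticToContinuum-14662, the docking node KCW of route `OneFlightGossipEngine`: finite-kinetic-window
large deviations of the kinetic fast currents `F(x,v) = A(x):w⊗w + (b(x)·w) G(x,|w|²)`, `w = v − u₀(x)`, from local
Gibbs data, `η₀`-uniformly), from the standing disprover's `Cruxes/KineticCurrentsWindowLDUniform/Disproof.lean` § 1.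

`KineticCurrentsWindowLDUniformAllN` is the crux VERBATIM with `∃ N₀, ∀ N ≥ N₀` strengthened to `∀ N`, and it is
FALSE. Witness: `η₀` arbitrary, `a = θ₀ = 1`, `u₀ = 0`, `σ = min(1/4, η₀, 1)` (so `σ³·sup a ≤ η₀ ∫a`), the Alexander
flows of the tree (`HardSphereFlow.nonempty_torus_holds`), `A = e₀ ⊗ e₁` (the kinetic shear stress `F = v₀v₁`, in the
crux's class: continuous, `|F| ≤ 1·(1+‖v‖²)`, orthogonal to `1, v_j, ‖v‖²` under `M_{1,0,1}` by the coordinate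
reflections `v₀ ↦ −v₀`, `v₁ ↦ −v₁`), `b = 0`, `G = 0`, and `N = 0`: ONE sphere flies freely on its good set
(`BoltzmannGreenKuboForallN.flow_vel_eq`, reused), so for every window `τ` the window average of `F` is `F(v)` itself
and the functional is the STATIC exponential moment `I(β) = ∫ e^{β v₀v₁} dγ` (one-body Gibbs expectations are
Gaussian, `ShearStressHalfDrudeNonCentred.lintegral_vel_localGibbsMeasure`, reused). By `e^{y} + e^{−y} ≥ 2 + y²/2`
(`CorrectorPressureDecayNegative.two_add_sq_div_two_le_exp_add_exp_neg`, reused),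
`I(β₀) + I(−β₀) ≥ 2 + (β₀²/2)·J` with `J = E_γ[(v₀v₁)²] > 0`, while the statement at BOTH admissible signs `β = ±β₀`
and `ε = log(1 + β₀² min(J,1)/8)` gives `I(±β₀) ≤ e^{ε}`, i.e. `2 + (β₀²/2) min(J,1) ≤ 2 + (β₀²/4) min(J,1)`: absurd.

Consequences for provers: (i) `N₀` is load-bearing — any proof must use the COLLISION mechanism quantitatively; no
argument insensitive to `N ≥ N₀` (equivalently valid for the ideal / one-particle gas) gives a pressure `< Λ_stat(β)`;
(ii) the static pressure per particle is `≥ log(1 + β²J/4) > 0` at every `β ≠ 0`, so the `τ`-window is what must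
bring it below `ε`; (iii) `gShear`, `gShear_orth_*`, `abs_gShear_le` give provers a ready-made non-trivial instance of the
crux's hypotheses. refuter-cdisprove-stmt-AtomisticToContinuum-14662-0.
-/

noncomputable section

namespace Summit.AtomisticToContinuum.HydrodynamicLimit.Cruxes.KineticCurrentsWindowLDUniform.Disproof
open Summit.AtomisticToContinuum.HydrodynamicLimit.Theorems

open MeasureTheory ProbabilityTheory Real
open scoped ENNReal InnerProductSpace
open Literature.Analysis.FluidPDE Literature.MathematicalPhysics.KineticTheory

namespace KineticCurrentsWindowLDUniformOneSphere

open BoltzmannGreenKuboForallN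
  (flow_vel_eq reflB reflB_apply integral_stdGaussian_eq_zero_of_odd norm_sq_eq_three)
open ShearStressHalfDrudeNonCentred (lintegral_vel_localGibbsMeasure)

/-! ### Frame, witness observable, Gaussian facts -/

/-- The hard-sphere flows of the crux: `N + 1` spheres of diameter `σ (N+1)^{-1/3}` on `𝕋³`. [folklore] -/
abbrev Flow (σ : ℝ) (N : ℕ) : Type :=
  HardSphereFlow (Torus.geometry (Fin 3)) (hsDiameter σ N) (N + 1)

/-- A hard-sphere flow family at reduced diameter `σ < 1/2`, from the tree's Alexander theorem on `𝕋³`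
(`HardSphereFlow.nonempty_torus_holds`): flows are CONSTRUCTIBLE, so every `¬`-lemma below is unconditional. [folklore] -/
def alexFlow {σ : ℝ} (hσ : 0 < σ) (hσ' : σ < 2⁻¹) (N : ℕ) : Flow σ N :=
  Classical.choice (HardSphereFlow.nonempty_torus_holds (d := Fin 3) (hsDiameter_pos hσ N)
    ((hsDiameter_le hσ.le N).trans_lt hσ') (N + 1))

/-- The shear-stress coefficient field `A ≡ e₀ ⊗ e₁` (constant in `x`; traceless). [folklore] -/
def A01 : T3 → Fin 3 → Fin 3 → ℝ := fun _ j k => if j = 0 ∧ k = 1 then 1 else 0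

/-- The kinetic shear stress `g(v) = v₀ v₁`. [folklore] -/
def gShear (v : V3) : ℝ := v 0 * v 1

/-- The shear stress is continuous. [folklore] -/
theorem continuous_gShear : Continuous gShear :=
  ((EuclideanSpace.proj (𝕜 := ℝ) (0 : Fin 3)).continuous).mul
    ((EuclideanSpace.proj (𝕜 := ℝ) (1 : Fin 3)).continuous)

/-- The crux functional `F` at `A = A01`, `b = 0`, `G = 0`, `u₀ = 0` is the shear stress `v₀ v₁`
(stated in the beta-normal form the crux produces after instantiation). [folklore] -/
theorem F_A01 (x : T3) (v : V3) :
    ((∑ j : Fin 3, ∑ k : Fin 3, A01 x j k * ((v - 0) j * (v - 0) k)) +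
      (∑ j : Fin 3, (0 : V3) j * (v - 0) j) * (0 : ℝ)) = gShear v := by
  simp [A01, gShear, Fin.sum_univ_three]

/-- `|v₀ v₁| ≤ 1 · (1 + ‖v‖²)`. [folklore] -/
theorem abs_gShear_le (v : V3) : |gShear v| ≤ 1 * (1 + ‖v‖ ^ 2) := by
  rw [gShear, one_mul, norm_sq_eq_three, abs_le]
  constructor <;> nlinarith [sq_nonneg (v 0 + v 1), sq_nonneg (v 0 - v 1), sq_nonneg (v 2)]

/-- `g` is odd under `v₀ ↦ -v₀`. [folklore] -/
theorem gShear_reflB_zero (w : V3) : gShear (reflB 0 w) = -gShear w := by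
  simp [gShear, reflB_apply]

/-- `g` is odd under `v₁ ↦ -v₁`. [folklore] -/
theorem gShear_reflB_one (w : V3) : gShear (reflB 1 w) = -gShear w := by
  simp [gShear, reflB_apply]

/-- Maxwellian-weighted Lebesgue integrals are standard-Gaussian integrals. [folklore] -/
theorem integral_mul_localMaxwellian_eq (h : V3 → ℝ) :
    ∫ v, h v * localMaxwellian 1 1 (0 : V3) v = ∫ v, h v ∂stdGaussian V3 := by
  rw [localMaxwellian_one_one_zero, integral_stdGaussian_eq_integral_mul_globalMaxwellian]
  simp_rw [mul_comm]

/-- Orthogonality of the shear stress to `1` (odd under `v₀ ↦ -v₀`). [folklore] -/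
theorem gShear_orth_one : ∫ v, gShear v * localMaxwellian 1 1 (0 : V3) v = 0 := by
  rw [integral_mul_localMaxwellian_eq]
  exact integral_stdGaussian_eq_zero_of_odd (reflB 0) gShear_reflB_zero

/-- Orthogonality of the shear stress to `v_j` (odd under `v₁ ↦ -v₁` for `j = 0`, under `v₀ ↦ -v₀` otherwise). [folklore] -/
theorem gShear_orth_mom (j : Fin 3) : ∫ v, gShear v * v j * localMaxwellian 1 1 (0 : V3) v = 0 := by
  rw [integral_mul_localMaxwellian_eq]
  fin_cases j
  · refine integral_stdGaussian_eq_zero_of_odd (reflB 1) fun w => ?_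
    simp [gShear, reflB_apply]
  · refine integral_stdGaussian_eq_zero_of_odd (reflB 0) fun w => ?_
    simp [gShear, reflB_apply]
  · refine integral_stdGaussian_eq_zero_of_odd (reflB 0) fun w => ?_
    simp [gShear, reflB_apply]

/-- Orthogonality of the shear stress to `‖v‖²` (odd under `v₀ ↦ -v₀`, which preserves the norm). [folklore] -/
theorem gShear_orth_energy : ∫ v, gShear v * ‖v‖ ^ 2 * localMaxwellian 1 1 (0 : V3) v = 0 := by
  rw [integral_mul_localMaxwellian_eq]
  refine integral_stdGaussian_eq_zero_of_odd (reflB 0) fun w => ?_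
  rw [gShear_reflB_zero, LinearIsometryEquiv.norm_map]
  ring

/-- `γ{v₀ v₁ ≠ 0} > 0`: Lebesgue measure is absolutely continuous w.r.t. the standard Gaussian
(positive Maxwellian density) and the set is open and nonempty. [folklore] -/
theorem stdGaussian_support_gShear_pos : 0 < stdGaussian V3 {w | gShear w ≠ 0} := by
  have hac : (volume : Measure V3) ≪ stdGaussian V3 := by
    rw [show stdGaussian V3 = _ from stdGaussian_eq_withDensity_globalMaxwellian_holds]
    exact withDensity_absolutelyContinuous'
      continuous_globalMaxwellian.measurable.ennreal_ofReal.aemeasurable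
      (Filter.Eventually.of_forall fun v => (ENNReal.ofReal_pos.2 (globalMaxwellian_pos v)).ne')
  have hopen : IsOpen {w : V3 | gShear w ≠ 0} := isOpen_ne_fun continuous_gShear continuous_const
  have hne : ({w : V3 | gShear w ≠ 0}).Nonempty := by
    refine ⟨WithLp.toLp 2 fun _ : Fin 3 => (1 : ℝ), ?_⟩
    simp [gShear]
  have hvol : (volume : Measure V3) {w | gShear w ≠ 0} ≠ 0 := (hopen.measure_pos volume hne).ne'
  exact pos_iff_ne_zero.2 fun h0 => hvol (hac h0)

/-- `J = ∫ ofReal(g²) dγ > 0`. [folklore] -/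
theorem lintegral_gShear_sq_pos : 0 < ∫⁻ w, ENNReal.ofReal (gShear w ^ 2) ∂stdGaussian V3 := by
  have hm : Measurable fun w : V3 => ENNReal.ofReal (gShear w ^ 2) :=
    (continuous_gShear.pow 2).measurable.ennreal_ofReal
  rw [lintegral_pos_iff_support hm]
  refine stdGaussian_support_gShear_pos.trans_le (measure_mono fun w hw => ?_)
  simp only [Set.mem_setOf_eq] at hw
  simp only [Function.mem_support, ne_eq, ENNReal.ofReal_eq_zero, not_le]
  positivity

/-! ### One sphere: the window functional is static -/

/-- For `N = 0` (ONE sphere, free flight on the good set) the kinetic-window functional of any velocity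
observable is its STATIC exponential moment, whatever the window. [folklore] -/
theorem window_N0_exp {σ : ℝ} (Φ : Flow σ 0) {w : ℝ} (hw : 0 < w) (β : ℝ) (Fv : V3 → ℝ) :
    ∫⁻ z, ENNReal.ofReal (Real.exp (β * ∑ i, w⁻¹ * ∫ r in (0 : ℝ)..w, Fv ((Φ.flow r z) i).2))
        ∂(localGibbsLaw σ (fun _ => 1) (fun _ => 0) (fun _ => 1) 0 Φ) =
      ∫⁻ z, ENNReal.ofReal (Real.exp (β * Fv ((z 0).2)))
        ∂(localGibbsLaw σ (fun _ => 1) (fun _ => 0) (fun _ => 1) 0 Φ) := by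
  have hgood : ∀ᵐ z ∂(localGibbsLaw σ (fun _ => 1) (fun _ => 0) (fun _ => 1) 0 Φ), z ∈ Φ.good := by
    unfold localGibbsLaw
    rw [particleLaw_eq]
    exact (withDensity_absolutelyContinuous _ _).ae_le Φ.ae_mem_good
  refine lintegral_congr_ae ?_
  filter_upwards [hgood] with z hz
  have hterm : ∀ i : Fin (0 + 1), w⁻¹ * ∫ r in (0 : ℝ)..w, Fv ((Φ.flow r z) i).2 = Fv ((z i).2) := by
    intro i
    have hint : ∫ r in (0 : ℝ)..w, Fv ((Φ.flow r z) i).2 = ∫ r in (0 : ℝ)..w, Fv ((z i).2) := by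
      refine intervalIntegral.integral_congr fun r hr => ?_
      rw [Set.uIcc_of_le hw.le] at hr
      rw [flow_vel_eq Φ hz hr.1 i]
    rw [hint, intervalIntegral.integral_const, smul_eq_mul, sub_zero, ← mul_assoc,
      inv_mul_cancel₀ hw.ne', one_mul]
  simp_rw [hterm]
  simp

/-- The static exponential moment `I(β) = ∫ ofReal(e^{β v₀ v₁}) dγ`. [folklore] -/
def Istat (β : ℝ) : ℝ≥0∞ := ∫⁻ w, ENNReal.ofReal (Real.exp (β * gShear w)) ∂stdGaussian V3

/-- `I(β) + I(-β) ≥ 2 + (β²/2) J` (`cosh ≥ 1 + x²/2` under the integral). [folklore] -/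
theorem two_add_le_Istat_add (β : ℝ) :
    2 + ENNReal.ofReal (β ^ 2 / 2) * ∫⁻ w, ENNReal.ofReal (gShear w ^ 2) ∂stdGaussian V3 ≤
      Istat β + Istat (-β) := by
  have hm1 : Measurable fun w : V3 => ENNReal.ofReal (Real.exp (β * gShear w)) :=
    ((continuous_const.mul continuous_gShear).rexp).measurable.ennreal_ofReal
  have hm2 : Measurable fun w : V3 => ENNReal.ofReal (gShear w ^ 2) :=
    (continuous_gShear.pow 2).measurable.ennreal_ofReal
  have hpt : ∀ w : V3, (2 : ℝ≥0∞) + ENNReal.ofReal (β ^ 2 / 2) * ENNReal.ofReal (gShear w ^ 2) ≤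
      ENNReal.ofReal (Real.exp (β * gShear w)) + ENNReal.ofReal (Real.exp (-β * gShear w)) := by
    intro w
    have e1 : (2 : ℝ≥0∞) + ENNReal.ofReal (β ^ 2 / 2) * ENNReal.ofReal (gShear w ^ 2) =
        ENNReal.ofReal (2 + β ^ 2 / 2 * gShear w ^ 2) := by
      rw [ENNReal.ofReal_add (by norm_num) (by positivity), ENNReal.ofReal_mul (by positivity),
        ENNReal.ofReal_ofNat]
    rw [e1, ← ENNReal.ofReal_add (Real.exp_pos _).le (Real.exp_pos _).le]
    refine ENNReal.ofReal_le_ofReal ?_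
    have := CorrectorPressureDecayNegative.two_add_sq_div_two_le_exp_add_exp_neg (β * gShear w)
    have e : β ^ 2 / 2 * gShear w ^ 2 = (β * gShear w) ^ 2 / 2 := by ring
    rw [e, show -β * gShear w = -(β * gShear w) by ring]
    exact this
  calc (2 : ℝ≥0∞) + ENNReal.ofReal (β ^ 2 / 2) * ∫⁻ w, ENNReal.ofReal (gShear w ^ 2) ∂stdGaussian V3
      = ∫⁻ w, (2 + ENNReal.ofReal (β ^ 2 / 2) * ENNReal.ofReal (gShear w ^ 2)) ∂stdGaussian V3 := by
        rw [lintegral_add_left measurable_const, lintegral_const, measure_univ, mul_one,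
          lintegral_const_mul _ hm2]
    _ ≤ ∫⁻ w, (ENNReal.ofReal (Real.exp (β * gShear w)) + ENNReal.ofReal (Real.exp (-β * gShear w)))
          ∂stdGaussian V3 := lintegral_mono hpt
    _ = Istat β + Istat (-β) := by
        rw [lintegral_add_left hm1]
        rfl

end KineticCurrentsWindowLDUniformOneSphere

open KineticCurrentsWindowLDUniformOneSphere
open ShearStressHalfDrudeNonCentred (lintegral_vel_localGibbsMeasure)

/-! ### The strengthening without `N₀` -/

/-- **A FALSE proposition — NOT a citable fact.** The crux `OneFlightGossipEngine.KineticCurrentsWindowLDUniform`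
(stmt-AtomisticToContinuum-14662) VERBATIM with the restriction to large `N` removed (`∃ N₀, ∀ N ≥ N₀` ↦ `∀ N`);
kept only as the statement that `not_kineticCurrentsWindowLDUniformAllN` negates (load-bearing analysis: collisions /
`N ≥ N₀` are necessary). [folklore] -/
def KineticCurrentsWindowLDUniformAllN : Prop :=
  ∃ η₀ : ℝ, 0 < η₀ ∧ ∀ (a θ₀ : Literature.MathematicalPhysics.KineticTheory.T3 → ℝ) (u₀ : Literature.MathematicalPhysics.KineticTheory.T3 → Literature.MathematicalPhysics.KineticTheory.V3), Continuous a → Continuous θ₀ → Continuous u₀ → (∀ x, 0 < a x) → (∀ x, 0 < θ₀ x) → ∀ σ : ℝ, 0 < σ → σ ^ 3 * (⨆ x, a x) ≤ η₀ * ∫ x, a x → ∀ Φ : (N : ℕ) → Literature.Analysis.FluidPDE.HardSphereFlow (Literature.Analysis.FluidPDE.Torus.geometry (Fin 3)) (Literature.MathematicalPhysics.KineticTheory.hsDiameter σ N) (N + 1), ∀ (A : Literature.MathematicalPhysics.KineticTheory.T3 → Fin 3 → Fin 3 → ℝ) (b : Literature.MathematicalPhysics.KineticTheory.T3 → Literature.MathematicalPhysics.KineticTheory.V3)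 (G : Literature.MathematicalPhysics.KineticTheory.T3 × ℝ → ℝ), Continuous A → Continuous b → Continuous G → (∃ C : ℝ, ∀ y : Literature.MathematicalPhysics.KineticTheory.T3 × Literature.MathematicalPhysics.KineticTheory.V3, |(fun y : Literature.MathematicalPhysics.KineticTheory.T3 × Literature.MathematicalPhysics.KineticTheory.V3 => ((∑ j : Fin 3, ∑ k : Fin 3, A y.1 j k * ((y.2 - u₀ y.1) j * (y.2 - u₀ y.1) k)) + (∑ j : Fin 3, b y.1 j * (y.2 - u₀ y.1) j) * G (y.1, ‖y.2 - u₀ y.1‖ ^ 2))) y| ≤ C * (1 + ‖y.2‖ ^ 2)) → (∀ x, ∫ v, (fun y : Literature.MathematicalPhysics.KineticTheory.T3 × Literature.MathematicalPhysics.KineticTheory.V3 => ((∑ j : Fin 3, ∑ k : Fin 3, A y.1 j k * ((y.2 - u₀ y.1) j * (y.2 - u₀ y.1) k)) + (∑ j : Fin 3, b y.1 j * (y.2 - u₀ y.1) j) * G (y.1, ‖y.2 - u₀ y.1‖ ^ 2))) (x, v) * Literature.Analysis.FluidPDE.localMaxwellian 1 (θ₀ x) (u₀ x) v = 0) → (∀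 x (j : Fin 3), ∫ v, (fun y : Literature.MathematicalPhysics.KineticTheory.T3 × Literature.MathematicalPhysics.KineticTheory.V3 => ((∑ j : Fin 3, ∑ k : Fin 3, A y.1 j k * ((y.2 - u₀ y.1) j * (y.2 - u₀ y.1) k)) + (∑ j : Fin 3, b y.1 j * (y.2 - u₀ y.1) j) * G (y.1, ‖y.2 - u₀ y.1‖ ^ 2))) (x, v) * v j * Literature.Analysis.FluidPDE.localMaxwellian 1 (θ₀ x) (u₀ x) v = 0) → (∀ x, ∫ v, (fun y : Literature.MathematicalPhysics.KineticTheory.T3 × Literature.MathematicalPhysics.KineticTheory.V3 => ((∑ j : Fin 3, ∑ k : Fin 3, A y.1 j k * ((y.2 - u₀ y.1) j * (y.2 - u₀ y.1) k)) + (∑ j : Fin 3, b y.1 j * (y.2 - u₀ y.1) j) * G (y.1, ‖y.2 - u₀ y.1‖ ^ 2))) (x, v) * ‖v‖ ^ 2 * Literature.Analysis.FluidPDE.localMaxwellian 1 (θ₀ x) (u₀ x) v = 0) → ∃ β₀ : ℝ, 0 < β₀ ∧ ∀ β : ℝ, |β| ≤ β₀ → ∀ ε : ℝ, 0 < ε →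 ∃ τ : ℝ, 0 < τ ∧ ∀ N : ℕ, ∫⁻ z, ENNReal.ofReal (Real.exp (β * ∑ i : Fin (N + 1), (τ * ((N : ℝ) + 1) ^ (-(1 / 3 : ℝ)))⁻¹ * ∫ r in (0 : ℝ)..(τ * ((N : ℝ) + 1) ^ (-(1 / 3 : ℝ))), (fun y : Literature.MathematicalPhysics.KineticTheory.T3 × Literature.MathematicalPhysics.KineticTheory.V3 => ((∑ j : Fin 3, ∑ k : Fin 3, A y.1 j k * ((y.2 - u₀ y.1) j * (y.2 - u₀ y.1) k)) + (∑ j : Fin 3, b y.1 j * (y.2 - u₀ y.1) j) * G (y.1, ‖y.2 - u₀ y.1‖ ^ 2))) (((Φ N).flow r z) i))) ∂(Literature.MathematicalPhysics.KineticTheory.localGibbsLaw σ a u₀ θ₀ N (Φ N)) ≤ ENNReal.ofReal (Real.exp (ε * ((N : ℝ) + 1)))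

/-- **THE "FOR EVERY `N`" STRENGTHENING IS FALSE** (so `∃ N₀` is load-bearing: no argument insensitive to
`N ≥ N₀` — equivalently valid for the ideal / one-particle gas — can prove the crux). Witness: `η₀` arbitrary,
`a = θ₀ = 1`, `u₀ = 0`, `σ = min(1/4, η₀, 1)`, the Alexander flows, `A = e₀ ⊗ e₁` (`F = v₀v₁`), `b = 0`, `G = 0`;
at `N = 0` the single sphere flies freely, the window average of `F` is `F(v)` for every `τ`, and
`I(β₀) + I(-β₀) ≥ 2 + (β₀²/2)·J`, `J = E_γ[(v₀v₁)²] > 0`, contradicts the bound `≤ e^{ε}` at BOTH signs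
`β = ±β₀` once `2e^{ε} < 2 + (β₀²/2) J`. [folklore] -/
theorem not_kineticCurrentsWindowLDUniformAllN : ¬ KineticCurrentsWindowLDUniformAllN := by
  rintro ⟨η₀, hη₀, h⟩
  -- parameters
  set σ : ℝ := min (1 / 4) (min η₀ 1) with hσdef
  have hσpos : 0 < σ := lt_min (by norm_num) (lt_min hη₀ one_pos)
  have hσ4 : σ ≤ 1 / 4 := min_le_left _ _
  have hση : σ ≤ η₀ := (min_le_right _ _).trans (min_le_left _ _)
  have hσ1 : σ ≤ 1 := (min_le_right _ _).trans (min_le_right _ _)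
  have hσhalf : σ ≤ 1 / 2 := hσ4.trans (by norm_num)
  have hσhalf' : σ < 2⁻¹ := hσ4.trans_lt (by norm_num)
  have hguard : σ ^ 3 * (⨆ _x : T3, (1 : ℝ)) ≤ η₀ * ∫ _x : T3, (1 : ℝ) := by
    have hsup : (⨆ _x : T3, (1 : ℝ)) = 1 := ciSup_const
    have hint : ∫ _x : T3, (1 : ℝ) = 1 := by simp
    rw [hsup, hint, mul_one, mul_one]
    calc σ ^ 3 ≤ σ := by
          have : σ ^ 3 ≤ σ ^ 1 := pow_le_pow_of_le_one hσpos.le hσ1 (by norm_num)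
          simpa using this
      _ ≤ η₀ := hση
  have hmain := h (fun _ => 1) (fun _ => 1) (fun _ => 0) continuous_const continuous_const
    continuous_const (fun _ => one_pos) (fun _ => one_pos) σ hσpos hguard (alexFlow hσpos hσhalf')
    A01 (fun _ => 0) (fun _ => 0) continuous_const continuous_const continuous_const
  have hmain' : (∃ C : ℝ, ∀ y : T3 × V3, |gShear y.2| ≤ C * (1 + ‖y.2‖ ^ 2)) →
      (∀ x : T3, ∫ v, gShear v * localMaxwellian 1 1 (0 : V3) v = 0) →
      (∀ (x : T3) (j : Fin 3), ∫ v, gShear v * v j * localMaxwellian 1 1 (0 : V3) v = 0) →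
      (∀ x : T3, ∫ v, gShear v * ‖v‖ ^ 2 * localMaxwellian 1 1 (0 : V3) v = 0) →
      ∃ β₀ : ℝ, 0 < β₀ ∧ ∀ β : ℝ, |β| ≤ β₀ → ∀ ε : ℝ, 0 < ε → ∃ τ : ℝ, 0 < τ ∧ ∀ N : ℕ,
        ∫⁻ z, ENNReal.ofReal (Real.exp (β * ∑ i : Fin (N + 1), (τ * ((N : ℝ) + 1) ^ (-(1 / 3 : ℝ)))⁻¹ *
          ∫ r in (0 : ℝ)..(τ * ((N : ℝ) + 1) ^ (-(1 / 3 : ℝ))),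
            gShear (((alexFlow hσpos hσhalf' N).flow r z) i).2))
          ∂(localGibbsLaw σ (fun _ => 1) (fun _ => 0) (fun _ => 1) N (alexFlow hσpos hσhalf' N)) ≤
        ENNReal.ofReal (Real.exp (ε * ((N : ℝ) + 1))) := by
    simpa only [F_A01] using hmain
  clear hmain h
  obtain ⟨β₀, hβ₀, hβ⟩ := hmain' ⟨1, fun y => abs_gShear_le y.2⟩ (fun _ => gShear_orth_one)
    (fun _ j => gShear_orth_mom j) (fun _ => gShear_orth_energy)
  -- the positive second moment, truncated to be finite
  set J : ℝ≥0∞ := ∫⁻ w, ENNReal.ofReal (gShear w ^ 2) ∂stdGaussian V3 with hJ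
  set J' : ℝ≥0∞ := min J 1 with hJ'
  have hJ'pos : 0 < J' := lt_min lintegral_gShear_sq_pos one_pos
  have hJ'top : J' ≠ ⊤ := (min_le_right _ _).trans_lt ENNReal.one_lt_top |>.ne
  have hJ'le : J' ≤ J := min_le_left _ _
  set j : ℝ := J'.toReal with hj
  have hjpos : 0 < j := ENNReal.toReal_pos hJ'pos.ne' hJ'top
  set ε : ℝ := Real.log (1 + β₀ ^ 2 / 8 * j) with hεdef
  have hc : 0 < β₀ ^ 2 / 8 * j := by positivity
  have hε : 0 < ε := Real.log_pos (by linarith)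
  have hexpε : Real.exp ε = 1 + β₀ ^ 2 / 8 * j := by
    rw [hεdef, Real.exp_log (by linarith)]
  -- the two signs
  have key : ∀ β : ℝ, |β| ≤ β₀ → Istat β ≤ ENNReal.ofReal (Real.exp ε) := by
    intro β hβle
    obtain ⟨τ, hτ, hN⟩ := hβ β hβle ε hε
    have h0 := hN 0
    have hw : (τ * (((0 : ℕ) : ℝ) + 1) ^ (-(1 / 3 : ℝ))) = τ := by simp
    rw [hw] at h0
    rw [window_N0_exp (alexFlow hσpos hσhalf' 0) hτ β gShear, localGibbsLaw_eq,
      lintegral_vel_localGibbsMeasure hσhalf 0 0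
        (H := fun w => ENNReal.ofReal (Real.exp (β * gShear w)))
        (((continuous_const.mul continuous_gShear).rexp).measurable.ennreal_ofReal)] at h0
    unfold Istat
    simpa using h0
  have k1 := key β₀ (by rw [abs_of_pos hβ₀])
  have k2 := key (-β₀) (by rw [abs_neg, abs_of_pos hβ₀])
  have hsum := (two_add_le_Istat_add β₀).trans (add_le_add k1 k2)
  -- compare in `ℝ≥0∞`
  have hL : (2 : ℝ≥0∞) + ENNReal.ofReal (β₀ ^ 2 / 2) * J' ≤ 2 + ENNReal.ofReal (β₀ ^ 2 / 2) * J :=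
    add_le_add le_rfl (mul_le_mul' le_rfl hJ'le)
  have hfin := hL.trans hsum
  have hJ'j : J' = ENNReal.ofReal j := by rw [hj, ENNReal.ofReal_toReal hJ'top]
  have hlhs : (2 : ℝ≥0∞) + ENNReal.ofReal (β₀ ^ 2 / 2) * J' = ENNReal.ofReal (2 + β₀ ^ 2 / 2 * j) := by
    rw [hJ'j, ENNReal.ofReal_add (by norm_num) (by positivity), ENNReal.ofReal_mul (by positivity),
      ENNReal.ofReal_ofNat]
  have hrhs : ENNReal.ofReal (Real.exp ε) + ENNReal.ofReal (Real.exp ε) =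
      ENNReal.ofReal (2 + β₀ ^ 2 / 4 * j) := by
    rw [← ENNReal.ofReal_add (Real.exp_pos _).le (Real.exp_pos _).le, hexpε]
    congr 1
    ring
  rw [hlhs, hrhs, ENNReal.ofReal_le_ofReal_iff (by positivity)] at hfin
  nlinarith [hfin, hjpos, hβ₀, sq_nonneg β₀, mul_pos (pow_pos hβ₀ 2) hjpos]


end Summit.AtomisticToContinuum.HydrodynamicLimit.Cruxes.KineticCurrentsWindowLDUniform.Disproof

end


/-!
# `KineticCurrentsWindowLDUniform`: the hypothesis `F ⊥ ‖v‖²` is REDUNDANT (implied by `F ⊥ 1` and `F ⊥ v_j`)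

Structural (positive) knowledge about the HYPOTHESES of the crux `OneFlightGossipEngine.KineticCurrentsWindowLDUniform`
(stmt-AtomisticToContinuum-14662), from the standing disprover's `Cruxes/KineticCurrentsWindowLDUniform/Disproof.lean`
§ 2 (it asserts no Theses decl). For the crux's class `F(v) = ∑_{jk} A_{jk} w_j w_k + (∑_j b_j w_j) G(‖w‖²)`,
`w = v − u`, with `|F| ≤ C(1 + ‖v‖²)` and `G` continuous, at a fixed point `x` (`u = u₀(x)`, `θ = θ₀(x) > 0`):
`∫ F M_{1,u,θ} = 0` and `∫ F v_k M_{1,u,θ} = 0 (k = 0,1,2)` IMPLY `∫ F ‖v‖² M_{1,u,θ} = 0`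
(`orth_energy_of_orth_one_of_orth_mom`), hence the crux's third orthogonality hypothesis follows from the first
two (`kcw_orth_energy_redundant`, in the exact form of the crux). Proof (Gaussian moment algebra, values not
needed): after `v = u + √θ ξ`, `ξ ∼ γ`, `‖v‖² = θ‖ξ‖² + 2⟪v,u⟫ − ‖u‖²` reduces `∫F‖v‖²M` to `θ ∫ F(u+√θξ)‖ξ‖² dγ`;
symmetrising in `ξ ↦ −ξ` kills the odd `b`-part: `F(u+√θξ) + F(u−√θξ) = 2θ ξᵀAξ`; off-diagonal moments
`E[ξ_jξ_k κ(‖ξ‖²)]` vanish by the coordinate reflections and the diagonal ones agree by coordinate swaps, so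
`∫ ξᵀAξ · κ(‖ξ‖²) dγ = m_κ · tr A`; the first hypothesis gives `θ · tr A · E[ξ₀²] = 0`, so `tr A = 0` and
everything vanishes (reflections/swaps and `integral_quad_weight` reused from the line's
`…ClassTruncationGauss/Reduced` helper files, which adapted them from this seat's Disproof.lean). By-product:
`∫ F M_{1,u,θ} = θ tr A` (`integral_classF`). Consequences: provers may discharge
hypothesis (3) of KCW for free when applying it; planners may delete it. refuter-cdisprove-stmt-AtomisticToContinuum-14662-0.
-/

noncomputable section

namespace Summit.AtomisticToContinuum.HydrodynamicLimit.Cruxes.KineticCurrentsWindowLDUniform.Disproof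
open Summit.AtomisticToContinuum.HydrodynamicLimit.Theorems
namespace KineticCurrentsWindowLDUniformClass

open MeasureTheory ProbabilityTheory Real
open scoped ENNReal InnerProductSpace
open Literature.Analysis.FluidPDE Literature.MathematicalPhysics.KineticTheory
open BoltzmannGreenKuboForallN (reflB reflB_apply integral_stdGaussian_eq_zero_of_odd norm_sq_eq_three inner_eq_three)
open KineticFluxLdDecayTilt (integral_comp_linearIsometryEquiv_stdGaussian)
open KineticCurrentsWindowLDUniformSketch.ClassTruncation (integral_offdiag_eq_zero integral_diag_eq
  integral_quad_weight integral_mul_localMaxwellian_shift)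

/-! ### The class functional at a point and its reduced quadratic part -/

/-- The crux's functional at a fixed macroscopic point: `F(v) = ∑ A_{jk} w_j w_k + (∑ b_j w_j) G(‖w‖²)`, `w = v − u`. -/
def classF (u : V3) (A : Fin 3 → Fin 3 → ℝ) (b : V3) (G : ℝ → ℝ) (v : V3) : ℝ :=
  (∑ j, ∑ k, A j k * ((v - u) j * (v - u) k)) + (∑ j, b j * (v - u) j) * G (‖v - u‖ ^ 2)

variable (u : V3) (A : Fin 3 → Fin 3 → ℝ) (b : V3) (G : ℝ → ℝ)

/-- The class functional in the reduced variable `v = u + s ξ`, `s² = θ`. [folklore] -/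
theorem classF_shift' {θ s : ℝ} (hs : s * s = θ) (ξ : V3) :
    classF u A b G (u + s • ξ) = θ * (∑ j, ∑ k, A j k * (ξ j * ξ k)) + s * (∑ j, b j * ξ j) * G (θ * ‖ξ‖ ^ 2) := by
  have hn : ‖s • ξ‖ ^ 2 = θ * ‖ξ‖ ^ 2 := by
    rw [norm_smul, mul_pow, Real.norm_eq_abs, sq_abs, sq, hs]
  simp only [classF, add_sub_cancel_left, hn, PiLp.smul_apply, smul_eq_mul, Finset.mul_sum]
  congr 1
  · refine Finset.sum_congr rfl fun j _ => Finset.sum_congr rfl fun k _ => ?_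
    rw [← hs]; ring
  · rw [Finset.sum_mul, Finset.sum_mul]
    refine Finset.sum_congr rfl fun j _ => ?_
    ring

/-- The class functional in the reduced variable `v = u + √θ ξ`. [folklore] -/
theorem classF_shift {θ : ℝ} (hθ : 0 < θ) (ξ : V3) :
    classF u A b G (u + Real.sqrt θ • ξ) =
      θ * (∑ j, ∑ k, A j k * (ξ j * ξ k)) + Real.sqrt θ * (∑ j, b j * ξ j) * G (θ * ‖ξ‖ ^ 2) :=
  classF_shift' u A b G (Real.mul_self_sqrt hθ.le) ξ

/-- Symmetrisation kills the odd part: `F(u + √θξ) + F(u − √θξ) = 2θ q(ξ)`. [folklore] -/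
theorem classF_shift_add_neg {θ : ℝ} (hθ : 0 < θ) (ξ : V3) :
    classF u A b G (u + Real.sqrt θ • ξ) + classF u A b G (u + Real.sqrt θ • (-ξ)) =
      2 * θ * ∑ j, ∑ k, A j k * (ξ j * ξ k) := by
  rw [classF_shift u A b G hθ, classF_shift u A b G hθ]
  have hq : (∑ j, ∑ k, A j k * ((-ξ) j * (-ξ) k)) = ∑ j, ∑ k, A j k * (ξ j * ξ k) := by simp
  have hl : (∑ j, b j * (-ξ) j) = -∑ j, b j * ξ j := by simp [Finset.sum_neg_distrib]
  rw [hq, hl, norm_neg]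
  ring

/-! ### Gaussian integrability of observables of quartic growth -/

/-- `ξ ↦ (1 + ‖ξ‖²)²` is integrable under the standard Gaussian. [folklore] -/
theorem integrable_one_add_norm_sq_sq :
    Integrable (fun ξ : V3 => (1 + ‖ξ‖ ^ 2) ^ 2) (stdGaussian V3) := by
  have h : (fun ξ : V3 => (1 + ‖ξ‖ ^ 2) ^ 2) = fun ξ => 1 + 2 * ‖ξ‖ ^ 2 + ‖ξ‖ ^ 4 := by
    funext ξ; ring
  rw [h]
  exact ((integrable_const _).add (integrable_norm_sq_stdGaussian.const_mul 2)).add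
    integrable_norm_pow_four_stdGaussian

/-- Domination by `K(1 + ‖ξ‖²)²` gives Gaussian integrability. [folklore] -/
theorem integrable_of_le_quartic {h : V3 → ℝ} (hm : AEStronglyMeasurable h (stdGaussian V3)) (K : ℝ)
    (hh : ∀ ξ, |h ξ| ≤ K * (1 + ‖ξ‖ ^ 2) ^ 2) : Integrable h (stdGaussian V3) :=
  (integrable_one_add_norm_sq_sq.const_mul K).mono' hm (ae_of_all _ fun ξ => by
    rw [Real.norm_eq_abs]; exact hh ξ)

/-- `C ≥ 0` for a growth constant. [folklore] -/
theorem C_nonneg {C : ℝ} (hC : ∀ v, |classF u A b G v| ≤ C * (1 + ‖v‖ ^ 2)) : 0 ≤ C := by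
  have h0 := (abs_nonneg _).trans (hC 0)
  have : 0 < (1 : ℝ) + ‖(0 : V3)‖ ^ 2 := by positivity
  nlinarith

/-- Growth of the shifted functional: `|F(u + √θξ)| ≤ C(1 + 2‖u‖² + 2θ)(1 + ‖ξ‖²)`. [folklore] -/
theorem abs_classF_shift_le {θ : ℝ} (hθ : 0 < θ) {C : ℝ} (hC : ∀ v, |classF u A b G v| ≤ C * (1 + ‖v‖ ^ 2))
    (ξ : V3) :
    |classF u A b G (u + Real.sqrt θ • ξ)| ≤ C * (1 + 2 * ‖u‖ ^ 2 + 2 * θ) * (1 + ‖ξ‖ ^ 2) := by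
  have hC0 := C_nonneg u A b G hC
  refine (hC _).trans ?_
  rw [mul_assoc]
  refine mul_le_mul_of_nonneg_left ?_ hC0
  have h := KineticCurrentsWindowLDUniformSketch.ClassTruncation.norm_shift_sq_le hθ.le u ξ
  nlinarith [mul_nonneg hθ.le (sq_nonneg ‖ξ‖), sq_nonneg ‖u‖, sq_nonneg ‖ξ‖,
    mul_nonneg (sq_nonneg ‖u‖) (sq_nonneg ‖ξ‖)]

/-- The shifted functional is continuous when `G` is. [folklore] -/
theorem continuous_classF_shift (θ : ℝ) (hG : Continuous G) :
    Continuous fun ξ : V3 => classF u A b G (u + Real.sqrt θ • ξ) := by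
  unfold classF
  fun_prop

/-- Integrability of `F(u+√θξ) · p(ξ)` for a continuous weight of quadratic growth `|p| ≤ P(1+‖ξ‖²)`. [folklore] -/
theorem integrable_classF_shift_mul {θ : ℝ} (hθ : 0 < θ) {C : ℝ}
    (hC : ∀ v, |classF u A b G v| ≤ C * (1 + ‖v‖ ^ 2)) (hG : Continuous G) {p : V3 → ℝ} (hp : Continuous p)
    {P : ℝ} (hP : ∀ ξ, |p ξ| ≤ P * (1 + ‖ξ‖ ^ 2)) :
    Integrable (fun ξ : V3 => classF u A b G (u + Real.sqrt θ • ξ) * p ξ) (stdGaussian V3) := by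
  refine integrable_of_le_quartic ((continuous_classF_shift u A b G θ hG).mul hp).aestronglyMeasurable
    (C * (1 + 2 * ‖u‖ ^ 2 + 2 * θ) * P) fun ξ => ?_
  rw [abs_mul]
  have h1 := abs_classF_shift_le u A b G hθ hC ξ
  have h2 := hP ξ
  have hK : 0 ≤ C * (1 + 2 * ‖u‖ ^ 2 + 2 * θ) * (1 + ‖ξ‖ ^ 2) :=
    mul_nonneg (mul_nonneg (C_nonneg u A b G hC) (by positivity)) (by positivity)
  calc |classF u A b G (u + Real.sqrt θ • ξ)| * |p ξ|
      ≤ (C * (1 + 2 * ‖u‖ ^ 2 + 2 * θ) * (1 + ‖ξ‖ ^ 2)) * (P * (1 + ‖ξ‖ ^ 2)) :=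
        mul_le_mul h1 h2 (abs_nonneg _) hK
    _ = C * (1 + 2 * ‖u‖ ^ 2 + 2 * θ) * P * (1 + ‖ξ‖ ^ 2) ^ 2 := by ring

/-! ### Symmetrisation under the Gaussian -/

/-- **Symmetrised reduced integrals**: for an EVEN continuous weight `p` of quadratic growth,
`∫ F(u+√θξ) p(ξ) dγ = θ ∫ q(ξ) p(ξ) dγ` — the odd `b`-part drops out. [folklore] -/
theorem integral_classF_shift_mul_even {θ : ℝ} (hθ : 0 < θ) {C : ℝ}
    (hC : ∀ v, |classF u A b G v| ≤ C * (1 + ‖v‖ ^ 2)) (hG : Continuous G) {p : V3 → ℝ} (hp : Continuous p)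
    (heven : ∀ ξ, p (-ξ) = p ξ) {P : ℝ} (hP : ∀ ξ, |p ξ| ≤ P * (1 + ‖ξ‖ ^ 2)) :
    ∫ ξ, classF u A b G (u + Real.sqrt θ • ξ) * p ξ ∂stdGaussian V3 =
      θ * ∫ ξ, (∑ j, ∑ k, A j k * (ξ j * ξ k)) * p ξ ∂stdGaussian V3 := by
  set Fp : V3 → ℝ := fun ξ => classF u A b G (u + Real.sqrt θ • ξ) * p ξ with hFp
  have hi : Integrable Fp (stdGaussian V3) := integrable_classF_shift_mul u A b G hθ hC hG hp hP
  have hmp : MeasurePreserving (LinearIsometryEquiv.neg ℝ (E := V3)) (stdGaussian V3) (stdGaussian V3) :=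
    ⟨(LinearIsometryEquiv.neg ℝ (E := V3)).continuous.measurable, stdGaussian_map _⟩
  have hi' : Integrable (fun ξ => Fp (-ξ)) (stdGaussian V3) :=
    (hmp.integrable_comp_emb (LinearIsometryEquiv.neg ℝ (E := V3)).toHomeomorph.measurableEmbedding).2 hi
  have hsym : ∫ ξ, Fp ξ ∂stdGaussian V3 = ∫ ξ, Fp (-ξ) ∂stdGaussian V3 :=
    (integral_comp_linearIsometryEquiv_stdGaussian (LinearIsometryEquiv.neg ℝ (E := V3)) Fp).symm
  have h2 : ∫ ξ, Fp ξ ∂stdGaussian V3 + ∫ ξ, Fp (-ξ) ∂stdGaussian V3 =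
      ∫ ξ, 2 * θ * ((∑ j, ∑ k, A j k * (ξ j * ξ k)) * p ξ) ∂stdGaussian V3 := by
    rw [← integral_add hi hi']
    refine integral_congr_ae (ae_of_all _ fun ξ => ?_)
    have := classF_shift_add_neg u A b G hθ ξ
    simp only [hFp, heven]
    rw [← add_mul, this]
    ring
  rw [integral_const_mul] at h2
  have : ∫ ξ, Fp ξ ∂stdGaussian V3 = θ * ∫ ξ, (∑ j, ∑ k, A j k * (ξ j * ξ k)) * p ξ ∂stdGaussian V3 := by
    linarith
  simpa [hFp] using this

/-! ### The redundancy -/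

/-- **`∫ F M_{1,u,θ} = θ · tr A`** (symmetrisation with `p = 1`, reduced second moments `E[ξ₀²] = 1`). [folklore] -/
theorem integral_classF {θ : ℝ} (hθ : 0 < θ) {C : ℝ} (hC : ∀ v, |classF u A b G v| ≤ C * (1 + ‖v‖ ^ 2))
    (hG : Continuous G) :
    ∫ v, classF u A b G v * localMaxwellian 1 θ u v = θ * ∑ j, A j j := by
  rw [integral_mul_localMaxwellian_shift hθ u]
  have h := integral_classF_shift_mul_even u A b G hθ hC hG continuous_const (p := fun _ => (1 : ℝ))
    (fun _ => rfl) (P := 1) (fun ξ => by rw [abs_one]; nlinarith [sq_nonneg ‖ξ‖])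
  have hq := integral_quad_weight A (ω := fun _ => (1 : ℝ)) continuous_const (P := 1)
    (fun s hs => by rw [abs_one]; nlinarith)
  simp only [mul_one] at h hq
  rw [h, hq, show (∫ ξ : V3, ξ 0 * ξ 0 ∂stdGaussian V3) = 1 by
    simpa [sq] using integral_coord_sq_stdGaussian (ι := Fin 3) 0, mul_one]

/-- `∫ F(u+√θξ) ‖ξ‖² dγ = θ · tr A · E[ξ₀²‖ξ‖²]` (symmetrisation with `p = ‖ξ‖²`). [folklore] -/
theorem integral_classF_shift_mul_norm_sq {θ : ℝ} (hθ : 0 < θ) {C : ℝ}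
    (hC : ∀ v, |classF u A b G v| ≤ C * (1 + ‖v‖ ^ 2)) (hG : Continuous G) :
    ∫ ξ, classF u A b G (u + Real.sqrt θ • ξ) * ‖ξ‖ ^ 2 ∂stdGaussian V3 =
      θ * ((∑ j, A j j) * ∫ ξ, ξ 0 * ξ 0 * ‖ξ‖ ^ 2 ∂stdGaussian V3) := by
  rw [integral_classF_shift_mul_even u A b G hθ hC hG (p := fun ξ : V3 => ‖ξ‖ ^ 2) (by fun_prop)
    (fun ξ => by rw [norm_neg]) (P := 1) (fun ξ => by rw [abs_of_nonneg (sq_nonneg _)]; nlinarith [sq_nonneg ‖ξ‖]),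
    integral_quad_weight A (ω := fun s => s) continuous_id (P := 1) (fun s hs => by rw [abs_of_nonneg hs]; nlinarith)]

/-- **THE REDUNDANCY.** For `θ > 0`, `u ∈ ℝ³`, any coefficients `A`, `b`, continuous `G` and the class functional
`F = classF u A b G` with `|F| ≤ C(1+‖v‖²)`: `F ⊥ 1` and `F ⊥ v_k (k = 0,1,2)` under `M_{1,u,θ}` imply
`F ⊥ ‖v‖²`. [folklore] -/
theorem orth_energy_of_orth_one_of_orth_mom {θ : ℝ} (hθ : 0 < θ) {C : ℝ}
    (hC : ∀ v, |classF u A b G v| ≤ C * (1 + ‖v‖ ^ 2)) (hG : Continuous G)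
    (h1 : ∫ v, classF u A b G v * localMaxwellian 1 θ u v = 0)
    (h2 : ∀ k : Fin 3, ∫ v, classF u A b G v * v k * localMaxwellian 1 θ u v = 0) :
    ∫ v, classF u A b G v * ‖v‖ ^ 2 * localMaxwellian 1 θ u v = 0 := by
  -- `tr A = 0` from the first hypothesis
  have htr : ∑ j, A j j = 0 := by
    rw [integral_classF u A b G hθ hC hG] at h1
    rcases mul_eq_zero.1 h1 with h | h
    · exact absurd h hθ.ne'
    · exact h
  -- pass to the reduced variable
  rw [integral_mul_localMaxwellian_shift hθ u]
  have h2' : ∀ k : Fin 3, ∫ ξ, classF u A b G (u + Real.sqrt θ • ξ) * (u + Real.sqrt θ • ξ) k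
      ∂stdGaussian V3 = 0 := fun k => by
    rw [← integral_mul_localMaxwellian_shift hθ u (fun v => classF u A b G v * v k)]
    exact h2 k
  have h1' : ∫ ξ, classF u A b G (u + Real.sqrt θ • ξ) ∂stdGaussian V3 = 0 := by
    rw [← integral_mul_localMaxwellian_shift hθ u (classF u A b G)]
    exact h1
  -- `‖v‖² = θ‖ξ‖² + 2 ∑ u_k v_k − ‖u‖²`
  have hdec : ∀ ξ : V3, ‖u + Real.sqrt θ • ξ‖ ^ 2 =
      θ * ‖ξ‖ ^ 2 + 2 * (∑ k, u k * (u + Real.sqrt θ • ξ) k) - ‖u‖ ^ 2 := by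
    intro ξ
    have hin : ⟪u + Real.sqrt θ • ξ, u⟫_ℝ = ∑ k, u k * (u + Real.sqrt θ • ξ) k := by
      rw [inner_eq_three, Fin.sum_univ_three]; ring
    have hns : ‖Real.sqrt θ • ξ‖ ^ 2 = θ * ‖ξ‖ ^ 2 := by
      rw [norm_smul, mul_pow, Real.norm_eq_abs, sq_abs, Real.sq_sqrt hθ.le]
    have := norm_sub_sq_real (u + Real.sqrt θ • ξ) u
    rw [add_sub_cancel_left, hns, hin] at this
    linarith
  -- integrability of the three pieces
  have hiN : Integrable (fun ξ : V3 => classF u A b G (u + Real.sqrt θ • ξ) * ‖ξ‖ ^ 2) (stdGaussian V3) :=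
    integrable_classF_shift_mul u A b G hθ hC hG (by fun_prop) (P := 1)
      (fun ξ => by rw [abs_of_nonneg (sq_nonneg _)]; nlinarith [sq_nonneg ‖ξ‖])
  have hi1 : Integrable (fun ξ : V3 => classF u A b G (u + Real.sqrt θ • ξ)) (stdGaussian V3) := by
    have := integrable_classF_shift_mul u A b G hθ hC hG continuous_const (p := fun _ => (1 : ℝ)) (P := 1)
      (fun ξ => by rw [abs_one]; nlinarith [sq_nonneg ‖ξ‖])
    simpa using this
  have hik : ∀ k : Fin 3, Integrable (fun ξ : V3 => classF u A b G (u + Real.sqrt θ • ξ) *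
      (u + Real.sqrt θ • ξ) k) (stdGaussian V3) := by
    intro k
    refine integrable_classF_shift_mul u A b G hθ hC hG (by fun_prop) (P := ‖u‖ + Real.sqrt θ) fun ξ => ?_
    have hk : |(u + Real.sqrt θ • ξ) k| ≤ ‖u + Real.sqrt θ • ξ‖ := by
      have := PiLp.norm_apply_le (u + Real.sqrt θ • ξ) k
      rwa [Real.norm_eq_abs] at this
    have h1 : ‖u + Real.sqrt θ • ξ‖ ≤ ‖u‖ + Real.sqrt θ * ‖ξ‖ := by
      refine (norm_add_le _ _).trans ?_
      rw [norm_smul, Real.norm_eq_abs, abs_of_nonneg (Real.sqrt_nonneg θ)]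
    refine hk.trans (h1.trans ?_)
    nlinarith [norm_nonneg u, Real.sqrt_nonneg θ, norm_nonneg ξ, sq_nonneg (‖ξ‖ - 1),
      mul_nonneg (Real.sqrt_nonneg θ) (sq_nonneg (‖ξ‖ - 1)), mul_nonneg (norm_nonneg u) (sq_nonneg ‖ξ‖)]
  -- assemble
  have hsum : Integrable (fun ξ : V3 => ∑ k, u k * (classF u A b G (u + Real.sqrt θ • ξ) *
      (u + Real.sqrt θ • ξ) k)) (stdGaussian V3) :=
    integrable_finsetSum _ fun k _ => (hik k).const_mul _
  have hpt : ∀ ξ : V3, classF u A b G (u + Real.sqrt θ • ξ) * ‖u + Real.sqrt θ • ξ‖ ^ 2 =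
      θ * (classF u A b G (u + Real.sqrt θ • ξ) * ‖ξ‖ ^ 2) +
        2 * (∑ k, u k * (classF u A b G (u + Real.sqrt θ • ξ) * (u + Real.sqrt θ • ξ) k)) -
        ‖u‖ ^ 2 * classF u A b G (u + Real.sqrt θ • ξ) := by
    intro ξ
    rw [hdec ξ, Finset.mul_sum, Finset.mul_sum]
    have : ∀ k : Fin 3, u k * (classF u A b G (u + Real.sqrt θ • ξ) * (u + Real.sqrt θ • ξ) k) =
        classF u A b G (u + Real.sqrt θ • ξ) * (u k * (u + Real.sqrt θ • ξ) k) := fun k => by ring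
    simp_rw [this, ← Finset.mul_sum]
    ring
  simp_rw [hpt]
  have hI1 : Integrable (fun ξ : V3 => θ * (classF u A b G (u + Real.sqrt θ • ξ) * ‖ξ‖ ^ 2) +
      2 * (∑ k, u k * (classF u A b G (u + Real.sqrt θ • ξ) * (u + Real.sqrt θ • ξ) k)))
      (stdGaussian V3) := (hiN.const_mul θ).add (hsum.const_mul 2)
  have hI2 : Integrable (fun ξ : V3 => ‖u‖ ^ 2 * classF u A b G (u + Real.sqrt θ • ξ)) (stdGaussian V3) :=
    hi1.const_mul _
  rw [integral_sub hI1 hI2, integral_add (hiN.const_mul θ) (hsum.const_mul 2), integral_const_mul,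
    integral_const_mul, integral_const_mul, integral_finsetSum _ fun k _ => (hik k).const_mul _]
  simp_rw [integral_const_mul, h2', mul_zero, Finset.sum_const_zero, mul_zero, add_zero, h1', mul_zero,
    sub_zero]
  rw [integral_classF_shift_mul_norm_sq u A b G hθ hC hG, htr]
  ring

/-- **The crux's third orthogonality hypothesis is implied by the first two** — in the exact form of
`OneFlightGossipEngine.KineticCurrentsWindowLDUniform`: for continuous profiles `θ₀ > 0`, `u₀`, coefficient
fields `A`, `b`, continuous `G : 𝕋³ × ℝ → ℝ` and the growth bound, `(∀ x, F(x,·) ⊥ 1) → (∀ x j, F(x,·) ⊥ v_j) →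
∀ x, F(x,·) ⊥ ‖v‖²` under `M_{1,θ₀(x),u₀(x)}`. [folklore] -/
theorem kcw_orth_energy_redundant (θ₀ : T3 → ℝ) (u₀ : T3 → V3) (hθ0 : ∀ x, 0 < θ₀ x)
    (A : T3 → Fin 3 → Fin 3 → ℝ) (b : T3 → V3) (G : T3 × ℝ → ℝ) (hG : Continuous G)
    (hC : ∃ C : ℝ, ∀ y : T3 × V3, |(fun y : T3 × V3 => ((∑ j : Fin 3, ∑ k : Fin 3, A y.1 j k *
      ((y.2 - u₀ y.1) j * (y.2 - u₀ y.1) k)) + (∑ j : Fin 3, b y.1 j * (y.2 - u₀ y.1) j) *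
        G (y.1, ‖y.2 - u₀ y.1‖ ^ 2))) y| ≤ C * (1 + ‖y.2‖ ^ 2))
    (h1 : ∀ x, ∫ v, (fun y : T3 × V3 => ((∑ j : Fin 3, ∑ k : Fin 3, A y.1 j k *
      ((y.2 - u₀ y.1) j * (y.2 - u₀ y.1) k)) + (∑ j : Fin 3, b y.1 j * (y.2 - u₀ y.1) j) *
        G (y.1, ‖y.2 - u₀ y.1‖ ^ 2))) (x, v) * localMaxwellian 1 (θ₀ x) (u₀ x) v = 0)
    (h2 : ∀ x (j : Fin 3), ∫ v, (fun y : T3 × V3 => ((∑ j : Fin 3, ∑ k : Fin 3, A y.1 j k *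
      ((y.2 - u₀ y.1) j * (y.2 - u₀ y.1) k)) + (∑ j : Fin 3, b y.1 j * (y.2 - u₀ y.1) j) *
        G (y.1, ‖y.2 - u₀ y.1‖ ^ 2))) (x, v) * v j * localMaxwellian 1 (θ₀ x) (u₀ x) v = 0) :
    ∀ x, ∫ v, (fun y : T3 × V3 => ((∑ j : Fin 3, ∑ k : Fin 3, A y.1 j k *
      ((y.2 - u₀ y.1) j * (y.2 - u₀ y.1) k)) + (∑ j : Fin 3, b y.1 j * (y.2 - u₀ y.1) j) *
        G (y.1, ‖y.2 - u₀ y.1‖ ^ 2))) (x, v) * ‖v‖ ^ 2 * localMaxwellian 1 (θ₀ x) (u₀ x) v = 0 := by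
  intro x
  obtain ⟨C, hC⟩ := hC
  have hFx : ∀ v : V3, (fun y : T3 × V3 => ((∑ j : Fin 3, ∑ k : Fin 3, A y.1 j k *
      ((y.2 - u₀ y.1) j * (y.2 - u₀ y.1) k)) + (∑ j : Fin 3, b y.1 j * (y.2 - u₀ y.1) j) *
        G (y.1, ‖y.2 - u₀ y.1‖ ^ 2))) (x, v) = classF (u₀ x) (A x) (b x) (fun s => G (x, s)) v := by
    intro v; rfl
  simp_rw [hFx] at h1 h2 ⊢
  refine orth_energy_of_orth_one_of_orth_mom (u₀ x) (A x) (b x) (fun s => G (x, s)) (hθ0 x) (C := C)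
    (fun v => ?_) (by fun_prop) (h1 x) (h2 x)
  have := hC (x, v)
  exact this

end KineticCurrentsWindowLDUniformClass
end Summit.AtomisticToContinuum.HydrodynamicLimit.Cruxes.KineticCurrentsWindowLDUniform.Disproof

end


/-!
# Window functionals under the drifted homogeneous Gibbs law (crux `KineticCurrentsWindowLDUniform`, 1/3)

Negative-knowledge infrastructure for the crux `OneFlightGossipEngine.KineticCurrentsWindowLDUniform`
(stmt-AtomisticToContinuum-14662), from the standing disprover's `Cruxes/KineticCurrentsWindowLDUniform/Disproof.lean`
§ 3; part 1 of `Negative/{WindowFubini, WindowSum, TiltWindow, LoadBearing}`. For the kinetic-window functional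
`W(z) = ∑ᵢ w⁻¹ ∫₀ʷ g(vᵢ(r)) dr` of a continuous one-body velocity observable `g` of POLYNOMIAL growth
`|g| ≤ C(1 + ‖v‖²)^m` (the crux's class is `m = 1`: traceless stress + truncated heat flux; the true heat flux is
`m = 2`) along ANY hard-sphere flow:
(A) Fubini in time + stationarity for INTEGRABLE (not only bounded) observables under the homogeneous Gibbs law
with constant drift, `∫ (∫₀ʰ f(Φ_s z) ds) dG_N = h ∫ f dG_N` (`integral_window_eq_of_integrable`; the bounded case
is `ShearStressHalfDrudeNonCentred.integral_window_eq`); (B) one-body reductions to `gaussMeasure u θ`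
(`lintegral/integral_vel_localGibbsMeasure_const`, `measurePreserving_vel_localGibbsMeasure_const`) and Gibbs
integrability of polynomially bounded observables and of powers of the kinetic energy; (C, file `WindowSum`) the window functional `windowSum` and its mean under the drifted Gibbs law; part 3
(`TiltWindow`) turns this into the Donsker–Varadhan drift-tilt lower bound.
refuter-cdisprove-stmt-AtomisticToContinuum-14662-0.
-/

noncomputable section

namespace Summit.AtomisticToContinuum.HydrodynamicLimit.Cruxes.KineticCurrentsWindowLDUniform.Disproof
open Summit.AtomisticToContinuum.HydrodynamicLimit.Theorems
namespace KineticCurrentsWindowTilt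

open MeasureTheory ProbabilityTheory Filter Set Topology Real
open scoped ENNReal NNReal InnerProductSpace
open Literature.MathematicalPhysics.KineticTheory Literature.Analysis.FluidPDE

/-! ### A. Fubini in time + stationarity for INTEGRABLE observables -/

/-- **Mean of a window integral under the stationary Gibbs law, integrable observables**: for constant
profiles, every flow, every window `h > 0` and every measurable `f` that is INTEGRABLE under the Gibbs law,
`∫ (∫₀ʰ f(Φ_s z) ds) dG_N = h ∫ f dG_N` (joint measurability of the flow on its good set, Tonelli +
invariance for the integrability of the uncurried integrand, Fubini, and `(Φ_s)_# G_N = G_N`). The bounded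
case is `ShearStressHalfDrudeNonCentred.integral_window_eq`. [folklore] -/
theorem integral_window_eq_of_integrable (σ a θ : ℝ) (u : V3) (N : ℕ)
    (Φ : HardSphereFlow (Torus.geometry (Fin 3)) (hsDiameter σ N) (N + 1))
    [IsFiniteMeasure (localGibbsLaw σ (fun _ => a) (fun _ => u) (fun _ => θ) N Φ)]
    {f : Config (N + 1) (Fin 3) T3 → ℝ} (hf : Measurable f)
    (hfi : Integrable f (localGibbsLaw σ (fun _ => a) (fun _ => u) (fun _ => θ) N Φ))
    {h : ℝ} (hh : 0 < h) :
    ∫ z, (∫ s in (0 : ℝ)..h, f (Φ.flow s z)) ∂(localGibbsLaw σ (fun _ => a) (fun _ => u) (fun _ => θ) N Φ) =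
      h * ∫ z, f z ∂(localGibbsLaw σ (fun _ => a) (fun _ => u) (fun _ => θ) N Φ) := by
  set μ := localGibbsLaw σ (fun _ => a) (fun _ => u) (fun _ => θ) N Φ with hμ
  set ν : Measure ℝ := volume.restrict (Ioc (0 : ℝ) h) with hν
  haveI : IsFiniteMeasure ν := by
    rw [hν]; exact isFiniteMeasure_restrict.2 (by simp)
  -- the law is carried by the good set
  have hac : μ ≪ liouville (Torus.geometry (Fin 3)) (N + 1) (hsDiameter σ N) :=
    withDensity_absolutelyContinuous _ _
  have hgood : μ Φ.goodᶜ = 0 := hac Φ.measure_compl_good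
  -- a measurable modification of the uncurried integrand
  set S : Set (Config (N + 1) (Fin 3) T3 × ℝ) := Φ.good ×ˢ (univ : Set ℝ) with hS
  have hSm : MeasurableSet S := Φ.measurableSet_good.prod MeasurableSet.univ
  have hflowS : Measurable fun p : S => f (Φ.flow p.1.2 p.1.1) := by
    have hmk : Measurable fun p : S => ((⟨p.1.1, (mem_prod.1 p.2).1⟩ : Φ.good), p.1.2) :=
      ((measurable_fst.comp measurable_subtype_coe).subtype_mk).prodMk
        (measurable_snd.comp measurable_subtype_coe)
    exact hf.comp ((Φ.measurable_flow_prod_torus).comp hmk)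
  classical
  set G : Config (N + 1) (Fin 3) T3 × ℝ → ℝ := fun p =>
    if hp : p ∈ S then f (Φ.flow p.2 p.1) else 0 with hG
  have hGm : Measurable G := by
    have := Measurable.dite (s := S) (f := fun p : S => f (Φ.flow p.1.2 p.1.1))
      (g := fun _ => (0 : ℝ)) hflowS measurable_const hSm
    convert this using 1
  -- pointwise: `‖G (z, s)‖ₑ ≤ ‖f (Φ_s z)‖ₑ`
  have hGle : ∀ p, ‖G p‖ₑ ≤ ‖f (Φ.flow p.2 p.1)‖ₑ := by
    intro p
    by_cases hp : p ∈ S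
    · simp only [hG, hp, dite_true]; exact le_rfl
    · simp only [hG, hp, dite_false, enorm_zero]; exact bot_le
  -- integrability of `G` on the product: Tonelli + invariance
  have hGint : Integrable G (μ.prod ν) := by
    refine ⟨hGm.aestronglyMeasurable, ?_⟩
    rw [HasFiniteIntegral, lintegral_prod_symm _ hGm.enorm.aemeasurable]
    have hinner : ∀ s, ∫⁻ z, ‖G (z, s)‖ₑ ∂μ ≤ ∫⁻ z, ‖f z‖ₑ ∂μ := by
      intro s
      calc ∫⁻ z, ‖G (z, s)‖ₑ ∂μ ≤ ∫⁻ z, ‖f (Φ.flow s z)‖ₑ ∂μ := lintegral_mono fun z => hGle (z, s)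
        _ = ∫⁻ z, ‖f z‖ₑ ∂μ :=
            lintegral_comp_flow_localGibbsLaw_const σ a θ u N Φ s (g := fun z => ‖f z‖ₑ) hf.enorm
    calc ∫⁻ s, ∫⁻ z, ‖G (z, s)‖ₑ ∂μ ∂ν ≤ ∫⁻ _s, ∫⁻ z, ‖f z‖ₑ ∂μ ∂ν := lintegral_mono hinner
      _ = (∫⁻ z, ‖f z‖ₑ ∂μ) * ν univ := lintegral_const _
      _ < ⊤ := ENNReal.mul_lt_top hfi.2 (measure_lt_top _ _)
  -- the uncurried integrand agrees with `G` almost everywhere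
  have hSc : (μ.prod ν) Sᶜ = 0 := by
    have hsub : Sᶜ ⊆ Φ.goodᶜ ×ˢ (univ : Set ℝ) := by
      intro p hp
      simp only [hS, mem_compl_iff, mem_prod, mem_univ, and_true] at hp
      exact ⟨hp, mem_univ _⟩
    refine measure_mono_null hsub ?_
    rw [Measure.prod_prod, hgood, zero_mul]
  have hae : (Function.uncurry fun z s => f (Φ.flow s z)) =ᵐ[μ.prod ν] G := by
    refine (ae_iff.2 (measure_mono_null (fun p hp => ?_) hSc))
    intro hpS
    exact hp (by simp only [hG, hpS, dite_true]; rfl)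
  have hint : Integrable (Function.uncurry fun z s => f (Φ.flow s z)) (μ.prod ν) :=
    hGint.congr hae.symm
  -- Fubini and stationarity
  simp_rw [intervalIntegral.integral_of_le hh.le]
  rw [integral_integral_swap hint]
  have hinv : ∀ s, ∫ z, f (Φ.flow s z) ∂μ = ∫ z, f z ∂μ := fun s =>
    integral_comp_flow_localGibbsLaw_const σ a θ u N Φ s hf.aestronglyMeasurable
  simp_rw [hinv]
  rw [setIntegral_const]
  simp [Measure.real, Real.volume_Ioc, hh.le]

/-! ### B. One-body reductions under the homogeneous Gibbs law with drift -/

/-- One-body velocity expectations under the homogeneous Gibbs measure with constant profiles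
`(a, u, θ)`, `a, θ > 0`, `σ ≤ 1/2`, are `gaussMeasure u θ` expectations, particle by particle. [folklore] -/
theorem lintegral_vel_localGibbsMeasure_const {σ : ℝ} (hσ : σ ≤ 1 / 2) {a θ : ℝ} (ha : 0 < a)
    (hθ : 0 < θ) (u : V3) (N : ℕ) (i : Fin (N + 1)) {H : V3 → ℝ≥0∞} (hH : Measurable H) :
    ∫⁻ z, H ((z i).2) ∂localGibbsMeasure σ (fun _ => a) (fun _ => u) (fun _ => θ) N =
      ∫⁻ w, H w ∂gaussMeasure u θ := by
  haveI := isProbabilityMeasure_localGibbsMeasure (a₀ := fun _ : T3 => a)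
    (θ₀ := fun _ : T3 => θ) (u₀ := fun _ : T3 => u) continuous_const continuous_const
    continuous_const (fun _ => ha) (fun _ => hθ) hσ N
  have hG : Measurable fun z : Config (N + 1) (Fin 3) T3 => H ((z i).2) :=
    hH.comp (measurable_pi_apply i).snd
  rw [lintegral_localGibbsMeasure (a₀ := fun _ : T3 => a) (θ₀ := fun _ : T3 => θ)
    (u₀ := fun _ : T3 => u) continuous_const continuous_const continuous_const
    (fun _ => ha.le) (fun _ => hθ) σ N hG]
  have hinner : ∀ x : Fin (N + 1) → T3,
      ∫⁻ v, H ((zipConfig (x, v) i).2) ∂velMeasure (fun _ => u) (fun _ => θ) x =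
        ∫⁻ w, H w ∂gaussMeasure u θ := by
    intro x
    have hmp : MeasurePreserving (Function.eval i)
        (velMeasure (fun _ => u) (fun _ => θ) x) (gaussMeasure u θ) := by
      unfold velMeasure
      exact measurePreserving_eval _ i
    rw [← hmp.lintegral_comp hH]
    rfl
  simp_rw [hinner]
  rw [lintegral_mul_const _ ?_, lintegral_posWeight_eq_one (a₀ := fun _ : T3 => a)
    (θ₀ := fun _ : T3 => θ) (u₀ := fun _ : T3 => u) continuous_const continuous_const
    continuous_const (fun _ => ha.le) (fun _ => hθ) σ N, one_mul]
  exact ((measurable_posWeight continuous_const _ _).const_mul _).ennreal_ofReal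

open KineticFluxLdDecayTilt (llr1 llr1_eq llrConfig measurable_llrConfig continuous_llr1
  localGibbsMeasure_ref_eq_withDensity ofReal_exp_integral_le_lintegral integral_eq_zero_of_odd_stdGaussian)

/-! ### B'. Integrability of polynomially bounded one-body observables -/

/-- The velocity of particle `i` pushes the homogeneous Gibbs measure to `gaussMeasure u θ`. [folklore] -/
theorem measurePreserving_vel_localGibbsMeasure_const {σ : ℝ} (hσ : σ ≤ 1 / 2) {a θ : ℝ} (ha : 0 < a)
    (hθ : 0 < θ) (u : V3) (N : ℕ) (i : Fin (N + 1)) :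
    MeasurePreserving (fun z : Config (N + 1) (Fin 3) T3 => (z i).2)
      (localGibbsMeasure σ (fun _ => a) (fun _ => u) (fun _ => θ) N) (gaussMeasure u θ) := by
  refine ⟨(measurable_pi_apply i).snd, Measure.ext fun s hs => ?_⟩
  rw [Measure.map_apply (measurable_pi_apply i).snd hs, ← lintegral_indicator_one hs,
    ← lintegral_indicator_one ((measurable_pi_apply i).snd hs),
    ← lintegral_vel_localGibbsMeasure_const hσ ha hθ u N i (H := s.indicator 1)
      (measurable_one.indicator hs)]
  rfl

/-- `w ↦ (1 + ‖w‖²)^m` is integrable under the standard Gaussian (Fernique: all moments). [folklore] -/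
theorem integrable_one_add_norm_sq_pow (m : ℕ) :
    Integrable (fun w : V3 => (1 + ‖w‖ ^ 2) ^ m) (stdGaussian V3) := by
  have hpow : Integrable (fun w : V3 => ‖w‖ ^ (2 * m)) (stdGaussian V3) := by
    rcases Nat.eq_zero_or_pos m with hm | hm
    · subst hm; simp
    · have h := (IsGaussian.memLp_id (stdGaussian V3) ((2 * m : ℕ) : ℝ≥0∞) (ENNReal.natCast_ne_top _)).integrable_norm_pow
        (by omega)
      simpa using h
  have hdom : Integrable (fun w : V3 => 2 ^ m * (1 + ‖w‖ ^ (2 * m))) (stdGaussian V3) :=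
    ((integrable_const (1 : ℝ)).add hpow).const_mul (2 ^ m)
  refine hdom.mono' (by fun_prop : Continuous fun w : V3 => (1 + ‖w‖ ^ 2) ^ m).aestronglyMeasurable
    (ae_of_all _ fun w => ?_)
  rw [Real.norm_eq_abs, abs_of_nonneg (by positivity), pow_mul]
  exact Literature.Analysis.FunctionSpaces.BMOInv.one_add_pow_le_two_pow_mul (sq_nonneg _) m

/-- `1 + ‖u + √θ w‖² ≤ (1 + 2‖u‖² + 2θ)(1 + ‖w‖²)`. [folklore] -/
theorem one_add_norm_shift_sq_le (u w : V3) {θ : ℝ} (hθ : 0 < θ) :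
    1 + ‖u + Real.sqrt θ • w‖ ^ 2 ≤ (1 + 2 * ‖u‖ ^ 2 + 2 * θ) * (1 + ‖w‖ ^ 2) := by
  have h1 : ‖u + Real.sqrt θ • w‖ ≤ ‖u‖ + Real.sqrt θ * ‖w‖ := by
    refine (norm_add_le _ _).trans ?_
    rw [norm_smul, Real.norm_eq_abs, abs_of_nonneg (Real.sqrt_nonneg θ)]
  have hsq : Real.sqrt θ ^ 2 = θ := Real.sq_sqrt hθ.le
  nlinarith [norm_nonneg (u + Real.sqrt θ • w), norm_nonneg u, Real.sqrt_nonneg θ, norm_nonneg w,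
    sq_nonneg (‖u‖ - Real.sqrt θ * ‖w‖), mul_nonneg (Real.sqrt_nonneg θ) (norm_nonneg w),
    mul_nonneg hθ.le (sq_nonneg ‖w‖), sq_nonneg ‖u‖, mul_nonneg (sq_nonneg ‖u‖) (sq_nonneg ‖w‖),
    mul_nonneg (mul_nonneg hθ.le (sq_nonneg ‖w‖)) (sq_nonneg ‖w‖)]

/-- A continuous `g` of polynomial growth `|g v| ≤ C (1 + ‖v‖²)^m` is integrable under every
`gaussMeasure u θ`, `θ > 0`. [folklore] -/
theorem integrable_gaussMeasure_of_growth {g : V3 → ℝ} (hg : Continuous g) {C : ℝ} {m : ℕ}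
    (hC : ∀ v, |g v| ≤ C * (1 + ‖v‖ ^ 2) ^ m) (u : V3) {θ : ℝ} (hθ : 0 < θ) :
    Integrable g (gaussMeasure u θ) := by
  rw [gaussMeasure, ← coe_gaussShiftEquiv u hθ]
  refine (integrable_map_equiv (gaussShiftEquiv u hθ) g).2 ?_
  have hC0 : 0 ≤ C := by
    have h0 := (abs_nonneg _).trans (hC 0)
    have : 0 < ((1 : ℝ) + ‖(0 : V3)‖ ^ 2) ^ m := by positivity
    nlinarith
  set c : ℝ := 1 + 2 * ‖u‖ ^ 2 + 2 * θ with hc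
  have hdom : Integrable (fun w : V3 => C * c ^ m * (1 + ‖w‖ ^ 2) ^ m) (stdGaussian V3) :=
    (integrable_one_add_norm_sq_pow m).const_mul _
  refine hdom.mono' (hg.measurable.comp (gaussShiftEquiv u hθ).measurable).aestronglyMeasurable
    (ae_of_all _ fun w => ?_)
  rw [Function.comp_apply, coe_gaussShiftEquiv, Real.norm_eq_abs]
  refine (hC _).trans ?_
  rw [mul_assoc, ← mul_pow]
  refine mul_le_mul_of_nonneg_left (pow_le_pow_left₀ (by positivity) ?_ m) hC0
  exact one_add_norm_shift_sq_le u w hθ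

/-- One-body observables of polynomial growth are integrable under the homogeneous Gibbs measure. [folklore] -/
theorem integrable_vel_localGibbsMeasure_const {σ : ℝ} (hσ : σ ≤ 1 / 2) {a θ : ℝ} (ha : 0 < a)
    (hθ : 0 < θ) (u : V3) (N : ℕ) (i : Fin (N + 1)) {g : V3 → ℝ} (hg : Continuous g) {C : ℝ} {m : ℕ}
    (hC : ∀ v, |g v| ≤ C * (1 + ‖v‖ ^ 2) ^ m) :
    Integrable (fun z : Config (N + 1) (Fin 3) T3 => g ((z i).2))
      (localGibbsMeasure σ (fun _ => a) (fun _ => u) (fun _ => θ) N) :=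
  (measurePreserving_vel_localGibbsMeasure_const hσ ha hθ u N i).integrable_comp
    hg.aestronglyMeasurable |>.2 (integrable_gaussMeasure_of_growth hg hC u hθ)

/-- `∫ g(vᵢ) dG_N = ∫ g d(gaussMeasure u θ)` (Bochner form of the one-body reduction). [folklore] -/
theorem integral_vel_localGibbsMeasure_const {σ : ℝ} (hσ : σ ≤ 1 / 2) {a θ : ℝ} (ha : 0 < a)
    (hθ : 0 < θ) (u : V3) (N : ℕ) (i : Fin (N + 1)) {g : V3 → ℝ} (hg : Continuous g) :
    ∫ z, g ((z i).2) ∂localGibbsMeasure σ (fun _ => a) (fun _ => u) (fun _ => θ) N =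
      ∫ w, g w ∂gaussMeasure u θ := by
  have h := measurePreserving_vel_localGibbsMeasure_const hσ ha hθ u N i
  have hg' : AEStronglyMeasurable g
      ((localGibbsMeasure σ (fun _ => a) (fun _ => u) (fun _ => θ) N).map
        (fun z : Config (N + 1) (Fin 3) T3 => (z i).2)) := by
    rw [h.map_eq]; exact hg.aestronglyMeasurable
  rw [← integral_map (measurable_pi_apply i).snd.aemeasurable hg', h.map_eq]

/-- Powers of the kinetic energy are integrable under the homogeneous Gibbs measure:
`z ↦ (1 + 2E(z))^m` (power-mean inequality + one-body Gaussian moments). [folklore] -/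
theorem integrable_one_add_two_mul_configEnergy_pow {σ : ℝ} (hσ : σ ≤ 1 / 2) {a θ : ℝ} (ha : 0 < a)
    (hθ : 0 < θ) (u : V3) (N : ℕ) (m : ℕ) :
    Integrable (fun z : Config (N + 1) (Fin 3) T3 => (1 + 2 * configEnergy z) ^ m)
      (localGibbsMeasure σ (fun _ => a) (fun _ => u) (fun _ => θ) N) := by
  -- domination by `(N+1)^m ∑ᵢ (1 + ‖vᵢ‖²)^m`
  have hterm : ∀ i : Fin (N + 1), Integrable (fun z : Config (N + 1) (Fin 3) T3 => (1 + ‖(z i).2‖ ^ 2) ^ m)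
      (localGibbsMeasure σ (fun _ => a) (fun _ => u) (fun _ => θ) N) := fun i =>
    integrable_vel_localGibbsMeasure_const hσ ha hθ u N i (g := fun v : V3 => (1 + ‖v‖ ^ 2) ^ m) (by fun_prop)
      (C := 1) (m := m) (fun v => by rw [abs_of_nonneg (by positivity), one_mul])
  have hdom : Integrable (fun z : Config (N + 1) (Fin 3) T3 => ((N : ℝ) + 1) ^ m * ∑ i, (1 + ‖(z i).2‖ ^ 2) ^ m)
      (localGibbsMeasure σ (fun _ => a) (fun _ => u) (fun _ => θ) N) :=
    (integrable_finsetSum Finset.univ fun i _ => hterm i).const_mul _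
  refine hdom.mono' (by unfold configEnergy; fun_prop : Continuous fun z : Config (N + 1) (Fin 3) T3 =>
    (1 + 2 * configEnergy z) ^ m).aestronglyMeasurable (ae_of_all _ fun z => ?_)
  rw [Real.norm_eq_abs, abs_of_nonneg (by unfold configEnergy; positivity)]
  have hE : 1 + 2 * configEnergy z ≤ ∑ i, (1 + ‖(z i).2‖ ^ 2) := by
    rw [configEnergy, ← mul_assoc, mul_inv_cancel₀ two_ne_zero, one_mul, Finset.sum_add_distrib,
      Finset.sum_const, Finset.card_univ, Fintype.card_fin]
    simp only [nsmul_eq_mul, mul_one]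
    have : (0 : ℝ) ≤ (N : ℝ) := Nat.cast_nonneg N
    push_cast
    linarith
  have hnn : ∀ i ∈ (Finset.univ : Finset (Fin (N + 1))), (0 : ℝ) ≤ 1 + ‖(z i).2‖ ^ 2 := fun i _ => by positivity
  have h1 : (1 + 2 * configEnergy z) ^ m ≤ (∑ i, (1 + ‖(z i).2‖ ^ 2)) ^ m :=
    pow_le_pow_left₀ (by unfold configEnergy; positivity) hE m
  refine h1.trans ?_
  rcases Nat.eq_zero_or_pos m with hm | hm
  · subst hm
    simp
  · obtain ⟨n, rfl⟩ : ∃ n, m = n + 1 := ⟨m - 1, by omega⟩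
    have h2 := pow_sum_le_card_mul_sum_pow hnn n
    rw [Finset.card_univ, Fintype.card_fin] at h2
    refine h2.trans ?_
    push_cast
    refine mul_le_mul_of_nonneg_right (pow_le_pow_right₀ ?_ (Nat.le_succ n)) ?_
    · have : (1 : ℝ) ≤ (N : ℝ) + 1 := by
        have : (0 : ℝ) ≤ N := Nat.cast_nonneg N
        linarith
      exact this
    · exact Finset.sum_nonneg fun i _ => by positivity

end KineticCurrentsWindowTilt
end Summit.AtomisticToContinuum.HydrodynamicLimit.Cruxes.KineticCurrentsWindowLDUniform.Disproof

end


/-!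
# The window functional and its drifted-Gibbs mean (crux `KineticCurrentsWindowLDUniform`, 2/3)

Negative-knowledge infrastructure for the crux `OneFlightGossipEngine.KineticCurrentsWindowLDUniform`
(stmt-AtomisticToContinuum-14662), from the standing disprover's `Cruxes/KineticCurrentsWindowLDUniform/Disproof.lean`
§ 3; part 2 of `Negative/{WindowFubini, WindowSum, TiltWindow, LoadBearing}`. The kinetic-window functional
`(∑ i, w⁻¹ * ∫ r in (0 : ℝ)..w, g ((Φ.flow r z) i).2) = ∑ᵢ w⁻¹ ∫₀ʷ g(vᵢ(r)) dr` of a continuous one-body velocity observable of polynomial growth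
`|g| ≤ C(1+‖v‖²)^m` along ANY hard-sphere flow `Φ`: a.e.-measurable under every law carried by the good set
(tree: joint measurability of the flow), dominated on the good set by the CONSERVED kinetic energy
(`|W| ≤ (N+1)C(1+2E)^m`, tree: `configEnergy_eq_holds`), hence integrable under the drifted homogeneous Gibbs law
`G_N^{u₁} = localGibbsLaw σ 1 u₁ 1 N Φ`, with mean `∫ W dG_N^{u₁} = (N+1) E_{N(u₁,I)} g` by Fubini in time + flow-invariance
(`integral_windowSum`, from part 1's `integral_window_eq_of_integrable`). refuter-cdisprove-stmt-AtomisticToContinuum-14662-0.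
-/

noncomputable section

namespace Summit.AtomisticToContinuum.HydrodynamicLimit.Cruxes.KineticCurrentsWindowLDUniform.Disproof
open Summit.AtomisticToContinuum.HydrodynamicLimit.Theorems
namespace KineticCurrentsWindowTilt

open MeasureTheory ProbabilityTheory Filter Set Topology Real
open scoped ENNReal NNReal InnerProductSpace
open Literature.MathematicalPhysics.KineticTheory Literature.Analysis.FluidPDE

/-! ### C. The drift-tilt lower bound for window exponential functionals -/

section Tilt

variable {σ : ℝ} {N : ℕ}

/-- Scalars come out of the window functional:
`∑ᵢ w⁻¹∫₀ʷ β g(vᵢ(r)) dr = β ∑ᵢ w⁻¹∫₀ʷ g(vᵢ(r)) dr`. [folklore] -/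
theorem window_sum_const_mul (Φ : HardSphereFlow (Torus.geometry (Fin 3)) (hsDiameter σ N) (N + 1))
    (w β : ℝ) (g : V3 → ℝ) (z : Config (N + 1) (Fin 3) T3) :
    (∑ i, w⁻¹ * ∫ r in (0 : ℝ)..w, β * g ((Φ.flow r z) i).2) =
      β * ∑ i, w⁻¹ * ∫ r in (0 : ℝ)..w, g ((Φ.flow r z) i).2 := by
  rw [Finset.mul_sum]
  refine Finset.sum_congr rfl fun i _ => ?_
  rw [intervalIntegral.integral_const_mul]
  ring

/-- A window term is a.e.-measurable under every law carried by the good set. [folklore] -/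
theorem aemeasurable_window_term (Φ : HardSphereFlow (Torus.geometry (Fin 3)) (hsDiameter σ N) (N + 1))
    (w : ℝ) {g : V3 → ℝ} (hg : Measurable g) (i : Fin (N + 1)) {μ : Measure (Config (N + 1) (Fin 3) T3)}
    (hμ : μ Φ.goodᶜ = 0) : AEMeasurable (fun z => ∫ r in (0 : ℝ)..w, g ((Φ.flow r z) i).2) μ :=
  Φ.aemeasurable_intervalIntegral_comp_flow_torus (f := fun z => g (z i).2)
    (hg.comp (measurable_pi_apply i).snd) 0 w hμ

/-- The window functional is a.e.-measurable under every law carried by the good set. [folklore] -/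
theorem aemeasurable_windowSum (Φ : HardSphereFlow (Torus.geometry (Fin 3)) (hsDiameter σ N) (N + 1))
    (w : ℝ) {g : V3 → ℝ} (hg : Measurable g) {μ : Measure (Config (N + 1) (Fin 3) T3)}
    (hμ : μ Φ.goodᶜ = 0) : AEMeasurable (fun z => ∑ i, w⁻¹ * ∫ r in (0 : ℝ)..w, g ((Φ.flow r z) i).2) μ := by
  have h : ∀ i : Fin (N + 1), AEMeasurable (fun z => w⁻¹ * ∫ r in (0 : ℝ)..w, g ((Φ.flow r z) i).2) μ :=
    fun i => (aemeasurable_window_term Φ w hg i hμ).const_mul _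
  have := Finset.aemeasurable_sum (Finset.univ : Finset (Fin (N + 1))) (fun i _ => h i)
  refine this.congr (ae_of_all _ fun z => ?_)
  simp

/-- On the good set a window term of a polynomially bounded observable is dominated by the (conserved)
kinetic energy: `|∫₀ʷ g(vᵢ(r)) dr| ≤ C (1 + 2E(z))^m w` for `w > 0`. [folklore] -/
theorem abs_window_term_le (Φ : HardSphereFlow (Torus.geometry (Fin 3)) (hsDiameter σ N) (N + 1))
    {w : ℝ} (hw : 0 < w) {g : V3 → ℝ} {C : ℝ} {m : ℕ} (hC : ∀ v, |g v| ≤ C * (1 + ‖v‖ ^ 2) ^ m)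
    {z : Config (N + 1) (Fin 3) T3} (hz : z ∈ Φ.good) (i : Fin (N + 1)) :
    |∫ r in (0 : ℝ)..w, g ((Φ.flow r z) i).2| ≤ C * (1 + 2 * configEnergy z) ^ m * w := by
  have hC0 : 0 ≤ C := by
    have h0 := (abs_nonneg _).trans (hC 0)
    have : 0 < ((1 : ℝ) + ‖(0 : V3)‖ ^ 2) ^ m := by positivity
    nlinarith
  have hE : ∀ r, configEnergy (Φ.flow r z) = configEnergy z := by
    intro r
    have h := IsHardSphereTrajectory.configEnergy_eq_holds (Φ.isTrajectory z hz) r 0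
    simpa [Φ.flow_zero z hz] using h
  have hbd : ∀ r ∈ Set.uIoc (0 : ℝ) w, ‖g ((Φ.flow r z) i).2‖ ≤ C * (1 + 2 * configEnergy z) ^ m := by
    intro r _
    rw [Real.norm_eq_abs]
    refine (hC _).trans (mul_le_mul_of_nonneg_left (pow_le_pow_left₀ (by positivity) ?_ m) hC0)
    have := AprioriBoundsNegative.norm_vel_sq_le_two_mul_configEnergy (Φ.flow r z) i
    rw [hE r] at this
    linarith
  have hint := intervalIntegral.norm_integral_le_of_norm_le_const hbd
  rwa [Real.norm_eq_abs, sub_zero, abs_of_pos hw] at hint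

/-- Hence `|W(z)| ≤ (N+1)·C·(1 + 2E(z))^m` on the good set. [folklore] -/
theorem abs_windowSum_le (Φ : HardSphereFlow (Torus.geometry (Fin 3)) (hsDiameter σ N) (N + 1))
    {w : ℝ} (hw : 0 < w) {g : V3 → ℝ} {C : ℝ} {m : ℕ} (hC : ∀ v, |g v| ≤ C * (1 + ‖v‖ ^ 2) ^ m)
    {z : Config (N + 1) (Fin 3) T3} (hz : z ∈ Φ.good) :
    |(∑ i, w⁻¹ * ∫ r in (0 : ℝ)..w, g ((Φ.flow r z) i).2)| ≤ (N + 1) * (C * (1 + 2 * configEnergy z) ^ m) := by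
  have hterm : ∀ i : Fin (N + 1), |w⁻¹ * ∫ r in (0 : ℝ)..w, g ((Φ.flow r z) i).2| ≤
      C * (1 + 2 * configEnergy z) ^ m := by
    intro i
    rw [abs_mul, abs_inv, abs_of_pos hw]
    calc w⁻¹ * |∫ r in (0 : ℝ)..w, g ((Φ.flow r z) i).2| ≤ w⁻¹ * (C * (1 + 2 * configEnergy z) ^ m * w) :=
          mul_le_mul_of_nonneg_left (abs_window_term_le Φ hw hC hz i) (inv_nonneg.2 hw.le)
      _ = C * (1 + 2 * configEnergy z) ^ m := by field_simp
  refine (Finset.abs_sum_le_sum_abs _ _).trans ?_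
  calc ∑ i, |w⁻¹ * ∫ r in (0 : ℝ)..w, g ((Φ.flow r z) i).2|
      ≤ ∑ _i : Fin (N + 1), C * (1 + 2 * configEnergy z) ^ m := Finset.sum_le_sum fun i _ => hterm i
    _ = (N + 1) * (C * (1 + 2 * configEnergy z) ^ m) := by simp

variable (hσ2 : σ ≤ 1 / 2)
include hσ2

/-- The drifted homogeneous Gibbs law `G_N^{u₁}` is a probability measure (`σ ≤ 1/2`). [folklore] -/
theorem isProbabilityMeasure_driftLaw (u₁ : V3)
    (Φ : HardSphereFlow (Torus.geometry (Fin 3)) (hsDiameter σ N) (N + 1)) :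
    IsProbabilityMeasure (localGibbsLaw σ (fun _ => 1) (fun _ => u₁) (fun _ => 1) N Φ) := by
  rw [localGibbsLaw_eq]
  exact isProbabilityMeasure_localGibbsMeasure (a₀ := fun _ : T3 => (1 : ℝ))
    (θ₀ := fun _ : T3 => (1 : ℝ)) (u₀ := fun _ : T3 => u₁) continuous_const continuous_const
    continuous_const (fun _ => one_pos) (fun _ => one_pos) hσ2 N

omit hσ2 in
/-- The drifted Gibbs law gives zero mass to the complement of the good set. [folklore] -/
theorem driftLaw_compl_good (u₁ : V3)
    (Φ : HardSphereFlow (Torus.geometry (Fin 3)) (hsDiameter σ N) (N + 1)) :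
    (localGibbsLaw σ (fun _ => 1) (fun _ => u₁) (fun _ => 1) N Φ) Φ.goodᶜ = 0 :=
  (withDensity_absolutelyContinuous _ _) Φ.measure_compl_good

/-- `z ↦ C (1 + 2E(z))^m w'` is integrable under the drifted Gibbs law. [folklore] -/
theorem integrable_energy_pow (u₁ : V3)
    (Φ : HardSphereFlow (Torus.geometry (Fin 3)) (hsDiameter σ N) (N + 1)) (C w' : ℝ) (m : ℕ) :
    Integrable (fun z : Config (N + 1) (Fin 3) T3 => C * (1 + 2 * configEnergy z) ^ m * w')
      (localGibbsLaw σ (fun _ => 1) (fun _ => u₁) (fun _ => 1) N Φ) := by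
  have hE : Integrable (fun z : Config (N + 1) (Fin 3) T3 => (1 + 2 * configEnergy z) ^ m) (localGibbsLaw σ (fun _ => 1) (fun _ => u₁) (fun _ => 1) N Φ) := by
    rw [localGibbsLaw_eq]
    exact integrable_one_add_two_mul_configEnergy_pow hσ2 one_pos one_pos u₁ N m
  exact (hE.const_mul C).mul_const w'

/-- A window term of a continuous polynomially bounded observable is integrable under the drifted Gibbs law
(domination by the conserved, Gibbs-integrable kinetic energy on the conull good set). [folklore] -/
theorem integrable_window_term (Φ : HardSphereFlow (Torus.geometry (Fin 3)) (hsDiameter σ N) (N + 1))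
    (u₁ : V3) {w : ℝ} (hw : 0 < w) {g : V3 → ℝ} (hg : Continuous g) {C : ℝ} {m : ℕ}
    (hC : ∀ v, |g v| ≤ C * (1 + ‖v‖ ^ 2) ^ m) (i : Fin (N + 1)) :
    Integrable (fun z => ∫ r in (0 : ℝ)..w, g ((Φ.flow r z) i).2) (localGibbsLaw σ (fun _ => 1) (fun _ => u₁) (fun _ => 1) N Φ) := by
  refine (integrable_energy_pow hσ2 u₁ Φ C w m).mono'
    (aemeasurable_window_term Φ w hg.measurable i (driftLaw_compl_good u₁ Φ)).aestronglyMeasurable ?_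
  have hae : ∀ᵐ z ∂(localGibbsLaw σ (fun _ => 1) (fun _ => u₁) (fun _ => 1) N Φ), z ∈ Φ.good := by
    have := compl_mem_ae_iff.2 (driftLaw_compl_good u₁ Φ)
    rwa [compl_compl] at this
  filter_upwards [hae] with z hz
  rw [Real.norm_eq_abs]
  exact abs_window_term_le Φ hw hC hz i

/-- The window functional is integrable under the drifted Gibbs law. [folklore] -/
theorem integrable_windowSum (Φ : HardSphereFlow (Torus.geometry (Fin 3)) (hsDiameter σ N) (N + 1))
    (u₁ : V3) {w : ℝ} (hw : 0 < w) {g : V3 → ℝ} (hg : Continuous g) {C : ℝ} {m : ℕ}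
    (hC : ∀ v, |g v| ≤ C * (1 + ‖v‖ ^ 2) ^ m) : Integrable (fun z => ∑ i, w⁻¹ * ∫ r in (0 : ℝ)..w, g ((Φ.flow r z) i).2) (localGibbsLaw σ (fun _ => 1) (fun _ => u₁) (fun _ => 1) N Φ) := by
  have := integrable_finsetSum (Finset.univ : Finset (Fin (N + 1)))
    fun i _ => (integrable_window_term hσ2 Φ u₁ hw hg hC i).const_mul w⁻¹
  refine this.congr (ae_of_all _ fun z => ?_)
  simp

/-- **Mean of a window term under the (invariant) drifted Gibbs law**: Fubini in time + stationarity
+ one-body reduction, `∫ (∫₀ʷ g(vᵢ(r)) dr) dQ = w ∫ g d(gaussMeasure u₁ 1)`. [folklore] -/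
theorem integral_window_term (Φ : HardSphereFlow (Torus.geometry (Fin 3)) (hsDiameter σ N) (N + 1))
    (u₁ : V3) {w : ℝ} (hw : 0 < w) {g : V3 → ℝ} (hg : Continuous g) {C : ℝ} {m : ℕ}
    (hC : ∀ v, |g v| ≤ C * (1 + ‖v‖ ^ 2) ^ m) (i : Fin (N + 1)) :
    ∫ z, (∫ r in (0 : ℝ)..w, g ((Φ.flow r z) i).2) ∂(localGibbsLaw σ (fun _ => 1) (fun _ => u₁) (fun _ => 1) N Φ) =
      w * ∫ v, g v ∂gaussMeasure u₁ 1 := by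
  haveI := isProbabilityMeasure_driftLaw hσ2 u₁ Φ
  have hfi : Integrable (fun z : Config (N + 1) (Fin 3) T3 => g ((z i).2)) (localGibbsLaw σ (fun _ => 1) (fun _ => u₁) (fun _ => 1) N Φ) := by
    rw [localGibbsLaw_eq]
    exact integrable_vel_localGibbsMeasure_const hσ2 one_pos one_pos u₁ N i hg hC
  have h := integral_window_eq_of_integrable σ 1 1 u₁ N Φ (f := fun z => g ((z i).2))
    (hg.measurable.comp (measurable_pi_apply i).snd) hfi hw
  rw [h, localGibbsLaw_eq, integral_vel_localGibbsMeasure_const hσ2 one_pos one_pos u₁ N i hg]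

/-- **Mean of the window functional under the drifted Gibbs law**: `∫ W dQ = (N+1) ∫ g d(gaussMeasure u₁ 1)`. [folklore] -/
theorem integral_windowSum (Φ : HardSphereFlow (Torus.geometry (Fin 3)) (hsDiameter σ N) (N + 1))
    (u₁ : V3) {w : ℝ} (hw : 0 < w) {g : V3 → ℝ} (hg : Continuous g) {C : ℝ} {m : ℕ}
    (hC : ∀ v, |g v| ≤ C * (1 + ‖v‖ ^ 2) ^ m) :
    ∫ z, (∑ i, w⁻¹ * ∫ r in (0 : ℝ)..w, g ((Φ.flow r z) i).2) ∂(localGibbsLaw σ (fun _ => 1) (fun _ => u₁) (fun _ => 1) N Φ) =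
      (N + 1) * ∫ v, g v ∂gaussMeasure u₁ 1 := by
  rw [integral_finsetSum _ fun i _ => (integrable_window_term hσ2 Φ u₁ hw hg hC i).const_mul w⁻¹]
  simp_rw [integral_const_mul, integral_window_term hσ2 Φ u₁ hw hg hC, ← mul_assoc,
    inv_mul_cancel₀ hw.ne', one_mul]
  simp

end Tilt

end KineticCurrentsWindowTilt
end Summit.AtomisticToContinuum.HydrodynamicLimit.Cruxes.KineticCurrentsWindowLDUniform.Disproof

end


/-!
# The drift-tilt lower bound for window exponential functionals (crux `KineticCurrentsWindowLDUniform`, 3/3)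

Negative knowledge for the crux `OneFlightGossipEngine.KineticCurrentsWindowLDUniform`
(stmt-AtomisticToContinuum-14662), from the standing disprover's `Cruxes/KineticCurrentsWindowLDUniform/Disproof.lean`
§ 3; part 3 of `Negative/{WindowFubini, WindowSum, TiltWindow, LoadBearing}`.

`tilt_window_lower_bound`: for `0 < σ ≤ 1/2`, every `N`, EVERY hard-sphere flow `Φ`, every window `w > 0`, every
drift `u₁ ∈ ℝ³` and every continuous `g` with `|g| ≤ C(1+‖v‖²)^m`,
`exp((N+1)·(E_{N(u₁,I)} g − ‖u₁‖²/2)) ≤ ∫ exp(∑ᵢ w⁻¹∫₀ʷ g(vᵢ(r)) dr) dG_N` — Donsker–Varadhan (Jensen under the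
drifted homogeneous Gibbs law `G_N^{u₁}`; equal partition functions give the tilt identity
`G_N = G_N^{u₁}·e^{∑ llr1}`, tree: `KineticFluxLdDecayTilt.localGibbsMeasure_ref_eq_withDensity`), where the
flow-INVARIANCE of `G_N^{u₁}` makes the mean of the window average the static one-body mean (part 2), at entropy
cost `(N+1)‖u₁‖²/2`. Two instances, uniform in the window and the flow:
* `lintegral_exp_shear_window_eq_top`: for the kinetic shear stress `g = β v₀v₁` and `β > 1` the functional is
  `+∞` (drifts `(s,s,0)`: gain `βs²`, cost `s²`), i.e. time averaging does NOT enlarge the static domain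
  `|β| < 1 = 1/(2θλ_max(A_sym))` of finiteness — the crux's `β₀` is load-bearing and `≤ 1/(2 sup θ₀ λ_max(A_sym))`;
* `exp_le_lintegral_exp_momentum_window`: for `g = β v₀` (a `b·w`-functional WITHOUT `⊥ v_j`) the functional is
  `≥ e^{(N+1)β²/2}`, its full static value, at every window (drift `βe₀`).
These feed the refuted variants of `Negative/LoadBearing.lean`. refuter-cdisprove-stmt-AtomisticToContinuum-14662-0.
-/

noncomputable section

namespace Summit.AtomisticToContinuum.HydrodynamicLimit.Cruxes.KineticCurrentsWindowLDUniform.Disproof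
open Summit.AtomisticToContinuum.HydrodynamicLimit.Theorems
namespace KineticCurrentsWindowTilt

open MeasureTheory ProbabilityTheory Filter Set Topology Real
open scoped ENNReal NNReal InnerProductSpace
open Literature.MathematicalPhysics.KineticTheory Literature.Analysis.FluidPDE
open KineticFluxLdDecayTilt (llr1 llr1_eq llrConfig measurable_llrConfig continuous_llr1
  localGibbsMeasure_ref_eq_withDensity ofReal_exp_integral_le_lintegral integral_eq_zero_of_odd_stdGaussian)

section Tilt

variable {σ : ℝ} {N : ℕ} (hσ2 : σ ≤ 1 / 2)
include hσ2

/-! ### C'. The Donsker–Varadhan step -/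

omit hσ2 in
/-- Closed form of the one-particle log-likelihood ratio at `θ₁ = 1`: `llr1 1 u₁ v = ‖u₁‖²/2 − ⟪v, u₁⟫`. [folklore] -/
theorem llr1_one_eq (u₁ v : V3) : llr1 1 u₁ v = ‖u₁‖ ^ 2 / 2 - ⟪v, u₁⟫_ℝ := by
  rw [llr1_eq one_pos, Real.log_one, mul_zero, zero_sub, mul_one, norm_sub_sq_real]
  ring

omit hσ2 in
/-- `llr1 1 u₁` has quadratic growth. [folklore] -/
theorem abs_llr1_one_le (u₁ v : V3) : |llr1 1 u₁ v| ≤ (1 + ‖u₁‖ ^ 2) * (1 + ‖v‖ ^ 2) := by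
  rw [llr1_one_eq]
  have h1 : |⟪v, u₁⟫_ℝ| ≤ ‖v‖ * ‖u₁‖ := abs_real_inner_le_norm v u₁
  have h2 := abs_sub (‖u₁‖ ^ 2 / 2) ⟪v, u₁⟫_ℝ
  rw [abs_of_nonneg (by positivity : (0 : ℝ) ≤ ‖u₁‖ ^ 2 / 2)] at h2
  nlinarith [norm_nonneg v, norm_nonneg u₁, sq_nonneg (‖v‖ - ‖u₁‖), mul_nonneg (norm_nonneg v) (norm_nonneg u₁),
    sq_nonneg ‖v‖, sq_nonneg ‖u₁‖, mul_nonneg (sq_nonneg ‖v‖) (sq_nonneg ‖u₁‖)]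

omit hσ2 in
/-- `⟪·, u₁⟫` is integrable under the standard Gaussian. [folklore] -/
theorem integrable_inner_stdGaussian (u₁ : V3) : Integrable (fun w : V3 => ⟪w, u₁⟫_ℝ) (stdGaussian V3) := by
  have hdom : Integrable (fun w : V3 => ‖u₁‖ * (1 + ‖w‖ ^ 2)) (stdGaussian V3) :=
    ((integrable_const (1 : ℝ)).add integrable_norm_sq_stdGaussian).const_mul ‖u₁‖
  refine hdom.mono' (by fun_prop : Continuous fun w : V3 => ⟪w, u₁⟫_ℝ).aestronglyMeasurable
    (ae_of_all _ fun w => ?_)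
  rw [Real.norm_eq_abs]
  refine (abs_real_inner_le_norm w u₁).trans ?_
  nlinarith [norm_nonneg w, norm_nonneg u₁, sq_nonneg (‖w‖ - 1), mul_nonneg (norm_nonneg u₁) (sq_nonneg (‖w‖ - 1))]

omit hσ2 in
/-- **Mean log-likelihood ratio under the drifted law = minus the relative entropy per particle**:
`∫ llr1 1 u₁ d(gaussMeasure u₁ 1) = −‖u₁‖²/2`. [folklore] -/
theorem integral_llr1_gaussMeasure (u₁ : V3) : ∫ v, llr1 1 u₁ v ∂gaussMeasure u₁ 1 = -(‖u₁‖ ^ 2 / 2) := by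
  rw [integral_gaussMeasure u₁ one_pos]
  simp_rw [llr1_one_eq, Real.sqrt_one, one_smul, inner_add_left, real_inner_self_eq_norm_sq]
  have h : ∀ w : V3, ‖u₁‖ ^ 2 / 2 - (‖u₁‖ ^ 2 + ⟪w, u₁⟫_ℝ) = -(‖u₁‖ ^ 2 / 2) - ⟪w, u₁⟫_ℝ := by
    intro w; ring
  simp_rw [h]
  rw [integral_sub (integrable_const _) (integrable_inner_stdGaussian u₁), integral_const]
  simp only [Measure.real, measure_univ, ENNReal.toReal_one, one_smul]
  have hodd : ∫ w : V3, ⟪w, u₁⟫_ℝ ∂stdGaussian V3 = 0 :=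
    integral_eq_zero_of_odd_stdGaussian fun w => by rw [inner_neg_left]
  rw [hodd, sub_zero]

/-- The configuration log-likelihood ratio is integrable under the drifted law, with mean `−(N+1)‖u₁‖²/2`. [folklore] -/
theorem integral_llrConfig_driftLaw (u₁ : V3)
    (Φ : HardSphereFlow (Torus.geometry (Fin 3)) (hsDiameter σ N) (N + 1)) :
    Integrable (llrConfig 1 u₁ : Config (N + 1) (Fin 3) T3 → ℝ) (localGibbsLaw σ (fun _ => 1) (fun _ => u₁) (fun _ => 1) N Φ) ∧
      ∫ z, llrConfig 1 u₁ z ∂(localGibbsLaw σ (fun _ => 1) (fun _ => u₁) (fun _ => 1) N Φ) = -((N + 1) * (‖u₁‖ ^ 2 / 2)) := by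
  have hterm : ∀ i : Fin (N + 1), Integrable (fun z : Config (N + 1) (Fin 3) T3 => llr1 1 u₁ ((z i).2))
      (localGibbsLaw σ (fun _ => 1) (fun _ => u₁) (fun _ => 1) N Φ) := fun i => by
    rw [localGibbsLaw_eq]
    exact integrable_vel_localGibbsMeasure_const hσ2 one_pos one_pos u₁ N i (continuous_llr1 one_pos u₁)
      (m := 1) (fun v => by rw [pow_one]; exact abs_llr1_one_le u₁ v)
  refine ⟨?_, ?_⟩
  · have := integrable_finsetSum (Finset.univ : Finset (Fin (N + 1))) fun i _ => hterm i
    refine this.congr (ae_of_all _ fun z => ?_)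
    simp [llrConfig]
  · unfold llrConfig
    rw [integral_finsetSum _ fun i _ => hterm i]
    have h1 : ∀ i : Fin (N + 1), ∫ z : Config (N + 1) (Fin 3) T3, llr1 1 u₁ ((z i).2) ∂(localGibbsLaw σ (fun _ => 1) (fun _ => u₁) (fun _ => 1) N Φ) =
        -(‖u₁‖ ^ 2 / 2) := fun i => by
      rw [localGibbsLaw_eq, integral_vel_localGibbsMeasure_const hσ2 one_pos one_pos u₁ N i
        (continuous_llr1 one_pos u₁), integral_llr1_gaussMeasure]
    simp_rw [h1]
    simp only [Finset.sum_const, Finset.card_univ, Fintype.card_fin]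
    ring

/-- **THE DRIFT-TILT LOWER BOUND FOR WINDOW EXPONENTIAL FUNCTIONALS.** For `0 < σ ≤ 1/2`, every `N`, EVERY
hard-sphere flow `Φ`, every window `w > 0`, every drift `u₁ ∈ ℝ³` and every continuous `g` with `|g| ≤ C(1+‖v‖²)^m`:
`exp((N+1)·(E_{N(u₁,I)} g − ‖u₁‖²/2)) ≤ ∫ exp(∑ᵢ w⁻¹∫₀ʷ g(vᵢ(r)) dr) dG_N` — Donsker–Varadhan with the drifted
homogeneous Gibbs law `G_N^{u₁}` (equal partition functions, `G_N = G_N^{u₁}·e^{∑ llr1}`), whose flow-INVARIANCE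
makes the mean of the window average equal to the static one-body mean `(N+1) E_{N(u₁,I)} g`, at entropy cost
`(N+1)‖u₁‖²/2`; uniform in the window and in the flow. [folklore] -/
theorem tilt_window_lower_bound (Φ : HardSphereFlow (Torus.geometry (Fin 3)) (hsDiameter σ N) (N + 1))
    (u₁ : V3) {w : ℝ} (hw : 0 < w) {g : V3 → ℝ} (hg : Continuous g) {C : ℝ} {m : ℕ}
    (hC : ∀ v, |g v| ≤ C * (1 + ‖v‖ ^ 2) ^ m) :
    ENNReal.ofReal (Real.exp ((N + 1) * (∫ v, g v ∂gaussMeasure u₁ 1 - ‖u₁‖ ^ 2 / 2))) ≤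
      ∫⁻ z, ENNReal.ofReal (Real.exp ((∑ i, w⁻¹ * ∫ r in (0 : ℝ)..w, g ((Φ.flow r z) i).2))) ∂(localGibbsLaw σ (fun _ => 1) (fun _ => 0) (fun _ => 1) N Φ) := by
  haveI := isProbabilityMeasure_driftLaw hσ2 u₁ Φ
  set Q := localGibbsLaw σ (fun _ => 1) (fun _ => u₁) (fun _ => 1) N Φ with hQ
  have hW : Integrable (fun z => ∑ i, w⁻¹ * ∫ r in (0 : ℝ)..w, g ((Φ.flow r z) i).2) Q := integrable_windowSum hσ2 Φ u₁ hw hg hC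
  obtain ⟨hL, hLint⟩ := integral_llrConfig_driftLaw hσ2 u₁ Φ
  have hWm : AEMeasurable (fun z => ∑ i, w⁻¹ * ∫ r in (0 : ℝ)..w, g ((Φ.flow r z) i).2) Q := aemeasurable_windowSum Φ w hg.measurable (driftLaw_compl_good u₁ Φ)
  have hLm : Measurable (llrConfig 1 u₁ : Config (N + 1) (Fin 3) T3 → ℝ) := measurable_llrConfig one_pos u₁ _
  -- the reference law is the tilted drifted law
  have hP : (localGibbsLaw σ (fun _ => 1) (fun _ => 0) (fun _ => 1) N Φ) = Q.withDensity fun z => ENNReal.ofReal (Real.exp (llrConfig 1 u₁ z)) := by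
    rw [localGibbsLaw_eq, localGibbsMeasure_ref_eq_withDensity σ one_pos u₁ N, hQ, localGibbsLaw_eq]
  -- Jensen under `Q`
  have hJ := ofReal_exp_integral_le_lintegral Q (hW.add hL)
  rw [integral_add' hW hL, integral_windowSum hσ2 Φ u₁ hw hg hC, hLint] at hJ
  have hexp : ((N : ℝ) + 1) * (∫ v, g v ∂gaussMeasure u₁ 1 - ‖u₁‖ ^ 2 / 2) =
      ((N : ℝ) + 1) * ∫ v, g v ∂gaussMeasure u₁ 1 + -(((N : ℝ) + 1) * (‖u₁‖ ^ 2 / 2)) := by ring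
  rw [hexp]
  refine hJ.trans (le_of_eq ?_)
  rw [hP, lintegral_withDensity_eq_lintegral_mul₀ hLm.exp.ennreal_ofReal.aemeasurable
    hWm.exp.ennreal_ofReal]
  refine lintegral_congr fun z => ?_
  simp only [Pi.add_apply, Pi.mul_apply]
  rw [Real.exp_add, ENNReal.ofReal_mul (Real.exp_pos _).le, mul_comm]

/-! ### D. Two instances: the shear stress beyond `β = 1`, and a momentum component -/

omit hσ2 in
/-- Coordinates of the diagonal drift. [folklore] -/
theorem diagDrift_apply (s : ℝ) : (EuclideanSpace.single 0 s + EuclideanSpace.single 1 s : V3) 0 = s ∧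
    (EuclideanSpace.single 0 s + EuclideanSpace.single 1 s : V3) 1 = s ∧
    (EuclideanSpace.single 0 s + EuclideanSpace.single 1 s : V3) 2 = 0 := by
  simp

omit hσ2 in
/-- `‖(s,s,0)‖² = 2s²`. [folklore] -/
theorem norm_diagDrift_sq (s : ℝ) : ‖(EuclideanSpace.single 0 s + EuclideanSpace.single 1 s : V3)‖ ^ 2 = 2 * s ^ 2 := by
  rw [BoltzmannGreenKuboForallN.norm_sq_eq_three]
  obtain ⟨h0, h1, h2⟩ := diagDrift_apply s
  rw [h0, h1, h2]
  ring

omit hσ2 in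
/-- The kinetic shear stress `β v₀ v₁` has quadratic growth. [folklore] -/
theorem abs_shear_le (β : ℝ) (v : V3) : |β * (v 0 * v 1)| ≤ |β| * (1 + ‖v‖ ^ 2) := by
  rw [abs_mul]
  refine mul_le_mul_of_nonneg_left ?_ (abs_nonneg β)
  rw [BoltzmannGreenKuboForallN.norm_sq_eq_three, abs_le]
  constructor <;> nlinarith [sq_nonneg (v 0 + v 1), sq_nonneg (v 0 - v 1), sq_nonneg (v 2)]

omit hσ2 in
/-- **Mean shear stress under the diagonally drifted Maxwellian**: `E_{N((s,s,0),I)}[β v₀v₁] = β s²`. [folklore] -/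
theorem integral_shear_gaussMeasure_diagDrift (β s : ℝ) :
    ∫ v, β * (v 0 * v 1) ∂gaussMeasure ((EuclideanSpace.single 0 s + EuclideanSpace.single 1 s : V3)) 1 = β * s ^ 2 := by
  rw [integral_const_mul, integral_gaussMeasure _ one_pos]
  congr 1
  have hc : ∀ w : V3, (EuclideanSpace.single 0 s + EuclideanSpace.single 1 s + w : V3) 0 = s + w 0 ∧
      (EuclideanSpace.single 0 s + EuclideanSpace.single 1 s + w : V3) 1 = s + w 1 := fun w => by
    constructor <;> simp [PiLp.add_apply]
  simp_rw [Real.sqrt_one, one_smul, (hc _).1, (hc _).2]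
  have hsplit : ∀ w : V3, (s + w 0) * (s + w 1) = s ^ 2 + (s * w 0 + s * w 1 + w 0 * w 1) := by
    intro w; ring
  simp_rw [hsplit]
  have hi0 : Integrable (fun w : V3 => w 0) (stdGaussian V3) := (memLp_coord_stdGaussian 0 1 (by simp)).integrable le_rfl
  have hi1 : Integrable (fun w : V3 => w 1) (stdGaussian V3) := (memLp_coord_stdGaussian 1 1 (by simp)).integrable le_rfl
  have hi01 : Integrable (fun w : V3 => w 0 * w 1) (stdGaussian V3) := by
    refine (integrable_norm_sq_stdGaussian).mono' ?_ (ae_of_all _ fun w => ?_)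
    · exact ((EuclideanSpace.proj (𝕜 := ℝ) (0 : Fin 3)).continuous.mul
        (EuclideanSpace.proj (𝕜 := ℝ) (1 : Fin 3)).continuous).aestronglyMeasurable
    · rw [Real.norm_eq_abs, BoltzmannGreenKuboForallN.norm_sq_eq_three, abs_le]
      constructor <;> nlinarith [sq_nonneg (w 0 + w 1), sq_nonneg (w 0 - w 1), sq_nonneg (w 2)]
  have hB : Integrable (fun w : V3 => s * w 0 + s * w 1) (stdGaussian V3) := (hi0.const_mul s).add (hi1.const_mul s)
  have hA : Integrable (fun w : V3 => s * w 0 + s * w 1 + w 0 * w 1) (stdGaussian V3) := hB.add hi01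
  rw [integral_add (integrable_const _) hA, integral_add hB hi01, integral_add (hi0.const_mul s) (hi1.const_mul s),
    integral_const_mul, integral_const_mul, integral_coord_stdGaussian, integral_coord_stdGaussian,
    BoltzmannGreenKuboForallN.integral_stdGaussian_eq_zero_of_odd (BoltzmannGreenKuboForallN.reflB 0)
      (G := fun w : V3 => w 0 * w 1) (fun w => by simp [BoltzmannGreenKuboForallN.reflB_apply]),
    integral_const]
  simp only [Measure.real, measure_univ, ENNReal.toReal_one, one_smul]
  ring

/-- **Beyond `β = 1` the window functional of the shear stress is INFINITE**, for every `0 < σ ≤ 1/2`, `N`, flow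
and window: `∫ exp(β ∑ᵢ w⁻¹∫₀ʷ v_{i,0}v_{i,1} dr) dG_N = ∞` when `β > 1` (drifts `(s,s,0)`, `s → ∞`: gain `βs²`,
cost `s²` per particle). So the static integrability threshold `β < 1 = 1/(2θλ_max(A))` of `∫e^{βF}M` is NOT
improved by time averaging: the crux's `β₀` must satisfy `β₀ ≤ 1/(2 sup θ₀ · λ_max(A_sym))`, uniformly in `τ`. [folklore] -/
theorem lintegral_exp_shear_window_eq_top (Φ : HardSphereFlow (Torus.geometry (Fin 3)) (hsDiameter σ N) (N + 1))
    {w : ℝ} (hw : 0 < w) {β : ℝ} (hβ : 1 < β) :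
    ∫⁻ z, ENNReal.ofReal (Real.exp (β * (∑ i, w⁻¹ * ∫ r in (0 : ℝ)..w, ((Φ.flow r z) i).2 0 * ((Φ.flow r z) i).2 1))) ∂(localGibbsLaw σ (fun _ => 1) (fun _ => 0) (fun _ => 1) N Φ) = ⊤ := by
  refine ENNReal.eq_top_of_forall_nnreal_le fun r => ?_
  -- choose the drift size
  set s : ℝ := Real.sqrt ((r : ℝ) / ((N + 1) * (β - 1))) with hs
  have hden : 0 < ((N : ℝ) + 1) * (β - 1) := by
    have : (0 : ℝ) < (N : ℝ) + 1 := by positivity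
    exact mul_pos this (by linarith)
  have hs2 : s ^ 2 = (r : ℝ) / ((N + 1) * (β - 1)) := Real.sq_sqrt (div_nonneg r.2 hden.le)
  have hkey := tilt_window_lower_bound hσ2 Φ ((EuclideanSpace.single 0 s + EuclideanSpace.single 1 s : V3)) hw
    (g := fun v => β * (v 0 * v 1)) (by fun_prop) (m := 1) (fun v => by rw [pow_one]; exact abs_shear_le β v)
  rw [integral_shear_gaussMeasure_diagDrift, norm_diagDrift_sq] at hkey
  simp_rw [window_sum_const_mul Φ w β (fun v : V3 => v 0 * v 1)] at hkey
  refine le_trans ?_ hkey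
  have hβ1 : β - 1 ≠ 0 := by linarith
  have hN1 : (N : ℝ) + 1 ≠ 0 := by positivity
  have hexp : ((N : ℝ) + 1) * (β * s ^ 2 - 2 * s ^ 2 / 2) = r := by
    rw [hs2]; field_simp
  rw [hexp, ← ENNReal.ofReal_coe_nnreal]
  exact ENNReal.ofReal_le_ofReal ((by linarith [Real.add_one_le_exp (r : ℝ)]) : (r : ℝ) ≤ Real.exp r)

/-- **A momentum component never decorrelates at exponential scale**: for `g(v) = β v₀` (the `b·w` part of the
crux's class with `G ≡ 1`, i.e. WITHOUT the orthogonality to `v_j`), every `0 < σ ≤ 1/2`, `N`, flow and window,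
`∫ exp(β ∑ᵢ w⁻¹∫₀ʷ v_{i,0}(r) dr) dG_N ≥ exp((N+1) β²/2)` (drift `β e₀`: gain `β²`, cost `β²/2`) — the full
static value `E e^{βP₀} = e^{(N+1)β²/2}`, at every window. [folklore] -/
theorem exp_le_lintegral_exp_momentum_window (Φ : HardSphereFlow (Torus.geometry (Fin 3)) (hsDiameter σ N) (N + 1))
    {w : ℝ} (hw : 0 < w) (β : ℝ) :
    ENNReal.ofReal (Real.exp ((N + 1) * (β ^ 2 / 2))) ≤
      ∫⁻ z, ENNReal.ofReal (Real.exp (β * (∑ i, w⁻¹ * ∫ r in (0 : ℝ)..w, ((Φ.flow r z) i).2 0))) ∂(localGibbsLaw σ (fun _ => 1) (fun _ => 0) (fun _ => 1) N Φ) := by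
  have hC : ∀ v : V3, |β * v 0| ≤ |β| * (1 + ‖v‖ ^ 2) ^ 1 := by
    intro v
    rw [pow_one, abs_mul]
    refine mul_le_mul_of_nonneg_left ?_ (abs_nonneg β)
    rw [BoltzmannGreenKuboForallN.norm_sq_eq_three, abs_le]
    constructor <;> nlinarith [sq_nonneg (v 0 + 1), sq_nonneg (v 0 - 1), sq_nonneg (v 1), sq_nonneg (v 2)]
  have hkey := tilt_window_lower_bound hσ2 Φ (EuclideanSpace.single 0 β) hw
    (g := fun v => β * v 0) (by fun_prop) hC
  have h1 : (EuclideanSpace.single (0 : Fin 3) β : V3) 0 = β := by simp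
  have h2 : ‖(EuclideanSpace.single (0 : Fin 3) β : V3)‖ = |β| := by
    rw [EuclideanSpace.single, PiLp.norm_single, Real.norm_eq_abs]
  rw [integral_const_mul, integral_coord_gaussMeasure _ one_pos, h1, h2, sq_abs] at hkey
  simp_rw [window_sum_const_mul Φ w β (fun v : V3 => v 0)] at hkey
  have hexp : ((N : ℝ) + 1) * (β * β - β ^ 2 / 2) = ((N : ℝ) + 1) * (β ^ 2 / 2) := by ring
  rw [hexp] at hkey
  exact hkey

end Tilt

end KineticCurrentsWindowTilt
end Summit.AtomisticToContinuum.HydrodynamicLimit.Cruxes.KineticCurrentsWindowLDUniform.Disproof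

end


/-!
# `KineticCurrentsWindowLDUniform`: `∃ β₀` (small `β`) and `⊥ v_j` are load-bearing — two refuted variants

Negative knowledge for the crux `OneFlightGossipEngine.KineticCurrentsWindowLDUniform`
(stmt-AtomisticToContinuum-14662), from the standing disprover's `Cruxes/KineticCurrentsWindowLDUniform/Disproof.lean`
§§ 3–4, using the drift-tilt lower bound of `Negative/TiltWindow.lean` (Donsker–Varadhan with drifted, flow-INVARIANT
homogeneous Gibbs laws) and the shear-stress witness of `Negative/ForallN.lean`.

* `KineticCurrentsWindowLDUniformAllBeta` — the crux VERBATIM with `∃ β₀ > 0, ∀ |β| ≤ β₀` strengthened to `∀ β` — is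
  FALSE: for `a = θ₀ = 1`, `u₀ = 0`, `F = v₀v₁` and `β = 2 > 1 = 1/(2θ₀λ_max(A_sym))` the window functional is `+∞`
  for EVERY `N`, flow and window (`KineticCurrentsWindowTilt.lintegral_exp_shear_window_eq_top`: drifts `(s,s,0)`,
  gain `βs²` against entropy `s²` per particle, `s → ∞`), so no `τ, N₀` can bring it below `e^{ε(N+1)}`.
  Hence `β₀` is load-bearing and QUANTITATIVELY `β₀ ≤ 1/(2 sup θ₀ · λ_max(A_sym))`: time averaging over kinetic
  windows does not enlarge the static domain of finiteness of `Λ(β)`, uniformly in `τ` — a proof whose admissible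
  `β`-range grows with `τ` is wrong.
* `KineticCurrentsWindowLDUniformWithoutOrthMom` — the crux VERBATIM with the hypothesis `F ⊥ v_j` DELETED — is
  FALSE: `F = v₀ = (e₀·w)·1` (`A = 0`, `b = e₀`, `G ≡ 1`; continuous, `|F| ≤ 1+‖v‖²`, `⊥ 1` and `⊥ ‖v‖²` by
  oddness) has `∫ exp(β ∑ᵢ w⁻¹∫₀ʷ v_{i,0}) dG_N ≥ e^{(N+1)β²/2}` at EVERY window and `N`
  (`KineticCurrentsWindowTilt.exp_le_lintegral_exp_momentum_window`: drift `βe₀`), which beats `e^{ε(N+1)}` at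
  `ε = β₀²/4`, `β = β₀`, whatever `β₀ > 0` is offered. (The momentum `P₀ = ∑ v_{i,0}` is conserved; the tilt
  argument does not even use that — only invariance of the drifted Gibbs law.)
refuter-cdisprove-stmt-AtomisticToContinuum-14662-0.
-/

noncomputable section

namespace Summit.AtomisticToContinuum.HydrodynamicLimit.Cruxes.KineticCurrentsWindowLDUniform.Disproof
open Summit.AtomisticToContinuum.HydrodynamicLimit.Theorems

open MeasureTheory ProbabilityTheory Real
open scoped ENNReal InnerProductSpace
open Literature.Analysis.FluidPDE Literature.MathematicalPhysics.KineticTheory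

namespace KineticCurrentsWindowLDUniformLoadBearing

open KineticCurrentsWindowLDUniformOneSphere
open KineticCurrentsWindowTilt
open BoltzmannGreenKuboForallN (reflB reflB_apply integral_stdGaussian_eq_zero_of_odd norm_sq_eq_three)

/-- The small reduced diameter used by all witnesses: `σ = min(1/4, η₀, 1)`. -/
def sigmaOf (η₀ : ℝ) : ℝ := min (1 / 4) (min η₀ 1)

/-- Properties of `sigmaOf η₀` for `η₀ > 0`: positive, `≤ 1/4`, `≤ η₀`, `≤ 1`. [folklore] -/
theorem sigmaOf_spec {η₀ : ℝ} (hη₀ : 0 < η₀) :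
    0 < sigmaOf η₀ ∧ sigmaOf η₀ ≤ 1 / 4 ∧ sigmaOf η₀ ≤ η₀ ∧ sigmaOf η₀ ≤ 1 :=
  ⟨lt_min (by norm_num) (lt_min hη₀ one_pos), min_le_left _ _,
    (min_le_right _ _).trans (min_le_left _ _), (min_le_right _ _).trans (min_le_right _ _)⟩

/-- The activity guard `σ³ · sup a ≤ η₀ ∫ a` holds for `a ≡ 1` and `σ = sigmaOf η₀`. [folklore] -/
theorem guard_sigmaOf {η₀ : ℝ} (hη₀ : 0 < η₀) :
    sigmaOf η₀ ^ 3 * (⨆ _x : T3, (1 : ℝ)) ≤ η₀ * ∫ _x : T3, (1 : ℝ) := by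
  obtain ⟨hpos, -, hη, h1⟩ := sigmaOf_spec hη₀
  have hsup : (⨆ _x : T3, (1 : ℝ)) = 1 := ciSup_const
  have hint : ∫ _x : T3, (1 : ℝ) = 1 := by simp
  rw [hsup, hint, mul_one, mul_one]
  calc sigmaOf η₀ ^ 3 ≤ sigmaOf η₀ := by
        have : sigmaOf η₀ ^ 3 ≤ sigmaOf η₀ ^ 1 := pow_le_pow_of_le_one hpos.le h1 (by norm_num)
        simpa using this
    _ ≤ η₀ := hη

/-! ### The witness `F = v₀` (no orthogonality to `v_j`) -/

/-- `A ≡ 0`. -/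
def A0 : T3 → Fin 3 → Fin 3 → ℝ := fun _ _ _ => 0

/-- `b ≡ e₀`. -/
def bE0 : T3 → V3 := fun _ => EuclideanSpace.single 0 1

/-- `G ≡ 1`. -/
def G1 : T3 × ℝ → ℝ := fun _ => 1

/-- The crux functional at `A = 0`, `b = e₀`, `G = 1`, `u₀ = 0` is the momentum component `v₀`
(stated in the beta-normal form the crux produces after instantiation). [folklore] -/
theorem F_mom (x : T3) (v : V3) :
    ((∑ j : Fin 3, ∑ k : Fin 3, A0 x j k * ((v - 0) j * (v - 0) k)) +
      (∑ j : Fin 3, bE0 x j * (v - 0) j) * G1 (x, ‖v - 0‖ ^ 2)) = v 0 := by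
  simp [A0, bE0, G1]

/-- `|v₀| ≤ 1 · (1 + ‖v‖²)`. [folklore] -/
theorem abs_coord_le (v : V3) : |v 0| ≤ 1 * (1 + ‖v‖ ^ 2) := by
  rw [one_mul, norm_sq_eq_three, abs_le]
  constructor <;> nlinarith [sq_nonneg (v 0 + 1), sq_nonneg (v 0 - 1), sq_nonneg (v 1), sq_nonneg (v 2)]

/-- `v₀ ⊥ 1` under the Maxwellian (odd under `v₀ ↦ -v₀`). [folklore] -/
theorem coord_orth_one : ∫ v, v 0 * localMaxwellian 1 1 (0 : V3) v = 0 := by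
  rw [integral_mul_localMaxwellian_eq]
  exact integral_stdGaussian_eq_zero_of_odd (reflB 0) (G := fun v : V3 => v 0) fun w => by simp [reflB_apply]

/-- `v₀ ⊥ ‖v‖²` under the Maxwellian (odd under `v₀ ↦ -v₀`, which preserves the norm). [folklore] -/
theorem coord_orth_energy : ∫ v, v 0 * ‖v‖ ^ 2 * localMaxwellian 1 1 (0 : V3) v = 0 := by
  rw [integral_mul_localMaxwellian_eq]
  refine integral_stdGaussian_eq_zero_of_odd (reflB 0) (G := fun v : V3 => v 0 * ‖v‖ ^ 2) fun w => ?_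
  simp [reflB_apply]


end KineticCurrentsWindowLDUniformLoadBearing

open KineticCurrentsWindowLDUniformOneSphere KineticCurrentsWindowTilt KineticCurrentsWindowLDUniformLoadBearing
open ShearStressHalfDrudeNonCentred (lintegral_vel_localGibbsMeasure)

/-! ### Variant 1: all `β` -/

/-- **A FALSE proposition — NOT a citable fact.** The crux `OneFlightGossipEngine.KineticCurrentsWindowLDUniform`
(stmt-AtomisticToContinuum-14662) VERBATIM with `∃ β₀ > 0, ∀ β, |β| ≤ β₀ →` strengthened to `∀ β`; kept only as the
statement that `not_kineticCurrentsWindowLDUniformAllBeta` negates (load-bearing analysis: small `β` is necessary,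
and quantitatively `β₀ ≤ 1/(2 sup θ₀ λ_max(A))`). [folklore] -/
def KineticCurrentsWindowLDUniformAllBeta : Prop :=
  ∃ η₀ : ℝ, 0 < η₀ ∧ ∀ (a θ₀ : Literature.MathematicalPhysics.KineticTheory.T3 → ℝ) (u₀ : Literature.MathematicalPhysics.KineticTheory.T3 → Literature.MathematicalPhysics.KineticTheory.V3), Continuous a → Continuous θ₀ → Continuous u₀ → (∀ x, 0 < a x) → (∀ x, 0 < θ₀ x) → ∀ σ : ℝ, 0 < σ → σ ^ 3 * (⨆ x, a x) ≤ η₀ * ∫ x, a x → ∀ Φ : (N : ℕ) → Literature.Analysis.FluidPDE.HardSphereFlow (Literature.Analysis.FluidPDE.Torus.geometry (Fin 3)) (Literature.MathematicalPhysics.KineticTheory.hsDiameter σ N) (N + 1), ∀ (A : Literature.MathematicalPhysics.KineticTheory.T3 → Fin 3 → Fin 3 → ℝ) (b : Literature.MathematicalPhysics.KineticTheory.T3 → Literature.MathematicalPhysics.KineticTheory.V3) (G : Literature.MathematicalPhysics.KineticTheory.T3 × ℝ → ℝ), Continuous A → Continuous b → Continuous G → (∃ C : ℝ, ∀ y : Literature.MathematicalPhysics.KineticTheory.T3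 × Literature.MathematicalPhysics.KineticTheory.V3, |(fun y : Literature.MathematicalPhysics.KineticTheory.T3 × Literature.MathematicalPhysics.KineticTheory.V3 => ((∑ j : Fin 3, ∑ k : Fin 3, A y.1 j k * ((y.2 - u₀ y.1) j * (y.2 - u₀ y.1) k)) + (∑ j : Fin 3, b y.1 j * (y.2 - u₀ y.1) j) * G (y.1, ‖y.2 - u₀ y.1‖ ^ 2))) y| ≤ C * (1 + ‖y.2‖ ^ 2)) → (∀ x, ∫ v, (fun y : Literature.MathematicalPhysics.KineticTheory.T3 × Literature.MathematicalPhysics.KineticTheory.V3 => ((∑ j : Fin 3, ∑ k : Fin 3, A y.1 j k * ((y.2 - u₀ y.1) j * (y.2 - u₀ y.1) k)) + (∑ j : Fin 3, b y.1 j * (y.2 - u₀ y.1) j) * G (y.1, ‖y.2 - u₀ y.1‖ ^ 2))) (x, v) * Literature.Analysis.FluidPDE.localMaxwellian 1 (θ₀ x) (u₀ x) v = 0) → (∀ x (j : Fin 3), ∫ v, (fun y : Literature.MathematicalPhysics.KineticTheory.T3 × Literature.MathematicalPhysics.KineticTheory.V3 => ((∑ j : Fin 3, ∑ k : Fin 3,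 A y.1 j k * ((y.2 - u₀ y.1) j * (y.2 - u₀ y.1) k)) + (∑ j : Fin 3, b y.1 j * (y.2 - u₀ y.1) j) * G (y.1, ‖y.2 - u₀ y.1‖ ^ 2))) (x, v) * v j * Literature.Analysis.FluidPDE.localMaxwellian 1 (θ₀ x) (u₀ x) v = 0) → (∀ x, ∫ v, (fun y : Literature.MathematicalPhysics.KineticTheory.T3 × Literature.MathematicalPhysics.KineticTheory.V3 => ((∑ j : Fin 3, ∑ k : Fin 3, A y.1 j k * ((y.2 - u₀ y.1) j * (y.2 - u₀ y.1) k)) + (∑ j : Fin 3, b y.1 j * (y.2 - u₀ y.1) j) * G (y.1, ‖y.2 - u₀ y.1‖ ^ 2))) (x, v) * ‖v‖ ^ 2 * Literature.Analysis.FluidPDE.localMaxwellian 1 (θ₀ x) (u₀ x) v = 0) → ∀ β : ℝ, ∀ ε : ℝ, 0 < ε → ∃ τ : ℝ, 0 < τ ∧ ∃ N₀ : ℕ, ∀ N : ℕ, N₀ ≤ N → ∫⁻ z, ENNReal.ofReal (Real.exp (β * ∑ i : Fin (N + 1), (τ * ((N : ℝ) + 1) ^ (-(1 / 3 : ℝ)))⁻¹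 * ∫ r in (0 : ℝ)..(τ * ((N : ℝ) + 1) ^ (-(1 / 3 : ℝ))), (fun y : Literature.MathematicalPhysics.KineticTheory.T3 × Literature.MathematicalPhysics.KineticTheory.V3 => ((∑ j : Fin 3, ∑ k : Fin 3, A y.1 j k * ((y.2 - u₀ y.1) j * (y.2 - u₀ y.1) k)) + (∑ j : Fin 3, b y.1 j * (y.2 - u₀ y.1) j) * G (y.1, ‖y.2 - u₀ y.1‖ ^ 2))) (((Φ N).flow r z) i))) ∂(Literature.MathematicalPhysics.KineticTheory.localGibbsLaw σ a u₀ θ₀ N (Φ N)) ≤ ENNReal.ofReal (Real.exp (ε * ((N : ℝ) + 1)))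

/-- **THE "FOR EVERY `β`" STRENGTHENING IS FALSE.** Witness: `η₀` arbitrary, `a = θ₀ = 1`, `u₀ = 0`,
`σ = min(1/4, η₀, 1)`, Alexander flows, `F = v₀v₁`, `β = 2`, `ε = 1`: whatever `τ, N₀` are offered, at `N = N₀`
the window functional is `+∞` (`lintegral_exp_shear_window_eq_top`, `2 > 1`), not `≤ e^{N₀+1}`. [folklore] -/
theorem not_kineticCurrentsWindowLDUniformAllBeta : ¬ KineticCurrentsWindowLDUniformAllBeta := by
  rintro ⟨η₀, hη₀, h⟩
  obtain ⟨hσpos, hσ4, -, -⟩ := sigmaOf_spec hη₀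
  have hσhalf : sigmaOf η₀ ≤ 1 / 2 := hσ4.trans (by norm_num)
  have hσhalf' : sigmaOf η₀ < 2⁻¹ := hσ4.trans_lt (by norm_num)
  have hmain := h (fun _ => 1) (fun _ => 1) (fun _ => 0) continuous_const continuous_const
    continuous_const (fun _ => one_pos) (fun _ => one_pos) (sigmaOf η₀) hσpos (guard_sigmaOf hη₀)
    (alexFlow hσpos hσhalf') A01 (fun _ => 0) (fun _ => 0) continuous_const continuous_const continuous_const
  have hmain' : (∃ C : ℝ, ∀ y : T3 × V3, |gShear y.2| ≤ C * (1 + ‖y.2‖ ^ 2)) →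
      (∀ x : T3, ∫ v, gShear v * localMaxwellian 1 1 (0 : V3) v = 0) →
      (∀ (x : T3) (j : Fin 3), ∫ v, gShear v * v j * localMaxwellian 1 1 (0 : V3) v = 0) →
      (∀ x : T3, ∫ v, gShear v * ‖v‖ ^ 2 * localMaxwellian 1 1 (0 : V3) v = 0) →
      ∀ β : ℝ, ∀ ε : ℝ, 0 < ε → ∃ τ : ℝ, 0 < τ ∧ ∃ N₀ : ℕ, ∀ N : ℕ, N₀ ≤ N →
        ∫⁻ z, ENNReal.ofReal (Real.exp (β * ∑ i : Fin (N + 1), (τ * ((N : ℝ) + 1) ^ (-(1 / 3 : ℝ)))⁻¹ *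
          ∫ r in (0 : ℝ)..(τ * ((N : ℝ) + 1) ^ (-(1 / 3 : ℝ))),
            gShear (((alexFlow hσpos hσhalf' N).flow r z) i).2))
          ∂(localGibbsLaw (sigmaOf η₀) (fun _ => 1) (fun _ => 0) (fun _ => 1) N (alexFlow hσpos hσhalf' N)) ≤
        ENNReal.ofReal (Real.exp (ε * ((N : ℝ) + 1))) := by
    simpa only [F_A01] using hmain
  clear hmain h
  obtain ⟨τ, hτ, N₀, hN⟩ := hmain' ⟨1, fun y => abs_gShear_le y.2⟩ (fun _ => gShear_orth_one)
    (fun _ j => gShear_orth_mom j) (fun _ => gShear_orth_energy) 2 1 one_pos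
  have h0 := hN N₀ le_rfl
  have hw : 0 < τ * ((N₀ : ℝ) + 1) ^ (-(1 / 3 : ℝ)) := mul_pos hτ (Real.rpow_pos_of_pos (by positivity) _)
  have htop := lintegral_exp_shear_window_eq_top hσhalf (alexFlow hσpos hσhalf' N₀) hw (β := 2) (by norm_num)
  have hle : (⊤ : ℝ≥0∞) ≤ ENNReal.ofReal (Real.exp (1 * ((N₀ : ℝ) + 1))) := le_of_eq_of_le htop.symm h0
  exact absurd hle (not_le.2 ENNReal.ofReal_lt_top)

/-! ### Variant 2: no orthogonality to `v_j` -/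

/-- **A FALSE proposition — NOT a citable fact.** The crux `OneFlightGossipEngine.KineticCurrentsWindowLDUniform`
(stmt-AtomisticToContinuum-14662) VERBATIM with the hypothesis `∀ x j, ∫ F(x,v) v_j M_{1,u₀(x),θ₀(x)}(v) dv = 0`
DELETED; kept only as the statement that `not_kineticCurrentsWindowLDUniformWithoutOrthMom` negates (load-bearing
analysis: orthogonality to the momentum invariants is necessary). [folklore] -/
def KineticCurrentsWindowLDUniformWithoutOrthMom : Prop :=
  ∃ η₀ : ℝ, 0 < η₀ ∧ ∀ (a θ₀ : Literature.MathematicalPhysics.KineticTheory.T3 → ℝ) (u₀ : Literature.MathematicalPhysics.KineticTheory.T3 → Literature.MathematicalPhysics.KineticTheory.V3), Continuous a → Continuous θ₀ → Continuous u₀ → (∀ x, 0 < a x) → (∀ x, 0 < θ₀ x) → ∀ σ : ℝ, 0 < σ → σ ^ 3 * (⨆ x, a x) ≤ η₀ * ∫ x, a x → ∀ Φ : (N : ℕ) → Literature.Analysis.FluidPDE.HardSphereFlow (Literature.Analysis.FluidPDE.Torus.geometry (Fin 3)) (Literature.MathematicalPhysics.KineticTheory.hsDiameter σ N) (N + 1),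 ∀ (A : Literature.MathematicalPhysics.KineticTheory.T3 → Fin 3 → Fin 3 → ℝ) (b : Literature.MathematicalPhysics.KineticTheory.T3 → Literature.MathematicalPhysics.KineticTheory.V3) (G : Literature.MathematicalPhysics.KineticTheory.T3 × ℝ → ℝ), Continuous A → Continuous b → Continuous G → (∃ C : ℝ, ∀ y : Literature.MathematicalPhysics.KineticTheory.T3 × Literature.MathematicalPhysics.KineticTheory.V3, |(fun y : Literature.MathematicalPhysics.KineticTheory.T3 × Literature.MathematicalPhysics.KineticTheory.V3 => ((∑ j : Fin 3, ∑ k : Fin 3, A y.1 j k * ((y.2 - u₀ y.1) j * (y.2 - u₀ y.1) k)) + (∑ j : Fin 3, b y.1 j * (y.2 - u₀ y.1) j) * G (y.1, ‖y.2 - u₀ y.1‖ ^ 2))) y| ≤ C * (1 + ‖y.2‖ ^ 2)) → (∀ x, ∫ v, (fun y : Literature.MathematicalPhysics.KineticTheory.T3 × Literature.MathematicalPhysics.KineticTheory.V3 => ((∑ j : Fin 3, ∑ k : Fin 3, A y.1 j k * ((y.2 - u₀ y.1) j * (y.2 - u₀ y.1) k)) + (∑ j : Fin 3, b y.1 j *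 (y.2 - u₀ y.1) j) * G (y.1, ‖y.2 - u₀ y.1‖ ^ 2))) (x, v) * Literature.Analysis.FluidPDE.localMaxwellian 1 (θ₀ x) (u₀ x) v = 0) → (∀ x, ∫ v, (fun y : Literature.MathematicalPhysics.KineticTheory.T3 × Literature.MathematicalPhysics.KineticTheory.V3 => ((∑ j : Fin 3, ∑ k : Fin 3, A y.1 j k * ((y.2 - u₀ y.1) j * (y.2 - u₀ y.1) k)) + (∑ j : Fin 3, b y.1 j * (y.2 - u₀ y.1) j) * G (y.1, ‖y.2 - u₀ y.1‖ ^ 2))) (x, v) * ‖v‖ ^ 2 * Literature.Analysis.FluidPDE.localMaxwellian 1 (θ₀ x) (u₀ x) v = 0) → ∃ β₀ : ℝ, 0 < β₀ ∧ ∀ β : ℝ, |β| ≤ β₀ → ∀ ε : ℝ, 0 < ε → ∃ τ : ℝ, 0 < τ ∧ ∃ N₀ : ℕ, ∀ N : ℕ, N₀ ≤ N → ∫⁻ z, ENNReal.ofReal (Real.exp (β * ∑ i : Fin (N + 1), (τ * ((N : ℝ) + 1) ^ (-(1 / 3 : ℝ)))⁻¹ * ∫ r in (0 : ℝ)..(τ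 * ((N : ℝ) + 1) ^ (-(1 / 3 : ℝ))), (fun y : Literature.MathematicalPhysics.KineticTheory.T3 × Literature.MathematicalPhysics.KineticTheory.V3 => ((∑ j : Fin 3, ∑ k : Fin 3, A y.1 j k * ((y.2 - u₀ y.1) j * (y.2 - u₀ y.1) k)) + (∑ j : Fin 3, b y.1 j * (y.2 - u₀ y.1) j) * G (y.1, ‖y.2 - u₀ y.1‖ ^ 2))) (((Φ N).flow r z) i))) ∂(Literature.MathematicalPhysics.KineticTheory.localGibbsLaw σ a u₀ θ₀ N (Φ N)) ≤ ENNReal.ofReal (Real.exp (ε * ((N : ℝ) + 1)))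

/-- **ORTHOGONALITY TO `v_j` IS LOAD-BEARING**: without it the crux is false. Witness: `η₀` arbitrary, `a = θ₀ = 1`,
`u₀ = 0`, `σ = min(1/4, η₀, 1)`, Alexander flows, `A = 0`, `b = e₀`, `G = 1` (`F = v₀`): given the offered `β₀ > 0`
take `β = β₀`, `ε = β₀²/4`; whatever `τ, N₀`, at `N = N₀` the functional is `≥ e^{(N₀+1)β₀²/2} > e^{(N₀+1)β₀²/4}`
(`exp_le_lintegral_exp_momentum_window`). [folklore] -/
theorem not_kineticCurrentsWindowLDUniformWithoutOrthMom : ¬ KineticCurrentsWindowLDUniformWithoutOrthMom := by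
  rintro ⟨η₀, hη₀, h⟩
  obtain ⟨hσpos, hσ4, -, -⟩ := sigmaOf_spec hη₀
  have hσhalf : sigmaOf η₀ ≤ 1 / 2 := hσ4.trans (by norm_num)
  have hσhalf' : sigmaOf η₀ < 2⁻¹ := hσ4.trans_lt (by norm_num)
  have hmain := h (fun _ => 1) (fun _ => 1) (fun _ => 0) continuous_const continuous_const
    continuous_const (fun _ => one_pos) (fun _ => one_pos) (sigmaOf η₀) hσpos (guard_sigmaOf hη₀)
    (alexFlow hσpos hσhalf') A0 bE0 G1 continuous_const continuous_const continuous_const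
  have hmain' : (∃ C : ℝ, ∀ y : T3 × V3, |y.2 0| ≤ C * (1 + ‖y.2‖ ^ 2)) →
      (∀ x : T3, ∫ v, v 0 * localMaxwellian 1 1 (0 : V3) v = 0) →
      (∀ x : T3, ∫ v, v 0 * ‖v‖ ^ 2 * localMaxwellian 1 1 (0 : V3) v = 0) →
      ∃ β₀ : ℝ, 0 < β₀ ∧ ∀ β : ℝ, |β| ≤ β₀ → ∀ ε : ℝ, 0 < ε → ∃ τ : ℝ, 0 < τ ∧ ∃ N₀ : ℕ, ∀ N : ℕ, N₀ ≤ N →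
        ∫⁻ z, ENNReal.ofReal (Real.exp (β * ∑ i : Fin (N + 1), (τ * ((N : ℝ) + 1) ^ (-(1 / 3 : ℝ)))⁻¹ *
          ∫ r in (0 : ℝ)..(τ * ((N : ℝ) + 1) ^ (-(1 / 3 : ℝ))),
            (((alexFlow hσpos hσhalf' N).flow r z) i).2 0))
          ∂(localGibbsLaw (sigmaOf η₀) (fun _ => 1) (fun _ => 0) (fun _ => 1) N (alexFlow hσpos hσhalf' N)) ≤
        ENNReal.ofReal (Real.exp (ε * ((N : ℝ) + 1))) := by
    simpa only [F_mom] using hmain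
  clear hmain h
  obtain ⟨β₀, hβ₀, hβ⟩ := hmain' ⟨1, fun y => abs_coord_le y.2⟩ (fun _ => coord_orth_one)
    (fun _ => coord_orth_energy)
  obtain ⟨τ, hτ, N₀, hN⟩ := hβ β₀ (by rw [abs_of_pos hβ₀]) (β₀ ^ 2 / 4) (by positivity)
  have h0 := hN N₀ le_rfl
  have hw : 0 < τ * ((N₀ : ℝ) + 1) ^ (-(1 / 3 : ℝ)) := mul_pos hτ (Real.rpow_pos_of_pos (by positivity) _)
  have hlow := exp_le_lintegral_exp_momentum_window hσhalf (alexFlow hσpos hσhalf' N₀) hw β₀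
  have hle : ENNReal.ofReal (Real.exp (((N₀ : ℝ) + 1) * (β₀ ^ 2 / 2))) ≤
      ENNReal.ofReal (Real.exp (β₀ ^ 2 / 4 * ((N₀ : ℝ) + 1))) := hlow.trans h0
  rw [ENNReal.ofReal_le_ofReal_iff (Real.exp_pos _).le, Real.exp_le_exp] at hle
  have hN1 : (0 : ℝ) < (N₀ : ℝ) + 1 := by positivity
  nlinarith [hle, hβ₀, mul_pos hN1 (pow_pos hβ₀ 2)]

end Summit.AtomisticToContinuum.HydrodynamicLimit.Cruxes.KineticCurrentsWindowLDUniform.Disproof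

end


/-!
# `KineticCurrentsWindowLDUniform`: the growth clause is load-bearing — the true heat flux (refuted variant)

Negative knowledge for the crux `OneFlightGossipEngine.KineticCurrentsWindowLDUniform`
(stmt-AtomisticToContinuum-14662), from the standing disprover's `Cruxes/KineticCurrentsWindowLDUniform/Disproof.lean`
§ 5, using the drift-tilt lower bound of `Negative/TiltWindow.lean` (any polynomial growth) and the frame of
`Negative/LoadBearing.lean`.

* `KineticCurrentsWindowLDUniformWithoutGrowth` — the crux VERBATIM with the growth clause `|F| ≤ C(1+‖v‖²)`
  DELETED — is FALSE: the TRUE kinetic heat flux `F = v₀(‖v‖² − 5)` (`A = 0`, `b = e₀`, `G(x,s) = s − 5`;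
  continuous, `⊥ 1, ‖v‖²` by oddness, `⊥ v_j` by `E[v₀²‖v‖²] = 5 = 5E[v₀²]`) has window functional `+∞` at EVERY
  `β > 0`, `N`, flow and window (`lintegral_exp_heat_window_eq_top`: drifts `s e₀`, gain `βs³`, cost `s²/2`): time
  averaging does not cure the cubic exponential moment (`HighMomentumCutoff` barrier, static form
  `Literature.Barriers.AtomisticToContinuum.lintegral_exp_cubic_eq_top`) — the truncation `G = O(√s)` forced by the
  growth clause is load-bearing, and the untruncated energy current must indeed be cut elsewhere (EnergyCurrentTails).
refuter-cdisprove-stmt-AtomisticToContinuum-14662-0.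
-/

noncomputable section

namespace Summit.AtomisticToContinuum.HydrodynamicLimit.Cruxes.KineticCurrentsWindowLDUniform.Disproof
open Summit.AtomisticToContinuum.HydrodynamicLimit.Theorems

open MeasureTheory ProbabilityTheory Real
open scoped ENNReal InnerProductSpace
open Literature.Analysis.FluidPDE Literature.MathematicalPhysics.KineticTheory

namespace KineticCurrentsWindowLDUniformLoadBearing

open KineticCurrentsWindowLDUniformOneSphere
open KineticCurrentsWindowTilt
open BoltzmannGreenKuboForallN (reflB reflB_apply integral_stdGaussian_eq_zero_of_odd norm_sq_eq_three)

/-! ### The witness `F = v₀(‖v‖² − 5)` (the true heat flux: no growth bound) -/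

open BoltzmannGreenKuboOrthMomentum (integral_coord_pow_four integral_coord_mul_coord_of_ne)
open KineticCurrentsWindowLDUniformSketch.ClassTruncation (integrable_of_le_cube integrable_coord_mul_weight)

/-- `G(x, s) = s − 5`. -/
def Gheat : T3 × ℝ → ℝ := fun p => p.2 - 5

/-- The kinetic heat flux `g(v) = v₀ (‖v‖² − 5)`. -/
def gHeat (v : V3) : ℝ := v 0 * (‖v‖ ^ 2 - 5)

/-- The heat flux is continuous. [folklore] -/
theorem continuous_gHeat : Continuous gHeat :=
  ((EuclideanSpace.proj (𝕜 := ℝ) (0 : Fin 3)).continuous).mul ((continuous_norm.pow 2).sub continuous_const)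

/-- The crux functional at `A = 0`, `b = e₀`, `G = s − 5`, `u₀ = 0` is the heat flux (beta-normal form). [folklore] -/
theorem F_heat (x : T3) (v : V3) :
    ((∑ j : Fin 3, ∑ k : Fin 3, A0 x j k * ((v - 0) j * (v - 0) k)) +
      (∑ j : Fin 3, bE0 x j * (v - 0) j) * Gheat (x, ‖v - 0‖ ^ 2)) = gHeat v := by
  simp [A0, bE0, Gheat, gHeat]

/-- Cubic growth: `|β v₀(‖v‖² − 5)| ≤ 5|β| (1 + ‖v‖²)²`. [folklore] -/
theorem abs_gHeat_le (β : ℝ) (v : V3) : |β * gHeat v| ≤ 5 * |β| * (1 + ‖v‖ ^ 2) ^ 2 := by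
  rw [abs_mul, show 5 * |β| * (1 + ‖v‖ ^ 2) ^ 2 = |β| * (5 * (1 + ‖v‖ ^ 2) ^ 2) by ring]
  refine mul_le_mul_of_nonneg_left ?_ (abs_nonneg β)
  have h0 : |v 0| ≤ ‖v‖ := by
    have := PiLp.norm_apply_le v 0
    rwa [Real.norm_eq_abs] at this
  rw [gHeat, abs_mul]
  have h1 : |‖v‖ ^ 2 - 5| ≤ ‖v‖ ^ 2 + 5 := by
    rw [abs_le]; constructor <;> nlinarith [sq_nonneg ‖v‖]
  calc |v 0| * |‖v‖ ^ 2 - 5| ≤ ‖v‖ * (‖v‖ ^ 2 + 5) := mul_le_mul h0 h1 (abs_nonneg _) (norm_nonneg _)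
    _ ≤ 5 * (1 + ‖v‖ ^ 2) ^ 2 := by nlinarith [norm_nonneg v, sq_nonneg (‖v‖ - 1), sq_nonneg ‖v‖]

/-- The mixed fourth moment `E[v₀² ‖v‖²] = 5` (`E v₀⁴ = 3`, `E v₀²v₁² = E v₀²v₂² = 1`). [folklore] -/
theorem integral_coord_sq_mul_norm_sq : ∫ w, w 0 * w 0 * ‖w‖ ^ 2 ∂stdGaussian V3 = 5 := by
  have hsplit : ∀ w : V3, w 0 * w 0 * ‖w‖ ^ 2 = (w 0) ^ 4 + ((w 0) ^ 2 * (w 1) ^ 2 + (w 0) ^ 2 * (w 2) ^ 2) := by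
    intro w; rw [norm_sq_eq_three]; ring
  have hb : ∀ (w : V3) (j : Fin 3), (w j) ^ 2 ≤ ‖w‖ ^ 2 := fun w j => by
    rw [norm_sq_eq_three]; fin_cases j <;> simp <;> nlinarith [sq_nonneg (w 0), sq_nonneg (w 1), sq_nonneg (w 2)]
  have hi4 : Integrable (fun w : V3 => (w 0) ^ 4) (stdGaussian V3) :=
    integrable_of_le_cube (by fun_prop) 1 fun w => by
      rw [abs_of_nonneg (by positivity)]
      nlinarith [hb w 0, sq_nonneg (w 0), sq_nonneg ‖w‖, sq_nonneg (‖w‖ ^ 2)]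
  have hi01 : Integrable (fun w : V3 => (w 0) ^ 2 * (w 1) ^ 2) (stdGaussian V3) :=
    integrable_of_le_cube (by fun_prop) 1 fun w => by
      rw [abs_of_nonneg (by positivity)]
      nlinarith [hb w 0, hb w 1, sq_nonneg (w 0), sq_nonneg (w 1), sq_nonneg ‖w‖, sq_nonneg (‖w‖ ^ 2),
        mul_nonneg (sq_nonneg (w 0)) (sq_nonneg (w 1))]
  have hi02 : Integrable (fun w : V3 => (w 0) ^ 2 * (w 2) ^ 2) (stdGaussian V3) :=
    integrable_of_le_cube (by fun_prop) 1 fun w => by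
      rw [abs_of_nonneg (by positivity)]
      nlinarith [hb w 0, hb w 2, sq_nonneg (w 0), sq_nonneg (w 2), sq_nonneg ‖w‖, sq_nonneg (‖w‖ ^ 2),
        mul_nonneg (sq_nonneg (w 0)) (sq_nonneg (w 2))]
  have hi012 : Integrable (fun w : V3 => (w 0) ^ 2 * (w 1) ^ 2 + (w 0) ^ 2 * (w 2) ^ 2) (stdGaussian V3) :=
    hi01.add hi02
  simp_rw [hsplit]
  rw [integral_add hi4 hi012, integral_add hi01 hi02, integral_coord_pow_four,
    integral_coord_mul_coord_of_ne (f := fun x => x ^ 2) (g := fun x => x ^ 2) (by decide : (0 : Fin 3) ≠ 1)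
      (measurable_id.pow_const 2) (measurable_id.pow_const 2),
    integral_coord_mul_coord_of_ne (f := fun x => x ^ 2) (g := fun x => x ^ 2) (by decide : (0 : Fin 3) ≠ 2)
      (measurable_id.pow_const 2) (measurable_id.pow_const 2),
    integral_coord_sq_stdGaussian, integral_coord_sq_stdGaussian, integral_coord_sq_stdGaussian]
  norm_num

/-- `v₀(‖v‖²−5) ⊥ 1` under the Maxwellian (odd under `v₀ ↦ −v₀`). [folklore] -/
theorem gHeat_orth_one : ∫ v, gHeat v * localMaxwellian 1 1 (0 : V3) v = 0 := by
  rw [integral_mul_localMaxwellian_eq]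
  exact integral_stdGaussian_eq_zero_of_odd (reflB 0) (G := gHeat) fun w => by
    simp [gHeat, reflB_apply]

/-- `v₀(‖v‖²−5) ⊥ v_j` under the Maxwellian (`j = 0`: `E[v₀²‖v‖²] − 5E[v₀²] = 0`; `j ≠ 0`: odd in `v_j`). [folklore] -/
theorem gHeat_orth_mom (j : Fin 3) : ∫ v, gHeat v * v j * localMaxwellian 1 1 (0 : V3) v = 0 := by
  rw [integral_mul_localMaxwellian_eq]
  by_cases hj : j = 0
  · subst hj
    have hsplit : ∀ w : V3, gHeat w * w 0 = w 0 * w 0 * ‖w‖ ^ 2 - 5 * (w 0) ^ 2 := by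
      intro w; rw [gHeat]; ring
    simp_rw [hsplit]
    have hA : Integrable (fun w : V3 => w 0 * w 0 * ‖w‖ ^ 2) (stdGaussian V3) :=
      integrable_coord_mul_weight 0 0 (ω := fun s : ℝ => s) continuous_id' (P := 1)
        (fun s hs => by show |s| ≤ 1 * (1 + s); rw [abs_of_nonneg hs]; linarith)
    have hB : Integrable (fun w : V3 => 5 * (w 0) ^ 2) (stdGaussian V3) :=
      (memLp_coord_stdGaussian (ι := Fin 3) 0 2 (by simp)).integrable_sq.const_mul 5
    rw [integral_sub hA hB, integral_const_mul, integral_coord_sq_mul_norm_sq, integral_coord_sq_stdGaussian]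
    norm_num
  · exact integral_stdGaussian_eq_zero_of_odd (reflB j) (G := fun w : V3 => gHeat w * w j) fun w => by
      simp [gHeat, reflB_apply, if_neg (Ne.symm hj)]

/-- `v₀(‖v‖²−5) ⊥ ‖v‖²` under the Maxwellian (odd under `v₀ ↦ −v₀`). [folklore] -/
theorem gHeat_orth_energy : ∫ v, gHeat v * ‖v‖ ^ 2 * localMaxwellian 1 1 (0 : V3) v = 0 := by
  rw [integral_mul_localMaxwellian_eq]
  exact integral_stdGaussian_eq_zero_of_odd (reflB 0) (G := fun w : V3 => gHeat w * ‖w‖ ^ 2) fun w => by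
    simp [gHeat, reflB_apply]

/-- The heat flux at the drifted point, in coordinates. [folklore] -/
theorem gHeat_shift (s : ℝ) (w : V3) :
    gHeat (EuclideanSpace.single 0 s + w) = (s + w 0) * ((s + w 0) ^ 2 + (w 1) ^ 2 + (w 2) ^ 2 - 5) := by
  rw [gHeat, norm_sq_eq_three]
  simp [PiLp.add_apply]

/-- **Mean heat flux under the drifted Maxwellian**: `E_{N(se₀,I)}[β v₀(‖v‖²−5)] = β s³`. [folklore] -/
theorem integral_gHeat_gaussMeasure (β s : ℝ) :
    ∫ v, β * gHeat v ∂gaussMeasure (EuclideanSpace.single 0 s) 1 = β * s ^ 3 := by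
  rw [integral_const_mul]
  congr 1
  -- integrability of the shifted cubic observable under `γ`
  have hint : Integrable (fun w : V3 => gHeat (EuclideanSpace.single 0 s + Real.sqrt 1 • w)) (stdGaussian V3) := by
    have hg : Integrable gHeat (gaussMeasure (EuclideanSpace.single (0 : Fin 3) s) 1) := by
      refine integrable_gaussMeasure_of_growth continuous_gHeat (C := 5 * |(1 : ℝ)|) (m := 2) (fun v => ?_) _ one_pos
      simpa using abs_gHeat_le 1 v
    rw [gaussMeasure, ← coe_gaussShiftEquiv _ one_pos] at hg
    exact (integrable_map_equiv (gaussShiftEquiv (EuclideanSpace.single (0 : Fin 3) s) one_pos) gHeat).1 hg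
  rw [integral_gaussMeasure _ one_pos]
  simp only [Real.sqrt_one, one_smul] at hint ⊢
  simp_rw [gHeat_shift]
  -- even part
  set he : V3 → ℝ := fun w => s * (s ^ 2 - 5) + s * ‖w‖ ^ 2 + 2 * s * (w 0) ^ 2 with hhe
  have hI1 : Integrable (fun w : V3 => s * (s ^ 2 - 5) + s * ‖w‖ ^ 2) (stdGaussian V3) :=
    (integrable_const _).add (integrable_norm_sq_stdGaussian.const_mul s)
  have hI2 : Integrable (fun w : V3 => 2 * s * (w 0) ^ 2) (stdGaussian V3) :=
    (memLp_coord_stdGaussian (ι := Fin 3) 0 2 (by simp)).integrable_sq.const_mul (2 * s)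
  have hie : Integrable he (stdGaussian V3) := hI1.add hI2
  have hie_val : ∫ w, he w ∂stdGaussian V3 = s ^ 3 := by
    simp only [hhe]
    rw [integral_add hI1 hI2, integral_add (integrable_const _) (integrable_norm_sq_stdGaussian.const_mul s),
      integral_const, integral_const_mul, integral_const_mul, integral_norm_sq_stdGaussian,
      integral_coord_sq_stdGaussian]
    simp only [Measure.real, measure_univ, ENNReal.toReal_one, one_smul, Fintype.card_fin]
    push_cast
    ring
  -- the odd part integrates to zero
  have hint' : Integrable (fun w : V3 => (s + w 0) * ((s + w 0) ^ 2 + (w 1) ^ 2 + (w 2) ^ 2 - 5)) (stdGaussian V3) := by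
    refine hint.congr (ae_of_all _ fun w => ?_)
    exact gHeat_shift s w
  have hodd : ∫ w : V3, ((s + w 0) * ((s + w 0) ^ 2 + (w 1) ^ 2 + (w 2) ^ 2 - 5) - he w) ∂stdGaussian V3 = 0 := by
    refine integral_stdGaussian_eq_zero_of_odd (reflB 0)
      (G := fun w : V3 => (s + w 0) * ((s + w 0) ^ 2 + (w 1) ^ 2 + (w 2) ^ 2 - 5) - he w) fun w => ?_
    simp only [hhe, reflB_apply, LinearIsometryEquiv.norm_map, if_true,
      show (1 : Fin 3) ≠ 0 by decide, show (2 : Fin 3) ≠ 0 by decide, if_false]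
    rw [norm_sq_eq_three]
    ring
  have hdecomp : (fun w : V3 => (s + w 0) * ((s + w 0) ^ 2 + (w 1) ^ 2 + (w 2) ^ 2 - 5)) =
      fun w => ((s + w 0) * ((s + w 0) ^ 2 + (w 1) ^ 2 + (w 2) ^ 2 - 5) - he w) + he w := by
    funext w; ring
  have hD : Integrable (fun w : V3 => (s + w 0) * ((s + w 0) ^ 2 + (w 1) ^ 2 + (w 2) ^ 2 - 5) - he w)
      (stdGaussian V3) := hint'.sub hie
  rw [hdecomp, integral_add hD hie, hodd, zero_add, hie_val]

/-- **The window functional of the TRUE heat flux is INFINITE at every `β > 0`**, for every `0 < σ ≤ 1/2`, `N`,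
flow and window: `∫ exp(β ∑ᵢ w⁻¹∫₀ʷ v_{i,0}(‖vᵢ‖²−5) dr) dG_N = ∞` (drifts `se₀`: gain `βs³` against entropy `s²/2`
per particle, `s → ∞`). Time averaging does not cure the cubic exponential moment. [folklore] -/
theorem lintegral_exp_heat_window_eq_top {σ : ℝ} (hσ2 : σ ≤ 1 / 2) {N : ℕ}
    (Φ : HardSphereFlow (Torus.geometry (Fin 3)) (hsDiameter σ N) (N + 1))
    {w : ℝ} (hw : 0 < w) {β : ℝ} (hβ : 0 < β) :
    ∫⁻ z, ENNReal.ofReal (Real.exp (β * (∑ i, w⁻¹ * ∫ r in (0 : ℝ)..w, gHeat ((Φ.flow r z) i).2))) ∂(localGibbsLaw σ (fun _ => 1) (fun _ => 0) (fun _ => 1) N Φ) = ⊤ := by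
  refine ENNReal.eq_top_of_forall_nnreal_le fun r => ?_
  set s : ℝ := β⁻¹ + Real.sqrt (2 * (r : ℝ) / ((N : ℝ) + 1)) with hs
  have hN1 : (0 : ℝ) < (N : ℝ) + 1 := by positivity
  have hsqrt : 0 ≤ Real.sqrt (2 * (r : ℝ) / ((N : ℝ) + 1)) := Real.sqrt_nonneg _
  have hs1 : 1 ≤ β * s := by
    rw [hs, mul_add, mul_inv_cancel₀ hβ.ne']
    nlinarith [mul_nonneg hβ.le hsqrt]
  have hs0 : 0 ≤ s := by rw [hs]; positivity
  have hs2 : 2 * (r : ℝ) / ((N : ℝ) + 1) ≤ s ^ 2 := by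
    have h1 : Real.sqrt (2 * (r : ℝ) / ((N : ℝ) + 1)) ≤ s := by
      rw [hs]; linarith [inv_nonneg.2 hβ.le]
    have h2 := Real.sq_sqrt (show (0 : ℝ) ≤ 2 * (r : ℝ) / ((N : ℝ) + 1) by positivity)
    nlinarith [h1, hsqrt]
  have hkey := tilt_window_lower_bound hσ2 Φ (EuclideanSpace.single 0 s) hw
    (g := fun v => β * gHeat v) (continuous_const.mul continuous_gHeat) (m := 2) (abs_gHeat_le β)
  have hn : ‖(EuclideanSpace.single (0 : Fin 3) s : V3)‖ = |s| := by
    rw [EuclideanSpace.single, PiLp.norm_single, Real.norm_eq_abs]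
  rw [integral_gHeat_gaussMeasure, hn, sq_abs] at hkey
  simp_rw [window_sum_const_mul Φ w β gHeat] at hkey
  refine le_trans ?_ hkey
  rw [← ENNReal.ofReal_coe_nnreal]
  refine ENNReal.ofReal_le_ofReal ?_
  have hexp : (r : ℝ) ≤ ((N : ℝ) + 1) * (β * s ^ 3 - s ^ 2 / 2) := by
    have h3 : ((N : ℝ) + 1) * (β * s ^ 3 - s ^ 2 / 2) = ((N : ℝ) + 1) * s ^ 2 * (β * s - 1 / 2) := by ring
    rw [h3]
    have h4 : (r : ℝ) = ((N : ℝ) + 1) * (2 * (r : ℝ) / ((N : ℝ) + 1)) * (1 / 2) := by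
      field_simp
    rw [h4]
    exact mul_le_mul (mul_le_mul_of_nonneg_left hs2 hN1.le) (by linarith) (by norm_num)
      (mul_nonneg hN1.le (sq_nonneg _))
  linarith [Real.add_one_le_exp (((N : ℝ) + 1) * (β * s ^ 3 - s ^ 2 / 2))]


end KineticCurrentsWindowLDUniformLoadBearing

open KineticCurrentsWindowLDUniformOneSphere KineticCurrentsWindowTilt KineticCurrentsWindowLDUniformLoadBearing

/-! ### The variant without the growth clause -/

/-- **A FALSE proposition — NOT a citable fact.** The crux `OneFlightGossipEngine.KineticCurrentsWindowLDUniform`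
(stmt-AtomisticToContinuum-14662) VERBATIM with the growth clause `∃ C, ∀ y, |F y| ≤ C (1 + ‖y.2‖²)` DELETED; kept
only as the statement that `not_kineticCurrentsWindowLDUniformWithoutGrowth` negates (load-bearing analysis: the
truncation of the heat flux is necessary). [folklore] -/
def KineticCurrentsWindowLDUniformWithoutGrowth : Prop :=
  ∃ η₀ : ℝ, 0 < η₀ ∧ ∀ (a θ₀ : Literature.MathematicalPhysics.KineticTheory.T3 → ℝ) (u₀ : Literature.MathematicalPhysics.KineticTheory.T3 → Literature.MathematicalPhysics.KineticTheory.V3), Continuous a → Continuous θ₀ → Continuous u₀ → (∀ x, 0 < a x) → (∀ x, 0 < θ₀ x) → ∀ σ : ℝ, 0 < σ → σ ^ 3 * (⨆ x, a x) ≤ η₀ * ∫ x, a x → ∀ Φ : (N : ℕ) → Literature.Analysis.FluidPDE.HardSphereFlow (Literature.Analysis.FluidPDE.Torus.geometry (Fin 3)) (Literature.MathematicalPhysics.KineticTheory.hsDiameter σ N) (N + 1), ∀ (A : Literature.MathematicalPhysics.KineticTheory.T3 → Fin 3 → Fin 3 → ℝ) (b : Literature.MathematicalPhysics.KineticTheory.T3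 → Literature.MathematicalPhysics.KineticTheory.V3) (G : Literature.MathematicalPhysics.KineticTheory.T3 × ℝ → ℝ), Continuous A → Continuous b → Continuous G → (∀ x, ∫ v, (fun y : Literature.MathematicalPhysics.KineticTheory.T3 × Literature.MathematicalPhysics.KineticTheory.V3 => ((∑ j : Fin 3, ∑ k : Fin 3, A y.1 j k * ((y.2 - u₀ y.1) j * (y.2 - u₀ y.1) k)) + (∑ j : Fin 3, b y.1 j * (y.2 - u₀ y.1) j) * G (y.1, ‖y.2 - u₀ y.1‖ ^ 2))) (x, v) * Literature.Analysis.FluidPDE.localMaxwellian 1 (θ₀ x) (u₀ x) v = 0) → (∀ x (j : Fin 3), ∫ v, (fun y : Literature.MathematicalPhysics.KineticTheory.T3 × Literature.MathematicalPhysics.KineticTheory.V3 => ((∑ j : Fin 3, ∑ k : Fin 3, A y.1 j k * ((y.2 - u₀ y.1) j * (y.2 - u₀ y.1) k)) + (∑ j : Fin 3, b y.1 j * (y.2 - u₀ y.1) j) * G (y.1, ‖y.2 - u₀ y.1‖ ^ 2))) (x, v) * v j * Literature.Analysis.FluidPDE.localMaxwellian 1 (θ₀ x) (u₀ x) v = 0)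 → (∀ x, ∫ v, (fun y : Literature.MathematicalPhysics.KineticTheory.T3 × Literature.MathematicalPhysics.KineticTheory.V3 => ((∑ j : Fin 3, ∑ k : Fin 3, A y.1 j k * ((y.2 - u₀ y.1) j * (y.2 - u₀ y.1) k)) + (∑ j : Fin 3, b y.1 j * (y.2 - u₀ y.1) j) * G (y.1, ‖y.2 - u₀ y.1‖ ^ 2))) (x, v) * ‖v‖ ^ 2 * Literature.Analysis.FluidPDE.localMaxwellian 1 (θ₀ x) (u₀ x) v = 0) → ∃ β₀ : ℝ, 0 < β₀ ∧ ∀ β : ℝ, |β| ≤ β₀ → ∀ ε : ℝ, 0 < ε → ∃ τ : ℝ, 0 < τ ∧ ∃ N₀ : ℕ, ∀ N : ℕ, N₀ ≤ N → ∫⁻ z, ENNReal.ofReal (Real.exp (β * ∑ i : Fin (N + 1), (τ * ((N : ℝ) + 1) ^ (-(1 / 3 : ℝ)))⁻¹ * ∫ r in (0 : ℝ)..(τ * ((N : ℝ) + 1) ^ (-(1 / 3 : ℝ))), (fun y : Literature.MathematicalPhysics.KineticTheory.T3 × Literature.MathematicalPhysics.KineticTheory.V3 => ((∑ j : Fin 3,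 ∑ k : Fin 3, A y.1 j k * ((y.2 - u₀ y.1) j * (y.2 - u₀ y.1) k)) + (∑ j : Fin 3, b y.1 j * (y.2 - u₀ y.1) j) * G (y.1, ‖y.2 - u₀ y.1‖ ^ 2))) (((Φ N).flow r z) i))) ∂(Literature.MathematicalPhysics.KineticTheory.localGibbsLaw σ a u₀ θ₀ N (Φ N)) ≤ ENNReal.ofReal (Real.exp (ε * ((N : ℝ) + 1)))

/-- **THE GROWTH CLAUSE IS LOAD-BEARING**: without it the crux is false — the TRUE heat flux `F = v₀(‖v‖² − 5)`
(`A = 0`, `b = e₀`, `G(x,s) = s − 5`) is continuous and `⊥ 1, v_j, ‖v‖²`, and its window functional is `+∞` at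
`β = β₀ > 0`, whatever `τ, N₀` (`lintegral_exp_heat_window_eq_top`), not `≤ e^{N₀+1}`. [folklore] -/
theorem not_kineticCurrentsWindowLDUniformWithoutGrowth : ¬ KineticCurrentsWindowLDUniformWithoutGrowth := by
  rintro ⟨η₀, hη₀, h⟩
  obtain ⟨hσpos, hσ4, -, -⟩ := sigmaOf_spec hη₀
  have hσhalf : sigmaOf η₀ ≤ 1 / 2 := hσ4.trans (by norm_num)
  have hσhalf' : sigmaOf η₀ < 2⁻¹ := hσ4.trans_lt (by norm_num)
  have hmain := h (fun _ => 1) (fun _ => 1) (fun _ => 0) continuous_const continuous_const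
    continuous_const (fun _ => one_pos) (fun _ => one_pos) (sigmaOf η₀) hσpos (guard_sigmaOf hη₀)
    (alexFlow hσpos hσhalf') A0 bE0 Gheat continuous_const continuous_const (by unfold Gheat; fun_prop)
  have hmain' : (∀ x : T3, ∫ v, gHeat v * localMaxwellian 1 1 (0 : V3) v = 0) →
      (∀ (x : T3) (j : Fin 3), ∫ v, gHeat v * v j * localMaxwellian 1 1 (0 : V3) v = 0) →
      (∀ x : T3, ∫ v, gHeat v * ‖v‖ ^ 2 * localMaxwellian 1 1 (0 : V3) v = 0) →
      ∃ β₀ : ℝ, 0 < β₀ ∧ ∀ β : ℝ, |β| ≤ β₀ → ∀ ε : ℝ, 0 < ε → ∃ τ : ℝ, 0 < τ ∧ ∃ N₀ : ℕ, ∀ N : ℕ, N₀ ≤ N →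
        ∫⁻ z, ENNReal.ofReal (Real.exp (β * ∑ i : Fin (N + 1), (τ * ((N : ℝ) + 1) ^ (-(1 / 3 : ℝ)))⁻¹ *
          ∫ r in (0 : ℝ)..(τ * ((N : ℝ) + 1) ^ (-(1 / 3 : ℝ))),
            gHeat (((alexFlow hσpos hσhalf' N).flow r z) i).2))
          ∂(localGibbsLaw (sigmaOf η₀) (fun _ => 1) (fun _ => 0) (fun _ => 1) N (alexFlow hσpos hσhalf' N)) ≤
        ENNReal.ofReal (Real.exp (ε * ((N : ℝ) + 1))) := by
    simpa only [F_heat] using hmain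
  clear hmain h
  obtain ⟨β₀, hβ₀, hβ⟩ := hmain' (fun _ => gHeat_orth_one) (fun _ j => gHeat_orth_mom j)
    (fun _ => gHeat_orth_energy)
  obtain ⟨τ, hτ, N₀, hN⟩ := hβ β₀ (by rw [abs_of_pos hβ₀]) 1 one_pos
  have h0 := hN N₀ le_rfl
  have hw : 0 < τ * ((N₀ : ℝ) + 1) ^ (-(1 / 3 : ℝ)) := mul_pos hτ (Real.rpow_pos_of_pos (by positivity) _)
  have htop := lintegral_exp_heat_window_eq_top hσhalf (alexFlow hσpos hσhalf' N₀) hw hβ₀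
  have hle : (⊤ : ℝ≥0∞) ≤ ENNReal.ofReal (Real.exp (1 * ((N₀ : ℝ) + 1))) := le_of_eq_of_le htop.symm h0
  exact absurd hle (not_le.2 ENNReal.ofReal_lt_top)

end Summit.AtomisticToContinuum.HydrodynamicLimit.Cruxes.KineticCurrentsWindowLDUniform.Disproof

end


/-!
# `KineticCurrentsWindowLDUniform`: `F ⊥ 1` is load-bearing (refuted variant; the witness needs `|u₀|² = 5θ₀`)

Negative knowledge for the crux `OneFlightGossipEngine.KineticCurrentsWindowLDUniform`
(stmt-AtomisticToContinuum-14662), from the standing disprover's `Cruxes/KineticCurrentsWindowLDUniform/Disproof.lean`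
§ 6. `KineticCurrentsWindowLDUniformWithoutOrthOne` — the crux VERBATIM with the hypothesis `∀ x, ∫ F(x,v) M dv = 0`
DELETED — is FALSE. Within the class, `⊥ v_j` and `⊥ ‖v‖²` alone force `tr A = 0` wherever `|u₀(x)|² ≠ 5θ₀(x)`
(`Negative/OrthRedundant`: `∫FM = θ trA`, `∫Fv_jM = u_jθ trA + θ b_j m`, `∫F‖v‖²M = θ(5θ+|u|²)trA + 2θ(u·b)m`), so a
witness must sit on `|u₀|² = 5θ₀` with `b ∥ u₀`: `a = θ₀ = 1`, `u₀ ≡ √5 e₀`, `A = I`, `b ≡ −3√5 e₀`, `G ≡ 1`, i.e.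
`F(v) = ‖v − u₀‖² − 3√5 (v − u₀)₀` (continuous, `|F| ≤ 46(1+‖v‖²)`, `⊥ v_j` and `⊥ ‖v‖²` by the Gaussian moments
`E‖ξ‖² = 3`, `Eξ₀² = 1`, `E‖ξ‖⁴ = 15`, odd moments `0`). The reference law (constant drift `√5e₀`) is flow-INVARIANT, so
by Jensen and `integral_windowSum` the window functional is `≥ exp(β(N+1)E_{N(u₀,I)}F) = e^{3β(N+1)}` at every window and
`N`, beating `e^{ε(N+1)}` at `ε = β = β₀`. (Here `∑ᵢFᵢ = 2KE − 2√5P₀ + … ` is even a function of the conserved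
`(KE, P)`.) This completes the load-bearing table of the crux's hypotheses: `∃N₀`, `∃β₀`, `⊥1`, `⊥v_j`, growth clause
load-bearing; `⊥‖v‖²` redundant. refuter-cdisprove-stmt-AtomisticToContinuum-14662-0.
-/

noncomputable section

namespace Summit.AtomisticToContinuum.HydrodynamicLimit.Cruxes.KineticCurrentsWindowLDUniform.Disproof
open Summit.AtomisticToContinuum.HydrodynamicLimit.Theorems

open MeasureTheory ProbabilityTheory Real
open scoped ENNReal InnerProductSpace
open Literature.Analysis.FluidPDE Literature.MathematicalPhysics.KineticTheory

namespace KineticCurrentsWindowLDUniformLoadBearing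

open KineticCurrentsWindowLDUniformOneSphere
open KineticCurrentsWindowTilt
open BoltzmannGreenKuboForallN (reflB reflB_apply integral_stdGaussian_eq_zero_of_odd norm_sq_eq_three)
open KineticCurrentsWindowLDUniformSketch.ClassTruncation (integrable_of_le_cube integrable_coord_mul_weight
  integral_diag_eq integral_mul_localMaxwellian_shift)
open KineticFluxLdDecayTilt (ofReal_exp_integral_le_lintegral)

/-! ### The witness on `|u₀|² = 5θ₀`: `F(v) = ‖v − u₀‖² − 3√5 (v − u₀)₀` -/

/-- The drift `u₀ = √5 e₀` (so `|u₀|² = 5 = 5θ₀`). -/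
def uS : V3 := EuclideanSpace.single 0 (Real.sqrt 5)

/-- `A ≡ I` (trace `3 ≠ 0`). -/
def Aid : T3 → Fin 3 → Fin 3 → ℝ := fun _ j k => if j = k then 1 else 0

/-- `b ≡ −3√5 e₀`. -/
def bS : T3 → V3 := fun _ => EuclideanSpace.single 0 (-3 * Real.sqrt 5)

/-- The witness functional `F(v) = ‖v − u₀‖² − 3√5 (v − u₀)₀`, in coordinates. -/
def gS (v : V3) : ℝ :=
  (v - uS) 0 ^ 2 + (v - uS) 1 ^ 2 + (v - uS) 2 ^ 2 - 3 * Real.sqrt 5 * (v - uS) 0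

/-- The witness is continuous. [folklore] -/
theorem continuous_gS : Continuous gS := by
  unfold gS; fun_prop

/-- The crux functional at `A = I`, `b = −3√5e₀`, `G = 1`, `u₀ = √5e₀` is `gS` (beta-normal form). [folklore] -/
theorem F_S (x : T3) (v : V3) :
    ((∑ j : Fin 3, ∑ k : Fin 3, Aid x j k * ((v - uS) j * (v - uS) k)) +
      (∑ j : Fin 3, bS x j * (v - uS) j) * G1 (x, ‖v - uS‖ ^ 2)) = gS v := by
  simp [Aid, bS, G1, gS, Fin.sum_univ_three]
  ring

/-- Coordinates of the drift. [folklore] -/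
theorem uS_apply (j : Fin 3) : uS j = if j = 0 then Real.sqrt 5 else 0 := by
  simp [uS]

/-- `gS` in terms of the norm. [folklore] -/
theorem gS_eq (v : V3) : gS v = ‖v - uS‖ ^ 2 - 3 * Real.sqrt 5 * (v - uS) 0 := by
  rw [gS, norm_sq_eq_three]

/-- Quadratic growth: `|F v| ≤ 46 (1 + ‖v‖²)`. [folklore] -/
theorem abs_gS_le (v : V3) : |gS v| ≤ 46 * (1 + ‖v‖ ^ 2) ^ 1 := by
  rw [pow_one, gS_eq]
  have h5 : Real.sqrt 5 ≤ 3 := by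
    rw [show (3 : ℝ) = Real.sqrt 9 by rw [show (9 : ℝ) = 3 ^ 2 by norm_num, Real.sqrt_sq (by norm_num)]]
    exact Real.sqrt_le_sqrt (by norm_num)
  have h5' : 0 ≤ Real.sqrt 5 := Real.sqrt_nonneg 5
  have hn : ‖uS‖ = Real.sqrt 5 := by
    rw [uS, EuclideanSpace.single, PiLp.norm_single, Real.norm_eq_abs, abs_of_nonneg h5']
  have h1 : ‖v - uS‖ ≤ ‖v‖ + 3 := by
    have := norm_sub_le v uS; rw [hn] at this; linarith
  have h2 : |(v - uS) 0| ≤ ‖v - uS‖ := by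
    have := PiLp.norm_apply_le (v - uS) 0
    rwa [Real.norm_eq_abs] at this
  have h3 : ‖v - uS‖ ^ 2 ≤ (‖v‖ + 3) ^ 2 := pow_le_pow_left₀ (norm_nonneg _) h1 2
  rw [abs_le]
  constructor <;> nlinarith [norm_nonneg v, norm_nonneg (v - uS), abs_le.1 h2, sq_nonneg (‖v‖ - 1),
    mul_nonneg h5' (norm_nonneg (v - uS))]

/-- The witness in the reduced variable: `F(u₀ + ξ) = ξ₀² + ξ₁² + ξ₂² − 3√5 ξ₀`. [folklore] -/
theorem gS_shift (ξ : V3) : gS (uS + ξ) = ξ 0 ^ 2 + ξ 1 ^ 2 + ξ 2 ^ 2 - 3 * Real.sqrt 5 * ξ 0 := by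
  simp [gS]

/-- `√5 · √5 = 5`. [folklore] -/
theorem sqrt5_mul_self : Real.sqrt 5 * Real.sqrt 5 = 5 := Real.mul_self_sqrt (by norm_num)

/-! ### Gaussian moments used -/

/-- `E‖ξ‖⁴ = 15` in coordinates: `E[(ξ₀²+ξ₁²+ξ₂²)²] = 15` (`E ξ_j²‖ξ‖² = 5` for each `j`). [folklore] -/
theorem integral_norm_pow_four_coord :
    ∫ ξ : V3, (ξ 0 ^ 2 + ξ 1 ^ 2 + ξ 2 ^ 2) * (ξ 0 ^ 2 + ξ 1 ^ 2 + ξ 2 ^ 2) ∂stdGaussian V3 = 15 := by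
  have h : ∀ ξ : V3, (ξ 0 ^ 2 + ξ 1 ^ 2 + ξ 2 ^ 2) * (ξ 0 ^ 2 + ξ 1 ^ 2 + ξ 2 ^ 2) =
      ξ 0 * ξ 0 * ‖ξ‖ ^ 2 + (ξ 1 * ξ 1 * ‖ξ‖ ^ 2 + ξ 2 * ξ 2 * ‖ξ‖ ^ 2) := by
    intro ξ; rw [norm_sq_eq_three]; ring
  have hi : ∀ j : Fin 3, Integrable (fun ξ : V3 => ξ j * ξ j * ‖ξ‖ ^ 2) (stdGaussian V3) := fun j =>
    integrable_coord_mul_weight j j (ω := fun s : ℝ => s) continuous_id' (P := 1)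
      (fun s hs => by show |s| ≤ 1 * (1 + s); rw [abs_of_nonneg hs]; linarith)
  have hval : ∀ j : Fin 3, ∫ ξ : V3, ξ j * ξ j * ‖ξ‖ ^ 2 ∂stdGaussian V3 = 5 := fun j => by
    rw [integral_diag_eq j (fun s => s)]
    exact integral_coord_sq_mul_norm_sq
  have hi12 : Integrable (fun ξ : V3 => ξ 1 * ξ 1 * ‖ξ‖ ^ 2 + ξ 2 * ξ 2 * ‖ξ‖ ^ 2) (stdGaussian V3) :=
    (hi 1).add (hi 2)
  simp_rw [h]
  rw [integral_add (hi 0) hi12, integral_add (hi 1) (hi 2), hval, hval, hval]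
  norm_num

/-- Integrability of the cubic odd combination `q(ξ) ξ₀ c₁ + c₂ ξ₀`. [folklore] -/
theorem integrable_odd_part (c₁ c₂ : ℝ) :
    Integrable (fun ξ : V3 => c₁ * ((ξ 0 ^ 2 + ξ 1 ^ 2 + ξ 2 ^ 2) * ξ 0) + c₂ * ξ 0) (stdGaussian V3) := by
  have h1 : Integrable (fun ξ : V3 => (ξ 0 ^ 2 + ξ 1 ^ 2 + ξ 2 ^ 2) * ξ 0) (stdGaussian V3) := by
    refine integrable_of_le_cube (by fun_prop) 1 fun ξ => ?_
    have hq : ξ 0 ^ 2 + ξ 1 ^ 2 + ξ 2 ^ 2 = ‖ξ‖ ^ 2 := (norm_sq_eq_three ξ).symm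
    have h0 : |ξ 0| ≤ ‖ξ‖ := by
      have := PiLp.norm_apply_le ξ 0
      rwa [Real.norm_eq_abs] at this
    rw [hq, abs_mul, abs_of_nonneg (sq_nonneg _)]
    calc ‖ξ‖ ^ 2 * |ξ 0| ≤ ‖ξ‖ ^ 2 * ‖ξ‖ := mul_le_mul_of_nonneg_left h0 (sq_nonneg _)
      _ ≤ 1 * (1 + ‖ξ‖ ^ 2) ^ 3 := by
          nlinarith [norm_nonneg ξ, sq_nonneg ‖ξ‖, sq_nonneg (‖ξ‖ - 1), sq_nonneg (‖ξ‖ ^ 2),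
            mul_nonneg (norm_nonneg ξ) (sq_nonneg (‖ξ‖ - 1)), mul_nonneg (sq_nonneg ‖ξ‖) (sq_nonneg (‖ξ‖ - 1))]
  exact (h1.const_mul c₁).add (((memLp_coord_stdGaussian (ι := Fin 3) 0 1 (by simp)).integrable le_rfl).const_mul c₂)

/-- The cubic odd combination integrates to zero (odd under `ξ₀ ↦ −ξ₀`). [folklore] -/
theorem integral_odd_part (c₁ c₂ : ℝ) :
    ∫ ξ : V3, (c₁ * ((ξ 0 ^ 2 + ξ 1 ^ 2 + ξ 2 ^ 2) * ξ 0) + c₂ * ξ 0) ∂stdGaussian V3 = 0 :=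
  integral_stdGaussian_eq_zero_of_odd (reflB 0)
    (G := fun ξ : V3 => c₁ * ((ξ 0 ^ 2 + ξ 1 ^ 2 + ξ 2 ^ 2) * ξ 0) + c₂ * ξ 0) fun ξ => by
      simp only [reflB_apply, if_true, show (1 : Fin 3) ≠ 0 by decide, show (2 : Fin 3) ≠ 0 by decide, if_false]
      ring

/-- `ξ ↦ ξ₀² + ξ₁² + ξ₂²` is integrable, with integral `3`. [folklore] -/
theorem integral_q : Integrable (fun ξ : V3 => ξ 0 ^ 2 + ξ 1 ^ 2 + ξ 2 ^ 2) (stdGaussian V3) ∧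
    ∫ ξ : V3, (ξ 0 ^ 2 + ξ 1 ^ 2 + ξ 2 ^ 2) ∂stdGaussian V3 = 3 := by
  have hi : ∀ j : Fin 3, Integrable (fun ξ : V3 => ξ j ^ 2) (stdGaussian V3) := fun j =>
    (memLp_coord_stdGaussian (ι := Fin 3) j 2 (by simp)).integrable_sq
  have hi01 : Integrable (fun ξ : V3 => ξ 0 ^ 2 + ξ 1 ^ 2) (stdGaussian V3) := (hi 0).add (hi 1)
  refine ⟨hi01.add (hi 2), ?_⟩
  rw [integral_add hi01 (hi 2), integral_add (hi 0) (hi 1), integral_coord_sq_stdGaussian,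
    integral_coord_sq_stdGaussian, integral_coord_sq_stdGaussian]
  norm_num

/-! ### The hypotheses `⊥ v_j`, `⊥ ‖v‖²` and the mean `E F = 3` -/

/-- `F ⊥ v_j` under `M_{1,1,u₀}`: `j = 0` by `√5·E‖ξ‖² − 3√5·Eξ₀² = 0`, `j ≠ 0` by oddness in `ξ_j`. [folklore] -/
theorem gS_orth_mom (j : Fin 3) : ∫ v, gS v * v j * localMaxwellian 1 1 uS v = 0 := by
  rw [integral_mul_localMaxwellian_shift one_pos uS (fun v => gS v * v j)]
  simp only [Real.sqrt_one, one_smul, gS_shift, PiLp.add_apply, uS_apply]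
  obtain ⟨hq, hq3⟩ := integral_q
  fin_cases j
  · simp only [Fin.zero_eta, Fin.isValue, if_true]
    -- even part `√5 q − 3√5 ξ₀²`, odd part `q ξ₀ − 15 ξ₀`
    have hsplit : ∀ ξ : V3, (ξ 0 ^ 2 + ξ 1 ^ 2 + ξ 2 ^ 2 - 3 * Real.sqrt 5 * ξ 0) * (Real.sqrt 5 + ξ 0) =
        (Real.sqrt 5 * (ξ 0 ^ 2 + ξ 1 ^ 2 + ξ 2 ^ 2) - 3 * Real.sqrt 5 * ξ 0 ^ 2) +
          (1 * ((ξ 0 ^ 2 + ξ 1 ^ 2 + ξ 2 ^ 2) * ξ 0) + (-(3 * (Real.sqrt 5 * Real.sqrt 5))) * ξ 0) := by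
      intro ξ; ring
    simp_rw [hsplit]
    have hE : Integrable (fun ξ : V3 => Real.sqrt 5 * (ξ 0 ^ 2 + ξ 1 ^ 2 + ξ 2 ^ 2) - 3 * Real.sqrt 5 * ξ 0 ^ 2)
        (stdGaussian V3) :=
      (hq.const_mul _).sub ((memLp_coord_stdGaussian (ι := Fin 3) 0 2 (by simp)).integrable_sq.const_mul _)
    rw [integral_add hE (integrable_odd_part _ _), integral_odd_part, add_zero,
      integral_sub (hq.const_mul _) ((memLp_coord_stdGaussian (ι := Fin 3) 0 2 (by simp)).integrable_sq.const_mul _),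
      integral_const_mul, integral_const_mul, hq3, integral_coord_sq_stdGaussian]
    ring
  · simp only [Fin.mk_one, Fin.isValue, show (1 : Fin 3) ≠ 0 by decide, if_false, zero_add]
    exact integral_stdGaussian_eq_zero_of_odd (reflB 1)
      (G := fun ξ : V3 => (ξ 0 ^ 2 + ξ 1 ^ 2 + ξ 2 ^ 2 - 3 * Real.sqrt 5 * ξ 0) * ξ 1) fun ξ => by
        simp only [reflB_apply, if_true, show (0 : Fin 3) ≠ 1 by decide, show (2 : Fin 3) ≠ 1 by decide, if_false]
        ring
  · simp only [Fin.reduceFinMk, Fin.isValue, show (2 : Fin 3) ≠ 0 by decide, if_false, zero_add]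
    exact integral_stdGaussian_eq_zero_of_odd (reflB 2)
      (G := fun ξ : V3 => (ξ 0 ^ 2 + ξ 1 ^ 2 + ξ 2 ^ 2 - 3 * Real.sqrt 5 * ξ 0) * ξ 2) fun ξ => by
        simp only [reflB_apply, if_true, show (0 : Fin 3) ≠ 2 by decide, show (1 : Fin 3) ≠ 2 by decide, if_false]
        ring

/-- `F ⊥ ‖v‖²` under `M_{1,1,u₀}`: even part `5E‖ξ‖² + E‖ξ‖⁴ − 30Eξ₀² = 15 + 15 − 30`, odd part `0`. [folklore] -/
theorem gS_orth_energy : ∫ v, gS v * ‖v‖ ^ 2 * localMaxwellian 1 1 uS v = 0 := by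
  rw [integral_mul_localMaxwellian_shift one_pos uS (fun v => gS v * ‖v‖ ^ 2)]
  simp only [Real.sqrt_one, one_smul, gS_shift]
  have hn : ∀ ξ : V3, ‖uS + ξ‖ ^ 2 = (Real.sqrt 5 + ξ 0) ^ 2 + ξ 1 ^ 2 + ξ 2 ^ 2 := by
    intro ξ
    rw [norm_sq_eq_three]
    simp [PiLp.add_apply, uS_apply]
  simp_rw [hn]
  obtain ⟨hq, hq3⟩ := integral_q
  have hsplit : ∀ ξ : V3, (ξ 0 ^ 2 + ξ 1 ^ 2 + ξ 2 ^ 2 - 3 * Real.sqrt 5 * ξ 0) *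
      ((Real.sqrt 5 + ξ 0) ^ 2 + ξ 1 ^ 2 + ξ 2 ^ 2) =
      ((Real.sqrt 5 * Real.sqrt 5) * (ξ 0 ^ 2 + ξ 1 ^ 2 + ξ 2 ^ 2) +
        (ξ 0 ^ 2 + ξ 1 ^ 2 + ξ 2 ^ 2) * (ξ 0 ^ 2 + ξ 1 ^ 2 + ξ 2 ^ 2) -
        6 * (Real.sqrt 5 * Real.sqrt 5) * ξ 0 ^ 2) +
      ((-Real.sqrt 5) * ((ξ 0 ^ 2 + ξ 1 ^ 2 + ξ 2 ^ 2) * ξ 0) +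
        (-(3 * Real.sqrt 5 * (Real.sqrt 5 * Real.sqrt 5))) * ξ 0) := by
    intro ξ; ring
  simp_rw [hsplit]
  have hi4 : Integrable (fun ξ : V3 => (ξ 0 ^ 2 + ξ 1 ^ 2 + ξ 2 ^ 2) * (ξ 0 ^ 2 + ξ 1 ^ 2 + ξ 2 ^ 2))
      (stdGaussian V3) := by
    refine integrable_of_le_cube (by fun_prop) 1 fun ξ => ?_
    have hq' : ξ 0 ^ 2 + ξ 1 ^ 2 + ξ 2 ^ 2 = ‖ξ‖ ^ 2 := (norm_sq_eq_three ξ).symm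
    rw [hq', abs_of_nonneg (by positivity)]
    nlinarith [sq_nonneg ‖ξ‖, sq_nonneg (‖ξ‖ ^ 2)]
  have h2 : Integrable (fun ξ : V3 => ξ 0 ^ 2) (stdGaussian V3) :=
    (memLp_coord_stdGaussian (ι := Fin 3) 0 2 (by simp)).integrable_sq
  have hE1 : Integrable (fun ξ : V3 => (Real.sqrt 5 * Real.sqrt 5) * (ξ 0 ^ 2 + ξ 1 ^ 2 + ξ 2 ^ 2) +
      (ξ 0 ^ 2 + ξ 1 ^ 2 + ξ 2 ^ 2) * (ξ 0 ^ 2 + ξ 1 ^ 2 + ξ 2 ^ 2)) (stdGaussian V3) := (hq.const_mul _).add hi4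
  have hE : Integrable (fun ξ : V3 => (Real.sqrt 5 * Real.sqrt 5) * (ξ 0 ^ 2 + ξ 1 ^ 2 + ξ 2 ^ 2) +
      (ξ 0 ^ 2 + ξ 1 ^ 2 + ξ 2 ^ 2) * (ξ 0 ^ 2 + ξ 1 ^ 2 + ξ 2 ^ 2) -
      6 * (Real.sqrt 5 * Real.sqrt 5) * ξ 0 ^ 2) (stdGaussian V3) := hE1.sub (h2.const_mul _)
  rw [integral_add hE (integrable_odd_part _ _), integral_odd_part, add_zero, integral_sub hE1 (h2.const_mul _),
    integral_add (hq.const_mul _) hi4, integral_const_mul, integral_const_mul, hq3, integral_norm_pow_four_coord,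
    integral_coord_sq_stdGaussian, sqrt5_mul_self]
  norm_num

/-- **The mean of the witness under its own reference Maxwellian is `E F = E‖ξ‖² = 3 = θ tr A ≠ 0`.** [folklore] -/
theorem integral_gS_gaussMeasure : ∫ v, gS v ∂gaussMeasure uS 1 = 3 := by
  rw [integral_gaussMeasure uS one_pos]
  simp only [Real.sqrt_one, one_smul, gS_shift]
  obtain ⟨hq, hq3⟩ := integral_q
  rw [integral_sub hq (((memLp_coord_stdGaussian (ι := Fin 3) 0 1 (by simp)).integrable le_rfl).const_mul _),
    integral_const_mul, hq3, integral_coord_stdGaussian]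
  ring

/-- **Jensen floor for the witness**: under its flow-invariant reference law (constant drift `u₀`), for every
`0 < σ ≤ 1/2`, `N`, flow, window and `β`, `exp(3β(N+1)) ≤ ∫ exp(β ∑ᵢ w⁻¹∫₀ʷ F(vᵢ(r)) dr) dG_N^{u₀}`. [folklore] -/
theorem exp_le_lintegral_exp_gS_window {σ : ℝ} (hσ2 : σ ≤ 1 / 2) {N : ℕ}
    (Φ : HardSphereFlow (Torus.geometry (Fin 3)) (hsDiameter σ N) (N + 1)) {w : ℝ} (hw : 0 < w) (β : ℝ) :
    ENNReal.ofReal (Real.exp (3 * β * ((N : ℝ) + 1))) ≤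
      ∫⁻ z, ENNReal.ofReal (Real.exp (β * (∑ i, w⁻¹ * ∫ r in (0 : ℝ)..w, gS ((Φ.flow r z) i).2))) ∂(localGibbsLaw σ (fun _ => 1) (fun _ => uS) (fun _ => 1) N Φ) := by
  haveI := isProbabilityMeasure_driftLaw hσ2 uS Φ
  have hW : Integrable (fun z => ∑ i, w⁻¹ * ∫ r in (0 : ℝ)..w, gS ((Φ.flow r z) i).2) (localGibbsLaw σ (fun _ => 1) (fun _ => uS) (fun _ => 1) N Φ) :=
    integrable_windowSum hσ2 Φ uS hw continuous_gS abs_gS_le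
  have hJ := ofReal_exp_integral_le_lintegral (localGibbsLaw σ (fun _ => 1) (fun _ => uS) (fun _ => 1) N Φ) (hW.const_mul β)
  rw [integral_const_mul, integral_windowSum hσ2 Φ uS hw continuous_gS abs_gS_le, integral_gS_gaussMeasure] at hJ
  have hexp : 3 * β * ((N : ℝ) + 1) = β * (((N : ℝ) + 1) * 3) := by ring
  rw [hexp]
  exact hJ

end KineticCurrentsWindowLDUniformLoadBearing

open KineticCurrentsWindowLDUniformOneSphere KineticCurrentsWindowTilt KineticCurrentsWindowLDUniformLoadBearing

/-! ### The variant without `⊥ 1` -/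

/-- **A FALSE proposition — NOT a citable fact.** The crux `OneFlightGossipEngine.KineticCurrentsWindowLDUniform`
(stmt-AtomisticToContinuum-14662) VERBATIM with the hypothesis `∀ x, ∫ F(x,v) M_{1,u₀(x),θ₀(x)}(v) dv = 0` DELETED; kept
only as the statement that `not_kineticCurrentsWindowLDUniformWithoutOrthOne` negates (load-bearing analysis:
orthogonality to the constants is necessary). [folklore] -/
def KineticCurrentsWindowLDUniformWithoutOrthOne : Prop :=
  ∃ η₀ : ℝ, 0 < η₀ ∧ ∀ (a θ₀ : Literature.MathematicalPhysics.KineticTheory.T3 → ℝ) (u₀ : Literature.MathematicalPhysics.KineticTheory.T3 → Literature.MathematicalPhysics.KineticTheory.V3), Continuous a → Continuous θ₀ → Continuous u₀ → (∀ x, 0 < a x) → (∀ x, 0 < θ₀ x) → ∀ σ : ℝ, 0 < σ → σ ^ 3 * (⨆ x, a x) ≤ η₀ * ∫ x, a x → ∀ Φ : (N : ℕ) → Literature.Analysis.FluidPDE.HardSphereFlow (Literature.Analysis.FluidPDE.Torus.geometry (Fin 3)) (Literature.MathematicalPhysics.KineticTheory.hsDiameter σ N) (N + 1), ∀ (A :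 Literature.MathematicalPhysics.KineticTheory.T3 → Fin 3 → Fin 3 → ℝ) (b : Literature.MathematicalPhysics.KineticTheory.T3 → Literature.MathematicalPhysics.KineticTheory.V3) (G : Literature.MathematicalPhysics.KineticTheory.T3 × ℝ → ℝ), Continuous A → Continuous b → Continuous G → (∃ C : ℝ, ∀ y : Literature.MathematicalPhysics.KineticTheory.T3 × Literature.MathematicalPhysics.KineticTheory.V3, |(fun y : Literature.MathematicalPhysics.KineticTheory.T3 × Literature.MathematicalPhysics.KineticTheory.V3 => ((∑ j : Fin 3, ∑ k : Fin 3, A y.1 j k * ((y.2 - u₀ y.1) j * (y.2 - u₀ y.1) k)) + (∑ j : Fin 3, b y.1 j * (y.2 - u₀ y.1) j) * G (y.1, ‖y.2 - u₀ y.1‖ ^ 2))) y| ≤ C * (1 + ‖y.2‖ ^ 2)) → (∀ x (j : Fin 3), ∫ v, (fun y : Literature.MathematicalPhysics.KineticTheory.T3 × Literature.MathematicalPhysics.KineticTheory.V3 => ((∑ j : Fin 3, ∑ k : Fin 3, A y.1 j k * ((y.2 - u₀ y.1) j * (y.2 - u₀ y.1) k)) + (∑ j : Fin 3, b y.1 j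 * (y.2 - u₀ y.1) j) * G (y.1, ‖y.2 - u₀ y.1‖ ^ 2))) (x, v) * v j * Literature.Analysis.FluidPDE.localMaxwellian 1 (θ₀ x) (u₀ x) v = 0) → (∀ x, ∫ v, (fun y : Literature.MathematicalPhysics.KineticTheory.T3 × Literature.MathematicalPhysics.KineticTheory.V3 => ((∑ j : Fin 3, ∑ k : Fin 3, A y.1 j k * ((y.2 - u₀ y.1) j * (y.2 - u₀ y.1) k)) + (∑ j : Fin 3, b y.1 j * (y.2 - u₀ y.1) j) * G (y.1, ‖y.2 - u₀ y.1‖ ^ 2))) (x, v) * ‖v‖ ^ 2 * Literature.Analysis.FluidPDE.localMaxwellian 1 (θ₀ x) (u₀ x) v = 0) → ∃ β₀ : ℝ, 0 < β₀ ∧ ∀ β : ℝ, |β| ≤ β₀ → ∀ ε : ℝ, 0 < ε → ∃ τ : ℝ, 0 < τ ∧ ∃ N₀ : ℕ, ∀ N : ℕ, N₀ ≤ N → ∫⁻ z, ENNReal.ofReal (Real.exp (β * ∑ i : Fin (N + 1), (τ * ((N : ℝ) + 1) ^ (-(1 / 3 : ℝ)))⁻¹ * ∫ r in (0 : ℝ)..(τ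 * ((N : ℝ) + 1) ^ (-(1 / 3 : ℝ))), (fun y : Literature.MathematicalPhysics.KineticTheory.T3 × Literature.MathematicalPhysics.KineticTheory.V3 => ((∑ j : Fin 3, ∑ k : Fin 3, A y.1 j k * ((y.2 - u₀ y.1) j * (y.2 - u₀ y.1) k)) + (∑ j : Fin 3, b y.1 j * (y.2 - u₀ y.1) j) * G (y.1, ‖y.2 - u₀ y.1‖ ^ 2))) (((Φ N).flow r z) i))) ∂(Literature.MathematicalPhysics.KineticTheory.localGibbsLaw σ a u₀ θ₀ N (Φ N)) ≤ ENNReal.ofReal (Real.exp (ε * ((N : ℝ) + 1)))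

/-- **ORTHOGONALITY TO `1` IS LOAD-BEARING**: without it the crux is false. Witness: `η₀` arbitrary, `a = θ₀ = 1`,
`u₀ ≡ √5e₀` (`|u₀|² = 5θ₀`), `σ = min(1/4, η₀, 1)`, Alexander flows, `A = I`, `b ≡ −3√5e₀`, `G ≡ 1`: given `β₀ > 0`
take `β = ε = β₀`; whatever `τ, N₀`, at `N = N₀` Jensen under the invariant drifted reference law gives
`≥ e^{3β₀(N₀+1)} > e^{β₀(N₀+1)}` (`exp_le_lintegral_exp_gS_window`). [folklore] -/
theorem not_kineticCurrentsWindowLDUniformWithoutOrthOne : ¬ KineticCurrentsWindowLDUniformWithoutOrthOne := by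
  rintro ⟨η₀, hη₀, h⟩
  obtain ⟨hσpos, hσ4, -, -⟩ := sigmaOf_spec hη₀
  have hσhalf : sigmaOf η₀ ≤ 1 / 2 := hσ4.trans (by norm_num)
  have hσhalf' : sigmaOf η₀ < 2⁻¹ := hσ4.trans_lt (by norm_num)
  have hmain := h (fun _ => 1) (fun _ => 1) (fun _ => uS) continuous_const continuous_const
    continuous_const (fun _ => one_pos) (fun _ => one_pos) (sigmaOf η₀) hσpos (guard_sigmaOf hη₀)
    (alexFlow hσpos hσhalf') Aid bS G1 continuous_const continuous_const continuous_const
  have hmain' : (∃ C : ℝ, ∀ y : T3 × V3, |gS y.2| ≤ C * (1 + ‖y.2‖ ^ 2)) →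
      (∀ (x : T3) (j : Fin 3), ∫ v, gS v * v j * localMaxwellian 1 1 uS v = 0) →
      (∀ x : T3, ∫ v, gS v * ‖v‖ ^ 2 * localMaxwellian 1 1 uS v = 0) →
      ∃ β₀ : ℝ, 0 < β₀ ∧ ∀ β : ℝ, |β| ≤ β₀ → ∀ ε : ℝ, 0 < ε → ∃ τ : ℝ, 0 < τ ∧ ∃ N₀ : ℕ, ∀ N : ℕ, N₀ ≤ N →
        ∫⁻ z, ENNReal.ofReal (Real.exp (β * ∑ i : Fin (N + 1), (τ * ((N : ℝ) + 1) ^ (-(1 / 3 : ℝ)))⁻¹ *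
          ∫ r in (0 : ℝ)..(τ * ((N : ℝ) + 1) ^ (-(1 / 3 : ℝ))),
            gS (((alexFlow hσpos hσhalf' N).flow r z) i).2))
          ∂(localGibbsLaw (sigmaOf η₀) (fun _ => 1) (fun _ => uS) (fun _ => 1) N (alexFlow hσpos hσhalf' N)) ≤
        ENNReal.ofReal (Real.exp (ε * ((N : ℝ) + 1))) := by
    simpa only [F_S] using hmain
  clear hmain h
  obtain ⟨β₀, hβ₀, hβ⟩ := hmain' ⟨46, fun y => by have := abs_gS_le y.2; rwa [pow_one] at this⟩
    (fun _ j => gS_orth_mom j) (fun _ => gS_orth_energy)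
  obtain ⟨τ, hτ, N₀, hN⟩ := hβ β₀ (by rw [abs_of_pos hβ₀]) β₀ hβ₀
  have h0 := hN N₀ le_rfl
  have hw : 0 < τ * ((N₀ : ℝ) + 1) ^ (-(1 / 3 : ℝ)) := mul_pos hτ (Real.rpow_pos_of_pos (by positivity) _)
  have hlow := exp_le_lintegral_exp_gS_window hσhalf (alexFlow hσpos hσhalf' N₀) hw β₀
  have hle : ENNReal.ofReal (Real.exp (3 * β₀ * ((N₀ : ℝ) + 1))) ≤
      ENNReal.ofReal (Real.exp (β₀ * ((N₀ : ℝ) + 1))) := hlow.trans h0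
  rw [ENNReal.ofReal_le_ofReal_iff (Real.exp_pos _).le, Real.exp_le_exp] at hle
  have hN1 : (0 : ℝ) < (N₀ : ℝ) + 1 := by positivity
  nlinarith [hle, mul_pos hβ₀ hN1]

end Summit.AtomisticToContinuum.HydrodynamicLimit.Cruxes.KineticCurrentsWindowLDUniform.Disproof

end
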